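import Literature.Analysis.FluidPDE.NSEnstrophyPersistence
import Literature.Analysis.FluidPDE.NewtonPotential
import Literature.Analysis.FluidPDE.NSWeakStrongUniquenessProofs
import Literature.Analysis.FluidPDE.TaoLocalisationProofs
import HarnessLib

/-!
# Bounded total speed for strong solutions (Tao 2011, Prop. 9.1, in the strong class), via
# the Foias–Guillopé–Temam normalised-enstrophy estimate and Agmon's inequality — PROVED

This file proves, for classical solutions `u` of the unforced Navier–Stokes system on the closed
slab `[0, T] × ℝ³` (`Fluid.IsClassicalNSSolutionOn (Icc 0 T) ν 0 u p`) which are *strong* in the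
sense `u ∈ L^∞_t H^k_x` for all `k` (`NS.HasBoundedSobolevNormsOn (Icc 0 T) u`), the total speed
bound

  `∫₀ᵀ ‖u(t)‖_{L^∞_x} dt ≤ K (ν^{-3/4} E^{1/2} T^{1/4} + ν⁻² E)`   whenever `ν ∫₀ᵀ ∫ |∇u|² ≤ E`,

with an absolute constant `K` (`NS.tao2011_boundedTotalSpeed_of_hasBoundedSobolevNormsOn`). This is
the conclusion of Tao's Prop. 9.1 (arXiv:1108.1165, Prop. 52, p. 27: for finite energy almost
smooth solutions, `‖u‖_{L¹_t L^∞_x([0,T] × ℝ³)} ≲ E^{1/2}T^{1/4} + E` at `ν = 1`; the displayed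
`ν`-dependence is the footnote-3 rescaling, as in `NS.tao2011_boundedTotalSpeed`), restricted to
the strong class, where it admits an elementary energy-method proof that avoids Tao's
Littlewood–Paley analysis of the Duhamel formula: it is the whole-space, quantitative form of the
classical bound `u ∈ L¹(0, T; L^∞)` of Foias–Guillopé–Temam (1981) (Robinson–Rodrigo–Sadowski
2016, Lemma 8.15, (8.6)–(8.7), held copy pp. 129–130; recalled on p. 264 with (17.17)), obtained
there by "dividing both sides of `d/dt ‖∇u‖² + ‖Au‖² ≤ c‖∇u‖⁶` by `‖∇u‖⁴` … integrating in
time", Hölder's inequality in time and Agmon's inequality `‖u‖_{L^∞} ≤ c‖u‖^{1/2}_{H¹}‖u‖^{1/2}_{H²}`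
(ibid., Thm. 1.20, held copy p. 35). Only the dissipation bound `ν∫₀ᵀ∫|∇u|² ≤ E` is used.

## The argument (all steps proved here; `y = ∫|Ω|²`, `z = ∫|∇Ω|²`, `aₘ = ∫|∇ᵐu|²`, `Ω_{ki} = ∂ₖuᵢ − ∂ᵢuₖ`)

1. **Agmon's inequality on `ℝ³`** (`NS.abs_le_agmon_two_param`, `NS.norm_apply_le_agmon`): from
   the Green representation `φ(x) = ∫ Γ₀^{ρ,2ρ}(z) Δφ(x+z) dz + ∫ λ^{ρ,2ρ}(z) φ(x+z) dz` of the
   tree (`NewtonPotential.lean`: `integral_newtonNear_mul_laplacian`, truncated Newton kernel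
   `newtonNear`, `newtonFarLaplacian`), Cauchy–Schwarz with `∫(Γ₀^{ρ,2ρ})² = ρ∫(Γ₀^{1,2})²`,
   Hölder `(6/5, 6)` with `‖λ^{ρ,2ρ}‖_{6/5} = ρ^{-1/2}‖λ^{1,2}‖_{6/5}` and the Sobolev inequality
   `H¹ ⊂ L⁶` (tree: `Fluid.eLpNorm_six_le_frobenius_of_hasWeakGradient`), then `ρ = (a₁/a₂)^{1/2}`:
   `|v(x)| ≤ A (a₁ a₂)^{1/4}`, `A = NS.agmonConst`.
2. **Global div–curl** (`integral_levelSq_succ_le_integral_vortSq`): `a_{m+1} ≤ ∫|∇ᵐΩ|²` for smooth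
   divergence-free `v` with `|∇ᵐv|², |∇ᵐ⁺¹v|² ∈ L¹` (cutoff version from `NSVorticitySlice`, cutoff
   removed by dominated convergence); hence `a₁ ≤ y`, `a₂ ≤ z` and `‖u(t)‖_∞ ≤ A (y z)^{1/4}`.
3. **The enstrophy inequality at cutoff level** (`enstrophy_pairing_le`,
   `IsClassicalNSSolutionOn.enstrophy_pairing_cutoff_le`): with `χ_R` the standard cutoff,
   `d/dt ∫χ_R⁴|Ω|² ≤ −(3/2)ν∫χ_R⁴|∇Ω|² + (96ν(C/R)² + 12(C/R)B) y + N`, where the vortex-stretching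
   term is bounded by Hölder and the `L⁴` Gagliardo–Nirenberg interpolation,
   `N ≤ 1944 K^{3/2} y^{1/2} a₁^{1/4} (2a₂ + 2(C/R)²a₁)^{3/4}` (`EnergyToolkit`), and `B = sup|u|`
   (finite for strong solutions: `NS.linfty_bound_of_hasBoundedSobolevNormsOn_holds`). The
   identity `∫χ⁴|Ω|²(t) − ∫χ⁴|Ω|²(0) = ∫₀ᵗ(pairing)` is the level-zero case of
   `IsClassicalNSSolutionOn.integral_cutoff_vortSq_sub_eq` (`NSEnstrophyPersistence`).
4. **FGT at cutoff level, then `R → ∞`** (`StrongData.fgt_limit`, `StrongData.fgt_dissipation`):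
   for `α > 0` the function `−(α + y_R)⁻¹` is `C¹` on `(0,T)` (FTC), so integrating
   `y_R'/(α+y_R)² ≤ (−(3/2)νD_R + … )/(α+y_R)²` and letting `R → ∞` (dominated convergence; all
   slice quantities are bounded on `[0,T]` for a strong solution) gives, after absorbing the
   stretching term by Young (`N ≤ (ν/2) z + C_Y ν⁻³ y³`, `C_Y = youngConst`),
   `ν ∫₀ᵀ z/(α+y)² ≤ α⁻¹ + C_Y ν⁻³ ∫₀ᵀ y` — the normalisation by `(α + y)²` instead of `y²`
   dispenses with the non-vanishing of `‖∇u‖` used in the book.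
5. **Hölder in time and the choice `α = E/(νT)`** (`StrongData.integral_rpow_quarter_le`,
   `StrongData.integral_rpow_quarter_le_energy`): `∫₀ᵀ(yz)^{1/4} ≤ (∫₀ᵀ z/(α+y)²)^{1/4}(αT + ∫₀ᵀy)^{3/4}`,
   `∫₀ᵀ y ≤ 4E/ν`, whence `∫₀ᵀ (yz)^{1/4} ≤ 5^{3/4}(1 + (4C_Y)^{1/4})(ν^{-3/4}E^{1/2}T^{1/4} + ν⁻²E)`.

Measurability in time of `y`, `z`, `aₘ` is obtained by exhibiting them as pointwise limits of the
cutoff quantities, which are continuous on `[0, T]` (`NSEnstrophyPersistence`).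

## Main declarations

* `NS.newtonNearSqInt`, `NS.newtonFarLaplacianL65`, `NS.agmonConst`: the constants of Agmon's
  inequality; `NS.abs_le_agmon_two_param`, `NS.abs_apply_le_agmon_comp`, `NS.norm_apply_le_agmon`.
* `Fluid.enstrophy_pairing_le`, `Fluid.stretchConst`, `Fluid.youngConst`, `Fluid.speedConst`.
* `Fluid.enstrophyAt`, `Fluid.palinstrophyAt`, `Fluid.levelInt`, `Fluid.enstrophyCut`,
  `Fluid.palinstrophyCut`, `Fluid.pairingCut`, `Fluid.stretchAt`: the slice functionals;
  `Fluid.StrongData`: the pointwise-in-time structure constants of a strong solution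
  (`IsClassicalNSSolutionOn.nonempty_strongData`).
* `Fluid.StrongData.fgt_dissipation`, `Fluid.StrongData.lintegral_eLpNorm_top_le`,
  `NS.tao2011_boundedTotalSpeed_of_hasBoundedSobolevNormsOn` (the packaged statement, in the
  dictionary of `NS.tao2011_boundedTotalSpeed` / `NS.tao2011_enstrophyLocalisation_exterior_apriori`:
  lower time integral over `(0, T)` of `eLpNorm (u t) ∞ volume`).

## Mathlib / tree search

`lean search 'Agmon|agmon'`: nothing in Mathlib or the tree. `lean search 'totalSpeed|TotalSpeed'`:
only the named facts `NS.tao2011_boundedTotalSpeed(_unit|_apriori_unit)` and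
`NS.tao2011_duhamelNonlinearSpeed_unit` (`TaoEnstrophyLocalisationParts`, `TaoUnitViscosity`,
`TaoBoundedTotalSpeed`), all for Tao's general finite energy class and unproved. Used from the
tree: `NewtonPotential`/`NewtonKernel` (Green representation), `NSWeakStrongUniquenessProofs`
(`Fluid.eLpNorm_six_le_frobenius_of_hasWeakGradient`), `CoordDerivatives`, `EnergyToolkit`,
`NSVorticityEnergy`, `NSVorticitySlice`, `NSEnstrophyPersistence` (coordinate vorticity calculus,
cutoff energy identities), `TaoLocalisationProofs` (`NS.linfty_bound_of_hasBoundedSobolevNormsOn_holds`).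
Mathlib: `integral_mul_le_Lp_mul_Lq_of_nonneg`, `intervalIntegral.integral_hasDerivAt_right`,
`tendsto_integral_of_dominated_convergence`, `eLpNormEssSup_le_of_ae_bound`,
`Measure.integral_comp_smul`, `Measure.map_addHaar_smul`.

## References

* T. Tao, *Localisation and compactness properties of the Navier–Stokes global regularity
  problem*, Anal. PDE 6 (2013) 25–107 = arXiv:1108.1165 (`Tao2011`): Prop. 9.1 (arXiv Prop. 52,
  p. 27), footnote 3 (rescaling).
* J. C. Robinson, J. L. Rodrigo, W. Sadowski, *The Three-Dimensional Navier–Stokes Equations: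
  Classical Theory*, CUP 2016 (`RobinsonRodrigoSadowski2016`): Thm. 1.20 (Agmon's inequality,
  held copy p. 35), Lemma 8.15 with (8.6)–(8.7) and its proof (§8.4, held copy pp. 129–130),
  (17.17) (held copy p. 264).
* C. Foias, C. Guillopé, R. Temam, *New a priori estimates for Navier–Stokes equations in
  dimension 3*, Comm. PDE 6 (1981) 329–359 (`FoiasGuillopeTemam1981`): the original source of
  the normalised-enstrophy estimate (as attributed in RRS 2016, §8.4).
* C. R. Doering, J. D. Gibbon, *Applied Analysis of the Navier–Stokes Equations*, CUP 1995
  (`DoeringGibbon1995`): §6.1, (6.1.5)–(6.1.6) (the div–curl identity `‖∇u‖₂ = ‖ω‖₂`).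
-/

open MeasureTheory Set Filter Topology
open scoped ENNReal NNReal ContDiff

namespace Literature.Analysis.FluidPDE

open Metric Real
open scoped Laplacian

/-- Local notation for physical space `ℝ³ = EuclideanSpace ℝ (Fin 3)`. -/
local notation "ℝ³" => EuclideanSpace ℝ (Fin 3)

/-! ## Agmon's inequality on `ℝ³` via the Green representation formula -/

section Agmon

/-- `Γ₀^{1,2} ∈ L²(ℝ³)`: `|Γ₀(z)|² ≤ (4π)⁻²|z|⁻²` with `2 < 3 = dim`, and compact support. [folklore] -/
theorem integrable_newtonNear_sq : Integrable fun z : ℝ³ => newtonNear 1 2 z ^ 2 := by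
  have hsupp : Function.support (fun z : ℝ³ => newtonNear 1 2 z ^ 2) ⊆ ball (0 : ℝ³) 3 := by
    intro z hz
    rw [mem_ball_zero_iff]
    by_contra h
    have : newtonNear 1 2 z = 0 := newtonNear_eq_zero zero_le_one one_lt_two (by linarith [not_lt.1 h])
    exact hz (by simp [this])
  rw [← integrableOn_iff_integrable_of_support_subset hsupp]
  refine integrableOn_ball_of_norm_le_rpow (by rw [finrank_euclideanSpace_fin]; norm_num)
    (C := ((4 * π)⁻¹) ^ 2) (α := 2) (by rw [finrank_euclideanSpace_fin]; norm_num)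
    (Eventually.of_forall fun z => ?_)
    ((measurable_newtonNear 1 2).pow_const 2).aestronglyMeasurable
  rw [norm_pow, Real.norm_eq_abs]
  by_cases hz : z = 0
  · subst hz
    simp [newtonNear, newtonKernel_eq]
    positivity
  have hzn : 0 < ‖z‖ := norm_pos_iff.2 hz
  calc |newtonNear 1 2 z| ^ 2 ≤ ((4 * π * ‖z‖)⁻¹) ^ 2 :=
        pow_le_pow_left₀ (abs_nonneg _) (abs_newtonNear_le 1 2 z) 2
    _ = ((4 * π)⁻¹) ^ 2 * ‖z‖ ^ (-(2 : ℝ)) := by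
        rw [Real.rpow_neg hzn.le, mul_inv, mul_pow]
        norm_cast
        rw [inv_pow, inv_pow]

/-- The squared `L²` norm of the truncated Newton kernel `Γ₀^{1,2}`. [folklore] -/
noncomputable def newtonNearSqInt : ℝ := ∫ z : ℝ³, newtonNear 1 2 z ^ 2

/-- `0 ≤ ∫ (Γ₀^{1,2})²`. [folklore] -/
theorem newtonNearSqInt_nonneg : 0 ≤ newtonNearSqInt :=
  integral_nonneg fun _ => sq_nonneg _

/-- Scaling: `∫ (Γ₀^{ρ,2ρ})² = ρ ∫ (Γ₀^{1,2})²`. [folklore] -/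
theorem integral_newtonNear_sq_scale {ρ : ℝ} (hρ : 0 < ρ) :
    ∫ z : ℝ³, newtonNear ρ (2 * ρ) z ^ 2 = ρ * newtonNearSqInt := by
  have h1 : ∀ z : ℝ³, newtonNear ρ (2 * ρ) z = ρ⁻¹ * newtonNear 1 2 (ρ⁻¹ • z) := by
    intro z
    have := newtonNear_scale hρ 1 2 z
    simpa [mul_comm] using this
  simp_rw [h1, mul_pow]
  rw [integral_const_mul]
  have h2 : ∫ z : ℝ³, newtonNear 1 2 (ρ⁻¹ • z) ^ 2 = |(ρ⁻¹ ^ Module.finrank ℝ ℝ³)⁻¹| * newtonNearSqInt := by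
    have := MeasureTheory.Measure.integral_comp_smul (μ := (volume : Measure ℝ³))
      (fun z : ℝ³ => newtonNear 1 2 z ^ 2) ρ⁻¹
    rw [this, newtonNearSqInt, smul_eq_mul, abs_inv]
  rw [h2, finrank_euclideanSpace_fin]
  have h3 : |((ρ⁻¹) ^ 3)⁻¹| = ρ ^ 3 := by
    rw [inv_pow, inv_inv, abs_of_pos (pow_pos hρ 3)]
  rw [h3]
  field_simp

/-- Scaling in the form produced by `newtonNear_scale`: `∫ (Γ₀^{ρ·1,ρ·2})² = ρ ∫ (Γ₀^{1,2})²`.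
[folklore] -/
theorem integral_newtonNear_sq_scale' {ρ : ℝ} (hρ : 0 < ρ) :
    ∫ z : ℝ³, newtonNear (ρ * 1) (ρ * 2) z ^ 2 = ρ * newtonNearSqInt := by
  rw [mul_one, mul_comm ρ 2]
  exact integral_newtonNear_sq_scale hρ

end Agmon

section Agmon2

/-- Change of variables in `L^p(ℝ³)`: `‖f(c ·)‖_{L^p} = |c³|^{-1/p} ‖f‖_{L^p}` for `c ≠ 0`
(`MeasureTheory.Measure.map_addHaar_smul`). [folklore] -/
theorem eLpNorm_comp_smul_three (p : ℝ≥0∞) (f : ℝ³ → ℝ) {c : ℝ} (hc : c ≠ 0) :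
    eLpNorm (fun x => f (c • x)) p volume =
      ENNReal.ofReal |(c ^ 3)⁻¹| ^ (1 / p).toReal * eLpNorm f p volume := by
  have hemb : MeasurableEmbedding (fun x : ℝ³ => c • x) :=
    (Homeomorph.smul (Units.mk0 c hc)).measurableEmbedding
  have h0 : ENNReal.ofReal |(c ^ 3)⁻¹| ≠ 0 :=
    (ENNReal.ofReal_pos.2 (abs_pos.2 (inv_ne_zero (pow_ne_zero _ hc)))).ne'
  rw [← Function.comp_def f, ← hemb.eLpNorm_map_measure, Measure.map_addHaar_smul volume hc,
    finrank_euclideanSpace_fin, eLpNorm_smul_measure_of_ne_zero h0, smul_eq_mul]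

/-- `‖f(ρ ·)‖_{L⁶(ℝ³)} = ρ^{-1/2} ‖f‖_{L⁶(ℝ³)}` for `ρ > 0`. [folklore] -/
theorem eLpNorm_six_comp_smul {ρ : ℝ} (hρ : 0 < ρ) (f : ℝ³ → ℝ) :
    eLpNorm (fun x => f (ρ • x)) 6 volume =
      ENNReal.ofReal (ρ ^ (-(1 / 2 : ℝ))) * eLpNorm f 6 volume := by
  rw [eLpNorm_comp_smul_three 6 f hρ.ne']
  congr 1
  have h3 : |(ρ ^ 3)⁻¹| = ρ ^ (-(3 : ℝ)) := by
    rw [abs_of_pos (inv_pos.2 (pow_pos hρ 3)), Real.rpow_neg hρ.le]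
    norm_cast
  rw [h3, ENNReal.ofReal_rpow_of_pos (Real.rpow_pos_of_pos hρ _), ← Real.rpow_mul hρ.le]
  congr 1
  norm_num

/-- The `L^{6/5}` size of `λ^{1,2} = ΔΓ∞^{1,2}`: `(∫ |λ^{1,2}|^{6/5})^{5/6}`. [folklore] -/
noncomputable def newtonFarLaplacianL65 : ℝ :=
  (∫ z : ℝ³, |newtonFarLaplacian 1 2 z| ^ (6 / 5 : ℝ)) ^ (5 / 6 : ℝ)

/-- `0 ≤ ‖λ^{1,2}‖_{L^{6/5}}`. [folklore] -/
theorem newtonFarLaplacianL65_nonneg : 0 ≤ newtonFarLaplacianL65 :=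
  Real.rpow_nonneg (integral_nonneg fun _ => Real.rpow_nonneg (abs_nonneg _) _) _

/-- `λ^{1,2} ∈ L^p` for every `p` (continuous with compact support). [folklore] -/
theorem memLp_newtonFarLaplacian (p : ℝ≥0∞) : MemLp (newtonFarLaplacian 1 2) p (volume : Measure ℝ³) :=
  (continuous_newtonFarLaplacian one_pos one_lt_two).memLp_of_hasCompactSupport
    (hasCompactSupport_newtonFarLaplacian zero_le_one one_lt_two)

/-- **Hölder for the far-field term**: `|∫ λ^{1,2}(w) g(w) dw| ≤ Λ (∫ |g|⁶)^{1/6}` for `g ∈ L⁶`.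
[folklore] -/
theorem abs_integral_newtonFarLaplacian_mul_le {g : ℝ³ → ℝ} (hg : MemLp g 6 volume) :
    |∫ w, newtonFarLaplacian 1 2 w * g w| ≤
      newtonFarLaplacianL65 * (∫ w, |g w| ^ (6 : ℝ)) ^ (1 / 6 : ℝ) := by
  have hpq : (6 / 5 : ℝ).HolderConjugate 6 := by
    rw [Real.holderConjugate_iff]; norm_num
  have h1 : MemLp (newtonFarLaplacian 1 2) (ENNReal.ofReal (6 / 5)) (volume : Measure ℝ³) :=
    memLp_newtonFarLaplacian _
  have h2 : MemLp g (ENNReal.ofReal 6) (volume : Measure ℝ³) := by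
    have : ENNReal.ofReal 6 = (6 : ℝ≥0∞) := by norm_num
    rw [this]; exact hg
  have h := integral_mul_norm_le_Lp_mul_Lq hpq h1 h2
  simp only [Real.norm_eq_abs] at h
  calc |∫ w, newtonFarLaplacian 1 2 w * g w| ≤ ∫ w, |newtonFarLaplacian 1 2 w * g w| :=
        abs_integral_le_integral_abs
    _ = ∫ w, |newtonFarLaplacian 1 2 w| * |g w| := integral_congr_ae (Eventually.of_forall fun w => abs_mul _ _)
    _ ≤ _ := h
    _ = newtonFarLaplacianL65 * (∫ w, |g w| ^ (6 : ℝ)) ^ (1 / 6 : ℝ) := by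
        rw [newtonFarLaplacianL65]
        norm_num

end Agmon2

section Agmon3

/-- The Sobolev gradient functional `D(φ) = ∫ |∇φ|²` (Frobenius density, in `ℝ≥0∞`). [folklore] -/
noncomputable abbrev gradL2 (φ : ℝ³ → ℝ) : ℝ≥0∞ :=
  ∫⁻ x, ENNReal.ofReal (FluidPDE.frobeniusNormSq (fderiv ℝ φ x))

/-- **Sobolev `L⁶` bound for `C¹ ∩ L²` functions on `ℝ³`** (the tree's
`Fluid.eLpNorm_six_le_frobenius_of_hasWeakGradient` with the classical gradient). [folklore] -/
theorem eLpNorm_six_le_of_contDiff {φ : ℝ³ → ℝ} (hφ : ContDiff ℝ 1 φ) (h2 : MemLp φ 2 volume) :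
    eLpNorm φ 6 volume ≤
      SNormLESNormFDerivOfEqConst ℝ (volume : Measure ℝ³) 2 * gradL2 φ ^ (1 / 2 : ℝ) :=
  FluidPDE.eLpNorm_six_le_frobenius_of_hasWeakGradient (finrank_euclideanSpace_fin)
    h2 (FluidPDE.hasWeakGradient_fderiv_of_contDiff hφ)

/-- `C¹ ∩ L²` functions with `∫|∇φ|² < ∞` are in `L⁶(ℝ³)`. [folklore] -/
theorem memLp_six_of_contDiff {φ : ℝ³ → ℝ} (hφ : ContDiff ℝ 1 φ) (h2 : MemLp φ 2 volume)
    (hD : gradL2 φ < ⊤) : MemLp φ 6 volume := by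
  refine ⟨hφ.continuous.aestronglyMeasurable, ?_⟩
  refine (eLpNorm_six_le_of_contDiff hφ h2).trans_lt ?_
  exact ENNReal.mul_lt_top ENNReal.coe_lt_top (ENNReal.rpow_lt_top_of_nonneg (by norm_num) hD.ne)

/-- **Agmon's inequality on `ℝ³`, two-parameter form.** For `φ ∈ C²(ℝ³)` with `φ, Δφ ∈ L²` and
`∫|∇φ|² < ∞`, every `ρ > 0` and every point `x`:
`|φ(x)| ≤ (ρ N)^{1/2} ‖Δφ‖_{L²} + Λ ρ^{-1/2} C_S (∫|∇φ|²)^{1/2}`, where `N = ∫(Γ₀^{1,2})²`,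
`Λ = ‖λ^{1,2}‖_{L^{6/5}}` and `C_S` is the Gagliardo–Nirenberg–Sobolev constant of `H¹ ⊂ L⁶`.
Proof: Green's representation `φ(x) = ∫ Γ₀^{ρ,2ρ}(z) Δφ(x+z) dz + ∫ λ^{ρ,2ρ}(z) φ(x+z) dz`
(`integral_newtonNear_mul_laplacian`), Cauchy–Schwarz with `∫(Γ₀^{ρ,2ρ})² = ρN`, and Hölder
`(6/5, 6)` with `‖λ^{ρ,2ρ}‖_{6/5} = ρ^{-1/2}Λ` and the Sobolev inequality. Optimising in `ρ`
gives Agmon's `‖φ‖_∞ ≲ ‖∇φ‖^{1/2}_{L²} ‖Δφ‖^{1/2}_{L²}` (Robinson–Rodrigo–Sadowski 2016, Thm. 1.20).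
[cite: RobinsonRodrigoSadowski2016, Thm. 1.20] -/
theorem abs_le_agmon_two_param {φ : ℝ³ → ℝ} (hφ : ContDiff ℝ 2 φ) (h2 : MemLp φ 2 volume)
    (hD : gradL2 φ < ⊤) (hΔ : Integrable (fun z => (Δ φ) z ^ 2)) {ρ : ℝ} (hρ : 0 < ρ) (x : ℝ³) :
    |φ x| ≤ Real.sqrt (ρ * newtonNearSqInt) * Real.sqrt (∫ z, (Δ φ) z ^ 2) +
      newtonFarLaplacianL65 * ρ ^ (-(1 / 2 : ℝ)) *
        (SNormLESNormFDerivOfEqConst ℝ (volume : Measure ℝ³) 2 * (gradL2 φ).toReal ^ (1 / 2 : ℝ)) := by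
  -- the translate `ψ(z) = φ(x + z)`
  set ψ : ℝ³ → ℝ := fun z => φ (x + z) with hψ_def
  have hψ : ContDiff ℝ 2 ψ := hφ.comp (contDiff_const.add contDiff_id)
  have hΔψ : ∀ z, (Δ ψ) z = (Δ φ) (x + z) := fun z => laplacian_comp_const_add φ x z
  have hρ2 : ρ * 1 < ρ * 2 := by linarith
  have hρ1 : 0 < ρ * 1 := by linarith
  -- Green's representation formula at `0`
  have hGreen := integral_newtonNear_mul_laplacian hρ1 hρ2 hψ
  have hψ0 : ψ 0 = φ x := by simp [hψ_def]
  have hrep : φ x = (∫ z, newtonNear (ρ * 1) (ρ * 2) z * (Δ ψ) z) +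
      ∫ z, newtonFarLaplacian (ρ * 1) (ρ * 2) z * ψ z := by
    rw [hGreen, hψ0]; ring
  -- Term 1: Cauchy–Schwarz
  have hΓint : Integrable fun z : ℝ³ => newtonNear (ρ * 1) (ρ * 2) z ^ 2 := by
    have h := (integrable_newtonNear_sq.comp_smul (inv_ne_zero hρ.ne')).const_mul (ρ⁻¹ ^ 2)
    refine h.congr (Eventually.of_forall fun z => ?_)
    simp only [newtonNear_scale hρ 1 2 z, mul_pow]
  have hΓmem : MemLp (newtonNear (ρ * 1) (ρ * 2)) 2 (volume : Measure ℝ³) :=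
    (memLp_two_iff_integrable_sq (measurable_newtonNear _ _).aestronglyMeasurable).2 hΓint
  have hΔψint : Integrable fun z : ℝ³ => (Δ ψ) z ^ 2 := by
    have := hΔ.comp_add_left x
    exact this.congr (Eventually.of_forall fun z => by simp only [hΔψ])
  have hΔψmem : MemLp (Δ ψ) 2 (volume : Measure ℝ³) :=
    (memLp_two_iff_integrable_sq
      (FluidPDE.continuous_laplacian hψ).aestronglyMeasurable).2 hΔψint
  have hT1 : |∫ z, newtonNear (ρ * 1) (ρ * 2) z * (Δ ψ) z| ≤
      Real.sqrt (ρ * newtonNearSqInt) * Real.sqrt (∫ z, (Δ φ) z ^ 2) := by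
    have h := FluidPDE.integral_norm_mul_norm_le_sqrt_mul_sqrt hΓmem hΔψmem
    simp only [Real.norm_eq_abs, sq_abs] at h
    rw [integral_newtonNear_sq_scale' hρ] at h
    have e2 : ∫ z, (Δ ψ) z ^ 2 = ∫ z, (Δ φ) z ^ 2 := by
      simp_rw [hΔψ]
      exact integral_add_left_eq_self (μ := (volume : Measure ℝ³)) (fun z => (Δ φ) z ^ 2) x
    rw [e2] at h
    calc |∫ z, newtonNear (ρ * 1) (ρ * 2) z * (Δ ψ) z|
        ≤ ∫ z, |newtonNear (ρ * 1) (ρ * 2) z * (Δ ψ) z| := abs_integral_le_integral_abs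
      _ = ∫ z, |newtonNear (ρ * 1) (ρ * 2) z| * |(Δ ψ) z| :=
          integral_congr_ae (Eventually.of_forall fun z => abs_mul _ _)
      _ ≤ _ := h
  -- Term 2: scaling, Hölder, Sobolev
  have hφ6 : MemLp φ 6 volume := memLp_six_of_contDiff (hφ.of_le one_le_two) h2 hD
  set g : ℝ³ → ℝ := fun w => φ (x + ρ • w) with hg_def
  have hψ6 : MemLp ψ 6 (volume : Measure ℝ³) := by
    have := hφ6.comp_measurePreserving (measurePreserving_add_left volume x)
    exact this
  have hg6 : MemLp g 6 (volume : Measure ℝ³) := by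
    refine ⟨(hφ.continuous.comp (continuous_const.add (continuous_const_smul ρ))).aestronglyMeasurable, ?_⟩
    have e : eLpNorm g 6 volume = ENNReal.ofReal (ρ ^ (-(1 / 2 : ℝ))) * eLpNorm ψ 6 volume :=
      eLpNorm_six_comp_smul hρ ψ
    rw [e]
    exact ENNReal.mul_lt_top ENNReal.ofReal_lt_top hψ6.eLpNorm_lt_top
  have hscale : (∫ z, newtonFarLaplacian (ρ * 1) (ρ * 2) z * ψ z) =
      ∫ w, newtonFarLaplacian 1 2 w * g w := by
    have := integral_newtonFarLaplacian_scale_smul hρ 1 2 ψ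
    simpa only [smul_eq_mul, hg_def, hψ_def] using this
  have hT2a := abs_integral_newtonFarLaplacian_mul_le hg6
  -- `(∫ |g|⁶)^{1/6} = ‖g‖_{L⁶} = ρ^{-1/2} ‖φ‖_{L⁶} ≤ ρ^{-1/2} C_S D^{1/2}`
  have hnorm : (∫ w, |g w| ^ (6 : ℝ)) ^ (1 / 6 : ℝ) = (eLpNorm g 6 volume).toReal := by
    rw [hg6.eLpNorm_eq_integral_rpow_norm (by norm_num) (by norm_num)]
    rw [ENNReal.toReal_ofReal (Real.rpow_nonneg (integral_nonneg fun _ => by positivity) _)]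
    simp only [Real.norm_eq_abs, ENNReal.toReal_ofNat, one_div]
  have hg_eq : eLpNorm g 6 volume = ENNReal.ofReal (ρ ^ (-(1 / 2 : ℝ))) * eLpNorm φ 6 volume := by
    rw [eLpNorm_six_comp_smul hρ ψ]
    congr 1
    exact eLpNorm_comp_measurePreserving hφ.continuous.aestronglyMeasurable
      (measurePreserving_add_left volume x)
  have hSob := eLpNorm_six_le_of_contDiff (hφ.of_le one_le_two) h2
  have hT2 : |∫ w, newtonFarLaplacian 1 2 w * g w| ≤
      newtonFarLaplacianL65 * ρ ^ (-(1 / 2 : ℝ)) *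
        (SNormLESNormFDerivOfEqConst ℝ (volume : Measure ℝ³) 2 * (gradL2 φ).toReal ^ (1 / 2 : ℝ)) := by
    refine hT2a.trans ?_
    rw [hnorm, hg_eq, ENNReal.toReal_mul, ENNReal.toReal_ofReal (Real.rpow_nonneg hρ.le _), mul_assoc]
    refine mul_le_mul_of_nonneg_left ?_ newtonFarLaplacianL65_nonneg
    refine mul_le_mul_of_nonneg_left ?_ (Real.rpow_nonneg hρ.le _)
    have hfin : (SNormLESNormFDerivOfEqConst ℝ (volume : Measure ℝ³) 2 : ℝ≥0∞) *
        gradL2 φ ^ (1 / 2 : ℝ) ≠ ⊤ :=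
      ENNReal.mul_ne_top ENNReal.coe_ne_top (ENNReal.rpow_ne_top_of_nonneg (by norm_num) hD.ne)
    have := (ENNReal.toReal_le_toReal hφ6.eLpNorm_lt_top.ne hfin).2 hSob
    rw [ENNReal.toReal_mul, ENNReal.coe_toReal, ← ENNReal.toReal_rpow] at this
    exact this
  rw [hrep]
  calc |(∫ z, newtonNear (ρ * 1) (ρ * 2) z * (Δ ψ) z) + ∫ z, newtonFarLaplacian (ρ * 1) (ρ * 2) z * ψ z|
      ≤ |∫ z, newtonNear (ρ * 1) (ρ * 2) z * (Δ ψ) z| + |∫ z, newtonFarLaplacian (ρ * 1) (ρ * 2) z * ψ z| :=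
        abs_add_le _ _
    _ ≤ _ := by rw [hscale]; exact add_le_add hT1 hT2

end Agmon3

end Literature.Analysis.FluidPDE

namespace Literature.Analysis.FluidPDE

open Metric Real
open scoped Laplacian

/-- Local notation for physical space `ℝ³ = EuclideanSpace ℝ (Fin 3)`. -/
local notation "ℝ³" => EuclideanSpace ℝ (Fin 3)

section Agmon4

/-- The scalar Laplacian in coordinates: `Δφ = ∑ⱼ ∂ⱼ∂ⱼφ`. [folklore] -/
theorem laplacian_eq_sum_pderiv_pderiv {φ : ℝ³ → ℝ} (hφ : ContDiff ℝ 2 φ) (x : ℝ³) :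
    (Δ φ) x = ∑ j, pderiv j (pderiv j φ) x := by
  rw [FluidPDE.laplacian_eq_sum_fderiv_fderiv (EuclideanSpace.basisFun (Fin 3) ℝ) hφ x]
  refine Finset.sum_congr rfl fun j _ => ?_
  have hb : (EuclideanSpace.basisFun (Fin 3) ℝ) j = (stdVec j : ℝ³) := by
    simp [stdVec, EuclideanSpace.basisFun_apply]
  rw [hb]
  rfl

/-- `|∇¹φ|² = ∑ₗ (∂ₗφ)²` for the coordinate tensor norm of order one. [folklore] -/
theorem dnormSq_one_eq {φ : ℝ³ → ℝ} (hφ : ContDiff ℝ ∞ φ) (x : ℝ³) :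
    dnormSq 1 φ x = ∑ l, pderiv l φ x ^ 2 := by
  rw [dnormSq_succ hφ]
  exact Finset.sum_congr rfl fun l _ => dnormSq_zero _ _

/-- `(Δφ)² ≤ 3 |∇²φ|²` pointwise (Cauchy–Schwarz on the three diagonal entries of the Hessian,
which are among the entries counted by `|∇²φ|²`). [folklore] -/
theorem laplacian_sq_le_three_mul_dnormSq_two {φ : ℝ³ → ℝ} (hφ : ContDiff ℝ ∞ φ) (x : ℝ³) :
    (Δ φ) x ^ 2 ≤ 3 * dnormSq 2 φ x := by
  rw [laplacian_eq_sum_pderiv_pderiv (hφ.of_le (by norm_cast)) x]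
  have h1 : (∑ j, pderiv j (pderiv j φ) x) ^ 2 ≤
      (Finset.univ : Finset (Fin 3)).card * ∑ j, pderiv j (pderiv j φ) x ^ 2 :=
    sq_sum_le_card_mul_sum_sq
  rw [Finset.card_univ, Fintype.card_fin] at h1
  push_cast at h1
  refine h1.trans (mul_le_mul_of_nonneg_left ?_ (by norm_num))
  rw [dnormSq_succ hφ]
  refine Finset.sum_le_sum fun l _ => ?_
  rw [dnormSq_one_eq (contDiff_pderiv hφ l)]
  exact Finset.single_le_sum (f := fun j => pderiv j (pderiv l φ) x ^ 2)
    (fun j _ => sq_nonneg _) (Finset.mem_univ l)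

/-- The Frobenius norm of the derivative of a scalar function is `|∇¹φ|²`. [folklore] -/
theorem frobeniusNormSq_fderiv_eq_dnormSq_one {φ : ℝ³ → ℝ} (hφ : ContDiff ℝ ∞ φ) (x : ℝ³) :
    frobeniusNormSq (fderiv ℝ φ x) = dnormSq 1 φ x := by
  rw [frobeniusNormSq_eq_sum (EuclideanSpace.basisFun (Fin 3) ℝ), dnormSq_one_eq hφ]
  refine Finset.sum_congr rfl fun l _ => ?_
  have hb : (EuclideanSpace.basisFun (Fin 3) ℝ) l = (stdVec l : ℝ³) := by
    simp [stdVec, EuclideanSpace.basisFun_apply]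
  rw [hb, Real.norm_eq_abs, sq_abs]
  rfl

variable {v : ℝ³ → ℝ³}

/-- `(vᵢ)² ≤ |v|² = |∇⁰v|²`. [folklore] -/
theorem sq_apply_le_levelSq_zero (v : ℝ³ → ℝ³) (x : ℝ³) (i : Fin 3) :
    v x i ^ 2 ≤ levelSq 0 v x := by
  unfold levelSq
  simp only [dnormSq_zero]
  exact Finset.single_le_sum (f := fun j => v x j ^ 2) (fun j _ => sq_nonneg _) (Finset.mem_univ i)

/-- `|∇ᵐvᵢ|² ≤ |∇ᵐv|²`. [folklore] -/
theorem dnormSq_apply_le_levelSq (m : ℕ) (v : ℝ³ → ℝ³) (x : ℝ³) (i : Fin 3) :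
    dnormSq m (fun y => v y i) x ≤ levelSq m v x :=
  Finset.single_le_sum (f := fun j => dnormSq m (fun y => v y j) x) (fun _ _ => dnormSq_nonneg _ _ _)
    (Finset.mem_univ i)

/-- Integrability of a continuous nonnegative function dominated by an integrable one. [folklore] -/
theorem integrable_of_le_of_continuous {f g : ℝ³ → ℝ} (hf : Continuous f) (hg : Integrable g)
    (h0 : ∀ x, 0 ≤ f x) (hle : ∀ x, f x ≤ g x) : Integrable f :=
  hg.mono' hf.aestronglyMeasurable (Eventually.of_forall fun x => by
    rw [Real.norm_of_nonneg (h0 x)]; exact hle x)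

/-- **Agmon's inequality for a component**, in terms of the coordinate Sobolev integrals
`a₁ = ∫|∇v|²`, `a₂ = ∫|∇²v|²`: for every `ρ > 0`,
`|vᵢ(x)| ≤ (3ρN a₂)^{1/2} + Λ C_S ρ^{-1/2} a₁^{1/2}`. [folklore] -/
theorem abs_apply_le_agmon_comp (hv : ContDiff ℝ ∞ v) (h0 : Integrable (levelSq 0 v))
    (h1 : Integrable (levelSq 1 v)) (h2 : Integrable (levelSq 2 v)) {ρ : ℝ} (hρ : 0 < ρ)
    (x : ℝ³) (i : Fin 3) :
    |v x i| ≤ Real.sqrt (ρ * newtonNearSqInt) * Real.sqrt (3 * ∫ y, levelSq 2 v y) +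
      newtonFarLaplacianL65 * ρ ^ (-(1 / 2 : ℝ)) *
        (SNormLESNormFDerivOfEqConst ℝ (volume : Measure ℝ³) 2 * (∫ y, levelSq 1 v y) ^ (1 / 2 : ℝ)) := by
  set φ : ℝ³ → ℝ := fun y => v y i with hφ_def
  have hφ : ContDiff ℝ ∞ φ := contDiff_comp_of_contDiff hv i
  -- `φ ∈ L²`
  have hφsq : Integrable fun y => φ y ^ 2 :=
    integrable_of_le_of_continuous (hφ.continuous.pow 2) h0 (fun _ => sq_nonneg _)
      (fun y => sq_apply_le_levelSq_zero v y i)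
  have hφ2 : MemLp φ 2 volume := (memLp_two_iff_integrable_sq hφ.continuous.aestronglyMeasurable).2 hφsq
  -- `∫|∇φ|² ≤ a₁`
  have hgrad_le : ∀ y, frobeniusNormSq (fderiv ℝ φ y) ≤ levelSq 1 v y := fun y => by
    rw [frobeniusNormSq_fderiv_eq_dnormSq_one hφ]
    exact dnormSq_apply_le_levelSq 1 v y i
  have hD_le : gradL2 φ ≤ ENNReal.ofReal (∫ y, levelSq 1 v y) := by
    rw [ofReal_integral_eq_lintegral_ofReal h1 (ae_of_all _ fun y => levelSq_nonneg 1 v y)]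
    exact lintegral_mono fun y => ENNReal.ofReal_le_ofReal (hgrad_le y)
  have hD : gradL2 φ < ⊤ := hD_le.trans_lt ENNReal.ofReal_lt_top
  -- `∫ (Δφ)² ≤ 3 a₂`
  have hΔle : ∀ y, (Δ φ) y ^ 2 ≤ 3 * levelSq 2 v y := fun y =>
    (laplacian_sq_le_three_mul_dnormSq_two hφ y).trans
      (mul_le_mul_of_nonneg_left (dnormSq_apply_le_levelSq 2 v y i) (by norm_num))
  have hΔint : Integrable fun y => (Δ φ) y ^ 2 :=
    integrable_of_le_of_continuous ((continuous_laplacian (hφ.of_le (by norm_cast))).pow 2)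
      (h2.const_mul 3) (fun _ => sq_nonneg _) hΔle
  have hΔI : ∫ y, (Δ φ) y ^ 2 ≤ 3 * ∫ y, levelSq 2 v y := by
    rw [← integral_const_mul]
    exact integral_mono hΔint (h2.const_mul 3) hΔle
  have h := abs_le_agmon_two_param (hφ.of_le (by norm_cast)) hφ2 hD hΔint hρ x
  refine h.trans (add_le_add ?_ ?_)
  · exact mul_le_mul_of_nonneg_left (Real.sqrt_le_sqrt hΔI) (Real.sqrt_nonneg _)
  · refine mul_le_mul_of_nonneg_left ?_ (mul_nonneg newtonFarLaplacianL65_nonneg (Real.rpow_nonneg hρ.le _))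
    refine mul_le_mul_of_nonneg_left ?_ (NNReal.coe_nonneg _)
    refine Real.rpow_le_rpow ENNReal.toReal_nonneg ?_ (by norm_num)
    have := ENNReal.toReal_mono ENNReal.ofReal_ne_top hD_le
    rwa [ENNReal.toReal_ofReal (integral_nonneg fun y => levelSq_nonneg 1 v y)] at this

/-- The constant in Agmon's inequality (coordinate form). [folklore] -/
noncomputable def agmonConst : ℝ :=
  3 * (Real.sqrt (3 * newtonNearSqInt) +
    newtonFarLaplacianL65 * SNormLESNormFDerivOfEqConst ℝ (volume : Measure ℝ³) 2)

/-- The Agmon constant is nonnegative. [folklore] -/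
theorem agmonConst_nonneg : 0 ≤ agmonConst := by
  unfold agmonConst
  have := newtonFarLaplacianL65_nonneg
  positivity

/-- `‖w‖ ≤ ∑ᵢ |wᵢ|` on `ℝ³`. [folklore] -/
theorem norm_le_sum_abs (w : ℝ³) : ‖w‖ ≤ ∑ i, |w i| := by
  have h1 : ‖w‖ ^ 2 = ∑ i, |w i| ^ 2 := by
    rw [EuclideanSpace.real_norm_sq_eq]
    exact Finset.sum_congr rfl fun i _ => (sq_abs _).symm
  have h2 : ∑ i, |w i| ^ 2 ≤ (∑ i, |w i|) ^ 2 :=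
    Finset.sum_sq_le_sq_sum_of_nonneg fun i _ => abs_nonneg (w i)
  have h3 : 0 ≤ ∑ i, |w i| := Finset.sum_nonneg fun i _ => abs_nonneg _
  nlinarith [norm_nonneg w]

/-- **Agmon's inequality, coordinate form** (Robinson–Rodrigo–Sadowski 2016, Thm. 1.20:
`‖u‖_{L^∞} ≤ c ‖u‖^{1/2}_{H¹} ‖u‖^{1/2}_{H²}`, here in the homogeneous form
`sup |v| ≤ A (∫|∇v|²)^{1/4} (∫|∇²v|²)^{1/4}` for smooth `v : ℝ³ → ℝ³` with `v, ∇v, ∇²v ∈ L²`).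
Proof: the component bound `abs_apply_le_agmon_comp` with `ρ = ((a₁+δ)/(a₂+δ))^{1/2}` and
`δ → 0⁺`. [cite: RobinsonRodrigoSadowski2016, Thm. 1.20] -/
theorem norm_apply_le_agmon (hv : ContDiff ℝ ∞ v) (h0 : Integrable (levelSq 0 v))
    (h1 : Integrable (levelSq 1 v)) (h2 : Integrable (levelSq 2 v)) (x : ℝ³) :
    ‖v x‖ ≤ agmonConst * ((∫ y, levelSq 1 v y) * ∫ y, levelSq 2 v y) ^ (1 / 4 : ℝ) := by
  set a₁ := ∫ y, levelSq 1 v y with ha₁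
  set a₂ := ∫ y, levelSq 2 v y with ha₂
  have ha₁0 : 0 ≤ a₁ := integral_nonneg fun y => levelSq_nonneg 1 v y
  have ha₂0 : 0 ≤ a₂ := integral_nonneg fun y => levelSq_nonneg 2 v y
  set P := Real.sqrt (3 * newtonNearSqInt) with hP
  set Q := newtonFarLaplacianL65 * SNormLESNormFDerivOfEqConst ℝ (volume : Measure ℝ³) 2 with hQ
  have hP0 : 0 ≤ P := Real.sqrt_nonneg _
  have hQ0 : 0 ≤ Q := mul_nonneg newtonFarLaplacianL65_nonneg (NNReal.coe_nonneg _)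
  -- the bound for every `δ > 0`
  have key : ∀ δ : ℝ, 0 < δ → ‖v x‖ ≤ agmonConst * ((a₁ + δ) * (a₂ + δ)) ^ (1 / 4 : ℝ) := by
    intro δ hδ
    set A := a₁ + δ with hA
    set B := a₂ + δ with hB
    have hA0 : 0 < A := by positivity
    have hB0 : 0 < B := by positivity
    set ρ := (A / B) ^ (1 / 2 : ℝ) with hρ_def
    have hρ : 0 < ρ := Real.rpow_pos_of_pos (div_pos hA0 hB0) _
    -- `ρ^{1/2} B^{1/2} = (AB)^{1/4}` and `ρ^{-1/2} A^{1/2} = (AB)^{1/4}`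
    have hAB : 0 < A * B := mul_pos hA0 hB0
    have hA4 : A ^ (1 / 2 : ℝ) = A ^ (1 / 4 : ℝ) * A ^ (1 / 4 : ℝ) := by
      rw [← Real.rpow_add hA0]; norm_num
    have hB4 : B ^ (1 / 2 : ℝ) = B ^ (1 / 4 : ℝ) * B ^ (1 / 4 : ℝ) := by
      rw [← Real.rpow_add hB0]; norm_num
    have hAB4 : (A * B) ^ (1 / 4 : ℝ) = A ^ (1 / 4 : ℝ) * B ^ (1 / 4 : ℝ) :=
      Real.mul_rpow hA0.le hB0.le
    have hρhalf : ρ ^ (1 / 2 : ℝ) = A ^ (1 / 4 : ℝ) / B ^ (1 / 4 : ℝ) := by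
      rw [hρ_def, ← Real.rpow_mul (div_pos hA0 hB0).le, Real.div_rpow hA0.le hB0.le]
      norm_num
    have hρnhalf : ρ ^ (-(1 / 2 : ℝ)) = B ^ (1 / 4 : ℝ) / A ^ (1 / 4 : ℝ) := by
      rw [Real.rpow_neg hρ.le, hρhalf, inv_div]
    have hA40 : 0 < A ^ (1 / 4 : ℝ) := Real.rpow_pos_of_pos hA0 _
    have hB40 : 0 < B ^ (1 / 4 : ℝ) := Real.rpow_pos_of_pos hB0 _
    have e1 : ρ ^ (1 / 2 : ℝ) * B ^ (1 / 2 : ℝ) = (A * B) ^ (1 / 4 : ℝ) := by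
      rw [hρhalf, hB4, hAB4]
      field_simp
    have e2 : ρ ^ (-(1 / 2 : ℝ)) * A ^ (1 / 2 : ℝ) = (A * B) ^ (1 / 4 : ℝ) := by
      rw [hρnhalf, hA4, hAB4]
      field_simp
    -- component bounds
    have hcomp : ∀ i, |v x i| ≤ (P + Q) * (A * B) ^ (1 / 4 : ℝ) := by
      intro i
      have h := abs_apply_le_agmon_comp hv h0 h1 h2 hρ x i
      rw [← ha₁, ← ha₂] at h
      have t1 : Real.sqrt (ρ * newtonNearSqInt) * Real.sqrt (3 * a₂) ≤ P * (A * B) ^ (1 / 4 : ℝ) := by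
        have : Real.sqrt (ρ * newtonNearSqInt) * Real.sqrt (3 * a₂) =
            P * (Real.sqrt ρ * Real.sqrt a₂) := by
          rw [hP, Real.sqrt_mul hρ.le newtonNearSqInt, Real.sqrt_mul (by norm_num : (0:ℝ) ≤ 3) a₂,
            Real.sqrt_mul (by norm_num : (0:ℝ) ≤ 3) newtonNearSqInt]
          ring
        rw [this]
        refine mul_le_mul_of_nonneg_left ?_ hP0
        rw [Real.sqrt_eq_rpow, Real.sqrt_eq_rpow, ← e1]
        exact mul_le_mul_of_nonneg_left (Real.rpow_le_rpow ha₂0 (by linarith) (by norm_num))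
          (Real.rpow_nonneg hρ.le _)
      have t2 : newtonFarLaplacianL65 * ρ ^ (-(1 / 2 : ℝ)) *
          (SNormLESNormFDerivOfEqConst ℝ (volume : Measure ℝ³) 2 * a₁ ^ (1 / 2 : ℝ)) ≤
          Q * (A * B) ^ (1 / 4 : ℝ) := by
        have : newtonFarLaplacianL65 * ρ ^ (-(1 / 2 : ℝ)) *
            (SNormLESNormFDerivOfEqConst ℝ (volume : Measure ℝ³) 2 * a₁ ^ (1 / 2 : ℝ)) =
            Q * (ρ ^ (-(1 / 2 : ℝ)) * a₁ ^ (1 / 2 : ℝ)) := by rw [hQ]; ring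
        rw [this, ← e2]
        refine mul_le_mul_of_nonneg_left ?_ hQ0
        exact mul_le_mul_of_nonneg_left (Real.rpow_le_rpow ha₁0 (by linarith) (by norm_num))
          (Real.rpow_nonneg hρ.le _)
      calc |v x i| ≤ _ := h
        _ ≤ P * (A * B) ^ (1 / 4 : ℝ) + Q * (A * B) ^ (1 / 4 : ℝ) := add_le_add t1 t2
        _ = (P + Q) * (A * B) ^ (1 / 4 : ℝ) := by ring
    calc ‖v x‖ ≤ ∑ i, |v x i| := norm_le_sum_abs (v x)
      _ ≤ ∑ _i : Fin 3, (P + Q) * (A * B) ^ (1 / 4 : ℝ) := Finset.sum_le_sum fun i _ => hcomp i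
      _ = agmonConst * (A * B) ^ (1 / 4 : ℝ) := by
          rw [Finset.sum_const, Finset.card_univ, Fintype.card_fin, nsmul_eq_mul, agmonConst, ← hP, ← hQ]
          push_cast
          ring
  -- `δ → 0⁺`
  have hcont : Tendsto (fun δ : ℝ => agmonConst * ((a₁ + δ) * (a₂ + δ)) ^ (1 / 4 : ℝ)) (𝓝[>] 0)
      (𝓝 (agmonConst * ((a₁ + 0) * (a₂ + 0)) ^ (1 / 4 : ℝ))) := by
    refine tendsto_nhdsWithin_of_tendsto_nhds ?_
    refine (Continuous.tendsto ?_ 0)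
    refine continuous_const.mul ?_
    exact ((continuous_const.add continuous_id).mul (continuous_const.add continuous_id)).rpow_const
      fun _ => Or.inr (by norm_num)
  rw [add_zero, add_zero] at hcont
  exact ge_of_tendsto hcont (eventually_nhdsWithin_of_forall fun δ hδ => key δ hδ)

end Agmon4

end Literature.Analysis.FluidPDE

namespace Literature.Analysis.FluidPDE

/-- Local notation for physical space `ℝ³ = EuclideanSpace ℝ (Fin 3)`. -/
local notation "ℝ³" => EuclideanSpace ℝ (Fin 3)

section Forcing

variable {v : ℝ³ → ℝ³} {φ : ℝ³ → ℝ}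

/-- Subadditivity of `t ↦ t^{3/4}` on `[0, ∞)`. [folklore] -/
theorem rpow_three_quarters_add_le {a b : ℝ} (ha : 0 ≤ a) (hb : 0 ≤ b) :
    (a + b) ^ (3 / 4 : ℝ) ≤ a ^ (3 / 4 : ℝ) + b ^ (3 / 4 : ℝ) := by
  have h := NNReal.rpow_add_le_add_rpow ⟨a, ha⟩ ⟨b, hb⟩ (p := 3 / 4) (by norm_num) (by norm_num)
  have := NNReal.coe_le_coe.2 h
  rw [NNReal.coe_rpow, NNReal.coe_add, NNReal.coe_add, NNReal.coe_rpow, NNReal.coe_rpow] at this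
  exact this

/-- `(P · P)^{1/8} = P^{1/4}` for `P ≥ 0`. [folklore] -/
theorem mul_self_rpow_eighth {P : ℝ} (hP : 0 ≤ P) : (P * P) ^ (1 / 8 : ℝ) = P ^ (1 / 4 : ℝ) := by
  rw [Real.mul_rpow hP hP, ← Real.rpow_add' hP (by norm_num)]
  norm_num

/-- `(Q · Q)^{3/8} = Q^{3/4}` for `Q ≥ 0`. [folklore] -/
theorem mul_self_rpow_three_eighths {Q : ℝ} (hQ : 0 ≤ Q) : (Q * Q) ^ (3 / 8 : ℝ) = Q ^ (3 / 4 : ℝ) := by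
  rw [Real.mul_rpow hQ hQ, ← Real.rpow_add' hQ (by norm_num)]
  norm_num

/-- `|∇¹g|² = ∑ₗ (∂ₗ g)²`. [folklore] -/
theorem dnormSq_one_eq' {g : ℝ³ → ℝ} (hg : ContDiff ℝ ∞ g) (x : ℝ³) :
    dnormSq 1 g x = ∑ l, pderiv l g x ^ 2 := by
  rw [dnormSq_succ hg]
  exact Finset.sum_congr rfl fun l _ => dnormSq_zero _ _

/-- `‖D(∂ₗvᵢ)(x)‖² ≤ |∇²v (x)|²` (operator norm against the coordinate tensor). [folklore] -/
theorem sq_norm_fderiv_pderiv_comp_le (hv : ContDiff ℝ ∞ v) (l i : Fin 3) (x : ℝ³) :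
    ‖fderiv ℝ (pderiv l fun y => v y i) x‖ ^ 2 ≤ levelSq 2 v x := by
  have hvi : ContDiff ℝ ∞ fun y => v y i := contDiff_comp_of_contDiff hv i
  have hg : ContDiff ℝ ∞ (pderiv l fun y => v y i) := contDiff_pderiv hvi l
  calc ‖fderiv ℝ (pderiv l fun y => v y i) x‖ ^ 2
      ≤ ∑ m, ‖fderiv ℝ (pderiv l fun y => v y i) x (stdVec m)‖ ^ 2 :=
        sq_opNorm_le_sum_sq_norm_apply_stdVec _
    _ = dnormSq 1 (pderiv l fun y => v y i) x := by
        rw [dnormSq_one_eq' hg]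
        exact Finset.sum_congr rfl fun m _ => by rw [Real.norm_eq_abs, sq_abs]; rfl
    _ ≤ dnormSq 2 (fun y => v y i) x := by
        rw [dnormSq_succ hvi 1]
        exact Finset.single_le_sum (f := fun l' => dnormSq 1 (pderiv l' fun y => v y i) x)
          (fun _ _ => dnormSq_nonneg _ _ _) (Finset.mem_univ l)
    _ ≤ levelSq 2 v x :=
        Finset.single_le_sum (f := fun j => dnormSq 2 (fun y => v y j) x)
          (fun _ _ => dnormSq_nonneg _ _ _) (Finset.mem_univ i)

/-- `(∂ₗvᵢ)² ≤ |∇v|²`. [folklore] -/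
theorem sq_pderiv_comp_le_levelSq_one (hv : ContDiff ℝ ∞ v) (l i : Fin 3) (x : ℝ³) :
    pderiv l (fun y => v y i) x ^ 2 ≤ levelSq 1 v x := by
  have hvi : ContDiff ℝ ∞ fun y => v y i := contDiff_comp_of_contDiff hv i
  calc pderiv l (fun y => v y i) x ^ 2 ≤ dnormSq 1 (fun y => v y i) x := by
        rw [dnormSq_one_eq' hvi]
        exact Finset.single_le_sum (f := fun l' => pderiv l' (fun y => v y i) x ^ 2)
          (fun _ _ => sq_nonneg _) (Finset.mem_univ l)
    _ ≤ levelSq 1 v x :=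
        Finset.single_le_sum (f := fun j => dnormSq 1 (fun y => v y j) x)
          (fun _ _ => dnormSq_nonneg _ _ _) (Finset.mem_univ i)

/-- `|∇v|² = ∑ᵢ ∑ₗ (∂ₗvᵢ)²`. [folklore] -/
theorem levelSq_one_eq_sum_sum (hv : ContDiff ℝ ∞ v) (x : ℝ³) :
    levelSq 1 v x = ∑ i, ∑ l, pderiv l (fun y => v y i) x ^ 2 := by
  unfold levelSq
  exact Finset.sum_congr rfl fun i _ => dnormSq_one_eq' (contDiff_comp_of_contDiff hv i) x

/-- **The trilinear forcing piece.** For a smooth field `v` with `|∇v|², |∇²v|² ∈ L¹`, a smooth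
compactly supported weight `0 ≤ φ ≤ 1` with `‖Dφ‖ ≤ c`, and a continuous `W`:
`∫ φ⁴ |W| (∂ₗvᵢ)² ≤ (∫ φ⁴ W²)^{1/2} K^{3/2} a₁^{1/4} (2a₂ + 2c²a₁)^{3/4}`, `a₁ = ∫|∇v|²`,
`a₂ = ∫|∇²v|²` (Hölder, the `L⁴` Gagliardo–Nirenberg interpolation applied to `φ ∂ₗvᵢ`).
[folklore] -/
theorem integral_pow_four_mul_abs_mul_sq_pderiv_le (hv : ContDiff ℝ ∞ v)
    (h1 : Integrable (levelSq 1 v)) (h2 : Integrable (levelSq 2 v))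
    (hφ : ContDiff ℝ ∞ φ) (hφc : HasCompactSupport φ) (hφ0 : ∀ x, 0 ≤ φ x) (hφ1 : ∀ x, φ x ≤ 1)
    {c : ℝ} (hc : ∀ x, ‖fderiv ℝ φ x‖ ≤ c) {W : ℝ³ → ℝ} (hW : Continuous W)
    (l i : Fin 3) :
    ∫ x, φ x ^ 4 * |W x| * pderiv l (fun y => v y i) x ^ 2 ≤
      Real.sqrt (∫ x, φ x ^ 4 * W x ^ 2) *
        ((eLpNormLESNormFDerivOfEqInnerConst (volume : Measure ℝ³) 2 : ℝ) ^ (3 / 2 : ℝ) *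
          ((∫ x, levelSq 1 v x) ^ (1 / 4 : ℝ) *
            (2 * (∫ x, levelSq 2 v x) + 2 * c ^ 2 * ∫ x, levelSq 1 v x) ^ (3 / 4 : ℝ))) := by
  set g : ℝ³ → ℝ := pderiv l fun y => v y i with hg_def
  have hvi : ContDiff ℝ ∞ fun y => v y i := contDiff_comp_of_contDiff hv i
  have hg : ContDiff ℝ ∞ g := contDiff_pderiv hvi l
  set f : ℝ³ → ℝ := fun x => φ x ^ 2 * W x with hf_def
  set Φ : ℝ³ → ℝ := fun x => φ x * g x with hΦ_def
  have hφcont := hφ.continuous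
  -- the players of the abstract trilinear inequality
  have hfmem : MemLp f 2 (volume : Measure ℝ³) :=
    ((hφcont.pow 2).mul hW).memLp_of_hasCompactSupport
      ((hasCompactSupport_pow hφc two_ne_zero).mul_right)
  have hΦ1 : ContDiff ℝ 1 Φ := (hφ.of_le (by norm_cast)).mul (hg.of_le (by norm_cast))
  have hΦc : HasCompactSupport Φ := hφc.mul_right
  have key := integral_norm_mul_norm_mul_norm_le_rpow (volume : Measure ℝ³) (F := ℝ) (F₂ := ℝ)
    finrank_euclideanSpace_fin hfmem hΦ1 hΦc hΦ1 hΦc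
    (K := (eLpNormLESNormFDerivOfEqInnerConst (volume : Measure ℝ³) 2 : ℝ)) le_rfl
  -- identify the left-hand side
  have hlhs : ∫ x, φ x ^ 4 * |W x| * g x ^ 2 = ∫ x, ‖f x‖ * (‖Φ x‖ * ‖Φ x‖) := by
    refine integral_congr_ae (Eventually.of_forall fun x => ?_)
    simp only [hf_def, hΦ_def, Real.norm_eq_abs, abs_mul, abs_pow, abs_of_nonneg (hφ0 x)]
    have : |g x| * |g x| = g x ^ 2 := by rw [← sq, sq_abs]
    calc φ x ^ 4 * |W x| * g x ^ 2 = φ x ^ 2 * |W x| * (φ x * φ x * (|g x| * |g x|)) := by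
          rw [this]; ring
      _ = φ x ^ 2 * |W x| * (φ x * |g x| * (φ x * |g x|)) := by ring
  -- the three integrals on the right
  have hf2 : ∫ x, ‖f x‖ ^ 2 = ∫ x, φ x ^ 4 * W x ^ 2 := by
    refine integral_congr_ae (Eventually.of_forall fun x => ?_)
    simp only [hf_def, Real.norm_eq_abs, sq_abs]
    ring
  have hP : ∫ x, ‖Φ x‖ ^ 2 ≤ ∫ x, levelSq 1 v x := by
    have hi : Integrable fun x => ‖Φ x‖ ^ 2 :=
      ((hΦ1.continuous.norm).pow 2).integrable_of_hasCompactSupport (hasCompactSupport_pow hΦc.norm two_ne_zero)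
    refine integral_mono hi h1 fun x => ?_
    simp only [hΦ_def, Real.norm_eq_abs, sq_abs, mul_pow]
    calc φ x ^ 2 * g x ^ 2 ≤ 1 * g x ^ 2 := by
          refine mul_le_mul_of_nonneg_right ?_ (sq_nonneg _)
          exact pow_le_one₀ (hφ0 x) (hφ1 x)
      _ = g x ^ 2 := one_mul _
      _ ≤ levelSq 1 v x := sq_pderiv_comp_le_levelSq_one hv l i x
  have hQ : ∫ x, ‖fderiv ℝ Φ x‖ ^ 2 ≤ 2 * (∫ x, levelSq 2 v x) + 2 * c ^ 2 * ∫ x, levelSq 1 v x := by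
    have hgd : Differentiable ℝ g := hg.differentiable (by simp)
    have hφd : Differentiable ℝ φ := hφ.differentiable (by simp)
    have hpt : ∀ x, ‖fderiv ℝ Φ x‖ ^ 2 ≤ 2 * levelSq 2 v x + 2 * c ^ 2 * levelSq 1 v x := by
      intro x
      have hD : fderiv ℝ Φ x = φ x • fderiv ℝ g x + g x • fderiv ℝ φ x :=
        fderiv_fun_mul (hφd x) (hgd x)
      have hn : ‖fderiv ℝ Φ x‖ ≤ |φ x| * ‖fderiv ℝ g x‖ + |g x| * ‖fderiv ℝ φ x‖ := by
        rw [hD]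
        refine (norm_add_le _ _).trans (add_le_add ?_ ?_) <;> rw [norm_smul, Real.norm_eq_abs]
      have ha : |φ x| * ‖fderiv ℝ g x‖ ≤ ‖fderiv ℝ g x‖ := by
        rw [abs_of_nonneg (hφ0 x)]
        exact mul_le_of_le_one_left (norm_nonneg _) (hφ1 x)
      have hb : |g x| * ‖fderiv ℝ φ x‖ ≤ |g x| * c := mul_le_mul_of_nonneg_left (hc x) (abs_nonneg _)
      have hn' : ‖fderiv ℝ Φ x‖ ≤ ‖fderiv ℝ g x‖ + |g x| * c := hn.trans (add_le_add ha hb)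
      have h2' : ‖fderiv ℝ g x‖ ^ 2 ≤ levelSq 2 v x := sq_norm_fderiv_pderiv_comp_le hv l i x
      have h1' : g x ^ 2 ≤ levelSq 1 v x := sq_pderiv_comp_le_levelSq_one hv l i x
      calc ‖fderiv ℝ Φ x‖ ^ 2 ≤ (‖fderiv ℝ g x‖ + |g x| * c) ^ 2 :=
            pow_le_pow_left₀ (norm_nonneg _) hn' 2
        _ ≤ 2 * ‖fderiv ℝ g x‖ ^ 2 + 2 * (|g x| * c) ^ 2 := by nlinarith [sq_nonneg (‖fderiv ℝ g x‖ - |g x| * c)]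
        _ = 2 * ‖fderiv ℝ g x‖ ^ 2 + 2 * c ^ 2 * g x ^ 2 := by rw [mul_pow, sq_abs]; ring
        _ ≤ 2 * levelSq 2 v x + 2 * c ^ 2 * levelSq 1 v x := by
            gcongr
    have hi : Integrable fun x => ‖fderiv ℝ Φ x‖ ^ 2 :=
      (((hΦ1.continuous_fderiv one_ne_zero).norm).pow 2).integrable_of_hasCompactSupport
        (hasCompactSupport_pow (hΦc.fderiv ℝ).norm two_ne_zero)
    have hi2 : Integrable fun x => 2 * levelSq 2 v x + 2 * c ^ 2 * levelSq 1 v x :=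
      (h2.const_mul 2).add (h1.const_mul (2 * c ^ 2))
    calc ∫ x, ‖fderiv ℝ Φ x‖ ^ 2 ≤ ∫ x, 2 * levelSq 2 v x + 2 * c ^ 2 * levelSq 1 v x :=
          integral_mono hi hi2 hpt
      _ = 2 * (∫ x, levelSq 2 v x) + 2 * c ^ 2 * ∫ x, levelSq 1 v x := by
          rw [integral_add (h2.const_mul 2) (h1.const_mul _), integral_const_mul, integral_const_mul]
  -- assemble
  have hP0 : 0 ≤ ∫ x, ‖Φ x‖ ^ 2 := integral_nonneg fun _ => sq_nonneg _
  have hQ0 : 0 ≤ ∫ x, ‖fderiv ℝ Φ x‖ ^ 2 := integral_nonneg fun _ => sq_nonneg _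
  have ha10 : 0 ≤ ∫ x, levelSq 1 v x := integral_nonneg fun x => levelSq_nonneg 1 v x
  have hK0 : 0 ≤ (eLpNormLESNormFDerivOfEqInnerConst (volume : Measure ℝ³) 2 : ℝ) := NNReal.coe_nonneg _
  rw [hlhs]
  refine key.trans ?_
  rw [hf2, mul_self_rpow_eighth hP0, mul_self_rpow_three_eighths hQ0]
  refine mul_le_mul_of_nonneg_left ?_ (Real.sqrt_nonneg _)
  refine mul_le_mul_of_nonneg_left ?_ (Real.rpow_nonneg hK0 _)
  exact mul_le_mul (Real.rpow_le_rpow hP0 hP (by norm_num)) (Real.rpow_le_rpow hQ0 hQ (by norm_num))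
    (Real.rpow_nonneg hQ0 _) (Real.rpow_nonneg ha10 _)

end Forcing

section SliceZero

variable {v : ℝ³ → ℝ³} {φ : ℝ³ → ℝ}

/-- `|wⱼ| ≤ ‖w‖` on `ℝ³`. [folklore] -/
theorem abs_apply_le_norm' (w : ℝ³) (j : Fin 3) : |w j| ≤ ‖w‖ := by
  rw [EuclideanSpace.norm_eq, ← Real.sqrt_sq_eq_abs]
  refine Real.sqrt_le_sqrt ?_
  have : w j ^ 2 = ‖w j‖ ^ 2 := by rw [Real.norm_eq_abs, sq_abs]
  rw [this]
  exact Finset.single_le_sum (f := fun i => ‖w i‖ ^ 2) (fun _ _ => sq_nonneg _) (Finset.mem_univ j)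

/-- `|∇⁰Ω|² ∈ L¹` when `|∇¹v|² ∈ L¹` (`|Ω|² ≤ 4|∇v|²`). [folklore] -/
theorem integrable_vortSq_of_levelSq_succ (hv : ContDiff ℝ ∞ v) (m : ℕ)
    (h : Integrable (levelSq (m + 1) v)) : Integrable (vortSq m v) :=
  (h.const_mul 4).mono' (continuous_vortSq hv m).aestronglyMeasurable
    (Eventually.of_forall fun x => by
      rw [Real.norm_of_nonneg (vortSq_nonneg m v x)]
      exact vortSq_le_four_mul_levelSq_succ hv m x)

/-- The level-zero forcing sum: `∑_{a ∈ [1,1]} √A_a √A_{2-a} = A₁`. [folklore] -/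
theorem sum_Icc_one_one_sqrt_levelSq (v : ℝ³ → ℝ³) (x : ℝ³) :
    ∑ a ∈ Finset.Icc 1 (0 + 1), Real.sqrt (levelSq a v x) * Real.sqrt (levelSq (0 + 2 - a) v x) =
      levelSq 1 v x := by
  rw [show (0 + 1 : ℕ) = 1 from rfl, Finset.Icc_self, Finset.sum_singleton]
  rw [show (0 + 2 - 1 : ℕ) = 1 from rfl, Real.mul_self_sqrt (levelSq_nonneg 1 v x)]

/-- **The localised enstrophy pairing at level zero, with explicit structure.** For a smooth
divergence-free `v` bounded by `B`, with `|∇v|², |∇²v|² ∈ L¹`, a smooth compactly supported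
weight `0 ≤ φ ≤ 1` with `‖Dφ‖ ≤ c`, and continuous `Ẇ_c` whose vorticity forcing
`F_c = Ẇ_c − νΔW_c + v·∇W_c` obeys `|F_c| ≤ 12 |∇v|²` (`W_c = Ω_{ki}`):
`∑_c 2∫φ⁴ Ẇ_c W_c ≤ −(3/2)ν ∫φ⁴|∇Ω|² + (96νc² + 12cB) ∫|Ω|²
   + 1944 K^{3/2} (∫|Ω|²)^{1/2} (∫|∇v|²)^{1/4} (2∫|∇²v|² + 2c²∫|∇v|²)^{3/4}`
(viscous and transport pairings by parts; the stretching by Hölder–Gagliardo–Nirenberg).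
[folklore] -/
theorem enstrophy_pairing_le {ν c B : ℝ} (hν : 0 ≤ ν) (hc : 0 ≤ c)
    (hv : ContDiff ℝ ∞ v) (hdiv : ∀ x, ∑ i, pderiv i (fun y => v y i) x = 0)
    (hvB : ∀ x, ‖v x‖ ≤ B)
    (h1 : Integrable (levelSq 1 v)) (h2 : Integrable (levelSq 2 v))
    (hφ : ContDiff ℝ ∞ φ) (hφc : HasCompactSupport φ) (hφ0 : ∀ x, 0 ≤ φ x) (hφ1 : ∀ x, φ x ≤ 1)
    (hcφ : ∀ x, ‖fderiv ℝ φ x‖ ≤ c)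
    (Wdot : (Fin 0 → Fin 3) × Fin 3 × Fin 3 → ℝ³ → ℝ) (hWc : ∀ c', Continuous (Wdot c'))
    (hforce : ∀ c' x, |Wdot c' x - ν * ∑ j, pderiv j (pderiv j (vortFam 0 v c')) x +
        ∑ j, v x j * pderiv j (vortFam 0 v c') x| ≤ 12 * levelSq 1 v x) :
    ∑ c', 2 * ∫ x, φ x ^ 4 * (Wdot c' x * vortFam 0 v c' x) ≤
      -(3 / 2 * ν) * (∫ x, φ x ^ 4 * vortSq 1 v x) +
        (96 * ν * c ^ 2 + 12 * c * B) * (∫ x, vortSq 0 v x) +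
        1944 * ((eLpNormLESNormFDerivOfEqInnerConst (volume : Measure ℝ³) 2 : ℝ) ^ (3 / 2 : ℝ)) *
          (Real.sqrt (∫ x, vortSq 0 v x) *
            ((∫ x, levelSq 1 v x) ^ (1 / 4 : ℝ) *
              (2 * (∫ x, levelSq 2 v x) + 2 * c ^ 2 * ∫ x, levelSq 1 v x) ^ (3 / 4 : ℝ))) := by
  set K : ℝ := (eLpNormLESNormFDerivOfEqInnerConst (volume : Measure ℝ³) 2 : ℝ) ^ (3 / 2 : ℝ) with hK
  set a₁ := ∫ x, levelSq 1 v x with ha₁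
  set a₂ := ∫ x, levelSq 2 v x with ha₂
  set y := ∫ x, vortSq 0 v x with hy
  set Q := (2 * a₂ + 2 * c ^ 2 * a₁) ^ (3 / 4 : ℝ) with hQ
  have hK0 : 0 ≤ K := Real.rpow_nonneg (NNReal.coe_nonneg _) _
  have ha₁0 : 0 ≤ a₁ := integral_nonneg fun x => levelSq_nonneg 1 v x
  have hy0 : 0 ≤ y := integral_nonneg fun x => vortSq_nonneg 0 v x
  have ha₂0 : 0 ≤ a₂ := integral_nonneg fun x => levelSq_nonneg 2 v x
  have hQ0 : 0 ≤ Q := Real.rpow_nonneg (by positivity) _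
  have hpφ : ∀ l x, |pderiv l φ x| ≤ c := fun l x => (abs_pderiv_le_norm_fderiv l φ x).trans (hcφ x)
  have hφcont := hφ.continuous
  have hy_int : Integrable (vortSq 0 v) := integrable_vortSq_of_levelSq_succ hv 0 h1
  -- the per-component inequality
  have hWsm : ∀ c', ContDiff ℝ ∞ (vortFam 0 v c') := fun c' => contDiff_vortFam hv 0 c'
  have hcomp := fun c' => component_pairing_le (hWsm c') (hWc c') hv hdiv hφ hφc hφ0 hpφ hν
    (Wdot := Wdot c')
  have hsum := Finset.sum_le_sum fun c' (_ : c' ∈ Finset.univ) => hcomp c'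
  -- (1) dissipation
  have cdW : ∀ c' j, Continuous (pderiv j (vortFam 0 v c')) := fun c' j =>
    continuous_pderiv (hWsm c') (by simp) j
  have iA : ∀ c', Integrable fun x => φ x ^ 4 * ∑ j, pderiv j (vortFam 0 v c') x ^ 2 := fun c' =>
    integrable_pow_mul_of_continuous hφcont hφc
      (continuous_finsetSum _ fun j _ => (cdW c' j).pow 2) (by norm_num)
  have e1 : ∑ c', ∫ x, φ x ^ 4 * ∑ j, pderiv j (vortFam 0 v c') x ^ 2 =
      ∫ x, φ x ^ 4 * vortSq 1 v x := by
    rw [← integral_finsetSum _ fun c' _ => iA c']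
    refine integral_congr_ae (Eventually.of_forall fun x => ?_)
    simp only
    rw [← Finset.mul_sum, ← sum_sq_pderiv_vortFam 0 v x, Finset.sum_comm]
  -- components squared are dominated by `|Ω|²`
  have hWsq_le : ∀ c' x, vortFam 0 v c' x ^ 2 ≤ vortSq 0 v x := fun c' x => by
    rw [← sum_sq_vortFam 0 v x]
    exact Finset.single_le_sum (f := fun d => vortFam 0 v d x ^ 2) (fun _ _ => sq_nonneg _)
      (Finset.mem_univ c')
  have iWsq : ∀ c', Integrable fun x => vortFam 0 v c' x ^ 2 := fun c' =>
    hy_int.mono' (((hWsm c').continuous.pow 2)).aestronglyMeasurable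
      (Eventually.of_forall fun x => by
        rw [Real.norm_of_nonneg (sq_nonneg _)]; exact hWsq_le c' x)
  -- (2) `96 ν c² ∑ ∫ φ² W_c² ≤ 96 ν c² y`
  have iB : ∀ c', Integrable fun x => φ x ^ 2 * vortFam 0 v c' x ^ 2 := fun c' =>
    integrable_pow_mul_of_continuous hφcont hφc ((hWsm c').continuous.pow 2) (by norm_num)
  have e2 : ∑ c', ∫ x, φ x ^ 2 * vortFam 0 v c' x ^ 2 ≤ y := by
    calc ∑ c', ∫ x, φ x ^ 2 * vortFam 0 v c' x ^ 2 = ∫ x, φ x ^ 2 * vortSq 0 v x := by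
          rw [← integral_finsetSum _ fun c' _ => iB c']
          refine integral_congr_ae (Eventually.of_forall fun x => ?_)
          simp only
          rw [← Finset.mul_sum, sum_sq_vortFam]
      _ ≤ ∫ x, vortSq 0 v x := by
          refine integral_mono ?_ hy_int fun x => ?_
          · exact integrable_pow_mul_of_continuous hφcont hφc (continuous_vortSq hv 0) (by norm_num)
          · calc φ x ^ 2 * vortSq 0 v x ≤ 1 * vortSq 0 v x :=
                  mul_le_mul_of_nonneg_right (pow_le_one₀ (hφ0 x) (hφ1 x)) (vortSq_nonneg 0 v x)
              _ = vortSq 0 v x := one_mul _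
  -- (3) transport terms: `∑_c ∫ 4φ³ (∇φ·v) W_c² ≤ 12 c B y`
  have cdφ : ∀ j, Continuous (pderiv j φ) := fun j => continuous_pderiv hφ (by simp) j
  have cV : ∀ j, Continuous fun y => v y j := fun j => (contDiff_comp_of_contDiff hv j).continuous
  have hs : ∀ x, |∑ j, pderiv j φ x * v x j| ≤ 3 * (c * B) := by
    intro x
    calc |∑ j, pderiv j φ x * v x j| ≤ ∑ j, |pderiv j φ x * v x j| := Finset.abs_sum_le_sum_abs _ _
      _ ≤ ∑ _j : Fin 3, c * B := Finset.sum_le_sum fun j _ => by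
          rw [abs_mul]
          refine mul_le_mul (hpφ j x) ?_ (abs_nonneg _) hc
          exact (abs_apply_le_norm' (v x) j).trans (hvB x)
      _ = 3 * (c * B) := by simp
  have e3 : ∑ c', ∫ x, 4 * φ x ^ 3 * (∑ j, pderiv j φ x * v x j) * vortFam 0 v c' x ^ 2 ≤
      12 * c * B * y := by
    have hi : ∀ c', Integrable fun x => 4 * φ x ^ 3 * (∑ j, pderiv j φ x * v x j) *
        vortFam 0 v c' x ^ 2 := by
      intro c'
      have : (fun x => 4 * φ x ^ 3 * (∑ j, pderiv j φ x * v x j) * vortFam 0 v c' x ^ 2) =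
          fun x => φ x ^ 3 * (4 * (∑ j, pderiv j φ x * v x j) * vortFam 0 v c' x ^ 2) := by
        funext x; ring
      rw [this]
      exact integrable_pow_mul_of_continuous hφcont hφc ((continuous_const.mul
        (continuous_finsetSum _ fun j _ => (cdφ j).mul (cV j))).mul ((hWsm c').continuous.pow 2))
        (by norm_num)
    have hle : ∀ c', ∫ x, 4 * φ x ^ 3 * (∑ j, pderiv j φ x * v x j) * vortFam 0 v c' x ^ 2 ≤
        12 * c * B * ∫ x, vortFam 0 v c' x ^ 2 := by
      intro c'
      rw [← integral_const_mul]
      refine integral_mono (hi c') ((iWsq c').const_mul _) fun x => ?_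
      have hφ3 : 0 ≤ φ x ^ 3 := pow_nonneg (hφ0 x) 3
      have hφ3' : φ x ^ 3 ≤ 1 := pow_le_one₀ (hφ0 x) (hφ1 x)
      have hW2 : 0 ≤ vortFam 0 v c' x ^ 2 := sq_nonneg _
      calc 4 * φ x ^ 3 * (∑ j, pderiv j φ x * v x j) * vortFam 0 v c' x ^ 2
          ≤ 4 * φ x ^ 3 * |∑ j, pderiv j φ x * v x j| * vortFam 0 v c' x ^ 2 :=
            mul_le_mul_of_nonneg_right (mul_le_mul_of_nonneg_left (le_abs_self _) (by positivity)) hW2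
        _ ≤ 4 * 1 * (3 * (c * B)) * vortFam 0 v c' x ^ 2 :=
            mul_le_mul_of_nonneg_right (mul_le_mul (mul_le_mul_of_nonneg_left hφ3' (by norm_num))
              (hs x) (abs_nonneg _) (by norm_num)) hW2
        _ = 12 * c * B * vortFam 0 v c' x ^ 2 := by ring
    calc ∑ c', ∫ x, 4 * φ x ^ 3 * (∑ j, pderiv j φ x * v x j) * vortFam 0 v c' x ^ 2
        ≤ ∑ c', 12 * c * B * ∫ x, vortFam 0 v c' x ^ 2 := Finset.sum_le_sum fun c' _ => hle c'
      _ = 12 * c * B * ∫ x, vortSq 0 v x := by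
          rw [← Finset.mul_sum, ← integral_finsetSum _ fun c' _ => iWsq c']
          congr 1
          exact integral_congr_ae (Eventually.of_forall fun x => by simp only; exact sum_sq_vortFam 0 v x)
      _ = 12 * c * B * y := rfl
  -- (4) forcing terms: `2∫ φ⁴ W_c F_c ≤ 24 ∫ φ⁴ |W_c| A₁ ≤ 24·9 K √y a₁^{1/4} Q`
  set F : (Fin 0 → Fin 3) × Fin 3 × Fin 3 → ℝ³ → ℝ := fun c' x =>
    Wdot c' x - ν * ∑ j, pderiv j (pderiv j (vortFam 0 v c')) x +
      ∑ j, v x j * pderiv j (vortFam 0 v c') x with hF_def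
  have cF : ∀ c', Continuous (F c') := fun c' =>
    ((hWc c').sub (continuous_const.mul (continuous_finsetSum _ fun j _ =>
      continuous_pderiv (contDiff_pderiv (hWsm c') j) (by simp) j))).add
      (continuous_finsetSum _ fun j _ => (cV j).mul (cdW c' j))
  have hA1c : Continuous (levelSq 1 v) := continuous_levelSq hv 1
  have e4 : ∀ c', 2 * ∫ x, φ x ^ 4 * (vortFam 0 v c' x * F c' x) ≤
      24 * (9 * (Real.sqrt y * (K * (a₁ ^ (1 / 4 : ℝ) * Q)))) := by
    intro c'
    have iL : Integrable fun x => φ x ^ 4 * (vortFam 0 v c' x * F c' x) :=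
      integrable_pow_mul_of_continuous hφcont hφc ((hWsm c').continuous.mul (cF c')) (by norm_num)
    have iR : Integrable fun x => φ x ^ 4 * (|vortFam 0 v c' x| * levelSq 1 v x) :=
      integrable_pow_mul_of_continuous hφcont hφc ((hWsm c').continuous.abs.mul hA1c) (by norm_num)
    have step1 : ∫ x, φ x ^ 4 * (vortFam 0 v c' x * F c' x) ≤
        12 * ∫ x, φ x ^ 4 * (|vortFam 0 v c' x| * levelSq 1 v x) := by
      rw [← integral_const_mul]
      refine integral_mono iL (iR.const_mul 12) fun x => ?_
      have hφ4 : 0 ≤ φ x ^ 4 := pow_nonneg (hφ0 x) 4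
      have hFx : |F c' x| ≤ 12 * levelSq 1 v x := hforce c' x
      calc φ x ^ 4 * (vortFam 0 v c' x * F c' x) ≤ φ x ^ 4 * (|vortFam 0 v c' x| * |F c' x|) := by
            refine mul_le_mul_of_nonneg_left ?_ hφ4
            rw [← abs_mul]; exact le_abs_self _
        _ ≤ φ x ^ 4 * (|vortFam 0 v c' x| * (12 * levelSq 1 v x)) := by
            gcongr
        _ = 12 * (φ x ^ 4 * (|vortFam 0 v c' x| * levelSq 1 v x)) := by ring
    -- `∫ φ⁴ |W| A₁ = ∑_{i,l} ∫ φ⁴ |W| (∂ₗvᵢ)²`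
    have iP : ∀ i l, Integrable fun x => φ x ^ 4 * |vortFam 0 v c' x| *
        pderiv l (fun y => v y i) x ^ 2 := fun i l => by
      have : (fun x => φ x ^ 4 * |vortFam 0 v c' x| * pderiv l (fun y => v y i) x ^ 2) =
          fun x => φ x ^ 4 * (|vortFam 0 v c' x| * pderiv l (fun y => v y i) x ^ 2) := by
        funext x; ring
      rw [this]
      exact integrable_pow_mul_of_continuous hφcont hφc ((hWsm c').continuous.abs.mul
        ((continuous_pderiv (contDiff_comp_of_contDiff hv i) (by simp) l).pow 2)) (by norm_num)
    have step2 : ∫ x, φ x ^ 4 * (|vortFam 0 v c' x| * levelSq 1 v x) =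
        ∑ i, ∑ l, ∫ x, φ x ^ 4 * |vortFam 0 v c' x| * pderiv l (fun y => v y i) x ^ 2 := by
      have : (fun x => φ x ^ 4 * (|vortFam 0 v c' x| * levelSq 1 v x)) =
          fun x => ∑ i, ∑ l, φ x ^ 4 * |vortFam 0 v c' x| * pderiv l (fun y => v y i) x ^ 2 := by
        funext x
        rw [levelSq_one_eq_sum_sum hv x, Finset.mul_sum, Finset.mul_sum]
        refine Finset.sum_congr rfl fun i _ => ?_
        rw [Finset.mul_sum, Finset.mul_sum]
        refine Finset.sum_congr rfl fun l _ => ?_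
        ring
      rw [this, integral_finsetSum _ fun i _ => integrable_finsetSum _ fun l _ => iP i l]
      exact Finset.sum_congr rfl fun i _ => integral_finsetSum _ fun l _ => iP i l
    have step3 : ∀ i l, ∫ x, φ x ^ 4 * |vortFam 0 v c' x| * pderiv l (fun y => v y i) x ^ 2 ≤
        Real.sqrt y * (K * (a₁ ^ (1 / 4 : ℝ) * Q)) := by
      intro i l
      have h := integral_pow_four_mul_abs_mul_sq_pderiv_le hv h1 h2 hφ hφc hφ0 hφ1 hcφ
        (hWsm c').continuous l i
      refine h.trans ?_
      rw [← hK, ← ha₁, ← ha₂, ← hQ]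
      refine mul_le_mul_of_nonneg_right ?_ (by positivity)
      refine Real.sqrt_le_sqrt ?_
      calc ∫ x, φ x ^ 4 * vortFam 0 v c' x ^ 2 ≤ ∫ x, vortFam 0 v c' x ^ 2 := by
            refine integral_mono (integrable_pow_mul_of_continuous hφcont hφc
              ((hWsm c').continuous.pow 2) (by norm_num)) (iWsq c') fun x => ?_
            calc φ x ^ 4 * vortFam 0 v c' x ^ 2 ≤ 1 * vortFam 0 v c' x ^ 2 :=
                  mul_le_mul_of_nonneg_right (pow_le_one₀ (hφ0 x) (hφ1 x)) (sq_nonneg _)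
              _ = _ := one_mul _
        _ ≤ y := integral_mono (iWsq c') hy_int (hWsq_le c')
    calc 2 * ∫ x, φ x ^ 4 * (vortFam 0 v c' x * F c' x)
        ≤ 2 * (12 * ∫ x, φ x ^ 4 * (|vortFam 0 v c' x| * levelSq 1 v x)) := by linarith [step1]
      _ = 24 * ∑ i, ∑ l, ∫ x, φ x ^ 4 * |vortFam 0 v c' x| * pderiv l (fun y => v y i) x ^ 2 := by
          rw [step2]; ring
      _ ≤ 24 * ∑ _i : Fin 3, ∑ _l : Fin 3, Real.sqrt y * (K * (a₁ ^ (1 / 4 : ℝ) * Q)) := by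
          gcongr with i _ l _
          exact step3 i l
      _ = 24 * (9 * (Real.sqrt y * (K * (a₁ ^ (1 / 4 : ℝ) * Q)))) := by
          simp only [Finset.sum_const, Finset.card_univ, Fintype.card_fin, nsmul_eq_mul]
          push_cast; ring
  have e4s : ∑ c', 2 * ∫ x, φ x ^ 4 * (vortFam 0 v c' x * F c' x) ≤
      1944 * K * (Real.sqrt y * (a₁ ^ (1 / 4 : ℝ) * Q)) := by
    calc ∑ c', 2 * ∫ x, φ x ^ 4 * (vortFam 0 v c' x * F c' x)
        ≤ ∑ _c' : (Fin 0 → Fin 3) × Fin 3 × Fin 3, 24 * (9 * (Real.sqrt y * (K * (a₁ ^ (1 / 4 : ℝ) * Q)))) :=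
          Finset.sum_le_sum fun c' _ => e4 c'
      _ = 1944 * K * (Real.sqrt y * (a₁ ^ (1 / 4 : ℝ) * Q)) := by
          simp only [Finset.sum_const, Finset.card_univ, Fintype.card_prod, Fintype.card_fun,
            Fintype.card_fin, nsmul_eq_mul]
          push_cast; ring
  -- assemble
  simp only [Finset.sum_add_distrib, ← Finset.mul_sum, e1] at hsum
  have hF_eq : ∀ c', (∫ x, φ x ^ 4 * (vortFam 0 v c' x * (Wdot c' x -
      ν * ∑ j, pderiv j (pderiv j (vortFam 0 v c')) x + ∑ j, v x j * pderiv j (vortFam 0 v c') x))) =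
      ∫ x, φ x ^ 4 * (vortFam 0 v c' x * F c' x) := fun c' => rfl
  simp only [hF_eq] at hsum
  rw [← Finset.mul_sum] at e4s ⊢
  have hc2 : 0 ≤ c ^ 2 := sq_nonneg c
  have hD0 : 0 ≤ ∫ x, φ x ^ 4 * vortSq 1 v x :=
    integral_nonneg fun x => mul_nonneg (pow_nonneg (hφ0 x) 4) (vortSq_nonneg 1 v x)
  nlinarith [hsum, e2, e3, e4s, mul_nonneg hν hc2, hD0, hy0]

end SliceZero

section Solution

variable {T ν : ℝ} {u : ℝ → ℝ³ → ℝ³} {p : ℝ → ℝ³ → ℝ}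

/-- The forcing constant `1944 K^{3/2}` of the level-zero enstrophy pairing. [folklore] -/
noncomputable def stretchConst : ℝ :=
  1944 * ((eLpNormLESNormFDerivOfEqInnerConst (volume : Measure ℝ³) 2 : ℝ) ^ (3 / 2 : ℝ))

/-- The stretching constant is nonnegative. [folklore] -/
theorem stretchConst_nonneg : 0 ≤ stretchConst :=
  mul_nonneg (by norm_num) (Real.rpow_nonneg (NNReal.coe_nonneg _) _)

/-- **The localised enstrophy pairing of a bounded classical solution.** For an unforced
classical solution on `[0, T] × ℝ³` with `|u| ≤ B`, the cutoff `χ_R` (`‖Dχ_R‖ ≤ C_χ/R`) and a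
time `t` at which `|∇u(t)|², |∇²u(t)|² ∈ L¹`:
`∑_c 2∫χ_R⁴ ∂ₜΩ_c Ω_c ≤ −(3/2)ν ∫χ_R⁴|∇Ω|² + (96ν(C_χ/R)² + 12(C_χ/R)B) ∫|Ω|²
  + 1944K^{3/2} (∫|Ω|²)^{1/2} (∫|∇u|²)^{1/4} (2∫|∇²u|² + 2(C_χ/R)²∫|∇u|²)^{3/4}`. [folklore] -/
theorem IsClassicalNSSolutionOn.enstrophy_pairing_cutoff_le
    (h : IsClassicalNSSolutionOn (Icc 0 T) ν 0 u p) (hν : 0 < ν) (hT : 0 < T)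
    {B : ℝ} (hB : ∀ t ∈ Icc 0 T, ∀ x, ‖u t x‖ ≤ B)
    {Cχ : ℝ} (hCχ0 : 0 ≤ Cχ) (hCχ : ∀ R : ℝ, 0 < R → ∀ x : ℝ³, ‖fderiv ℝ (cutoff R) x‖ ≤ Cχ / R)
    {R : ℝ} (hR : 0 < R) {t : ℝ} (ht : t ∈ Icc 0 T)
    (h1 : Integrable (levelSq 1 (u t))) (h2 : Integrable (levelSq 2 (u t))) :
    ∑ c', 2 * ∫ x, cutoff R x ^ 4 *
        (timeDerivWithin (Icc 0 T) (fun s y => vortFam 0 (u s) c' y) t x * vortFam 0 (u t) c' x) ≤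
      -(3 / 2 * ν) * (∫ x, cutoff R x ^ 4 * vortSq 1 (u t) x) +
        (96 * ν * (Cχ / R) ^ 2 + 12 * (Cχ / R) * B) * (∫ x, vortSq 0 (u t) x) +
        stretchConst * (Real.sqrt (∫ x, vortSq 0 (u t) x) *
          ((∫ x, levelSq 1 (u t) x) ^ (1 / 4 : ℝ) *
            (2 * (∫ x, levelSq 2 (u t) x) + 2 * (Cχ / R) ^ 2 * ∫ x, levelSq 1 (u t) x) ^ (3 / 4 : ℝ))) := by
  have hU := uniqueDiffOn_Icc hT
  have hcl := Icc_subset_closure_interior hT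
  have hv : ContDiff ℝ ∞ (u t) := h.contDiff_velocity ht
  have hdiv : ∀ x, ∑ i, pderiv i (fun y => u t y i) x = 0 := fun x => h.sum_pderiv_comp_eq_zero ht x
  have hWc : ∀ c', Continuous fun x =>
      timeDerivWithin (Icc 0 T) (fun s y => vortFam 0 (u s) c' y) t x := fun c' =>
    (((h.isSmoothSpaceTimeOn_vortFam hT 0 c').timeDerivWithin hU).contDiff_slice ht).continuous
  have hforce : ∀ c' x, |timeDerivWithin (Icc 0 T) (fun s y => vortFam 0 (u s) c' y) t x -
        ν * ∑ j, pderiv j (pderiv j (vortFam 0 (u t) c')) x +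
        ∑ j, u t x j * pderiv j (vortFam 0 (u t) c') x| ≤ 12 * levelSq 1 (u t) x := by
    intro c' x
    have := h.abs_vorticity_forcing_le hU hcl ht x c'.1 c'.2.1 c'.2.2
    rw [Fintype.card_fin, sum_Icc_one_one_sqrt_levelSq] at this
    push_cast at this
    have e : (2 : ℝ) * 3 * 2 ^ (0 + 1) = 12 := by norm_num
    rw [e] at this
    exact this
  exact enstrophy_pairing_le hν.le (div_nonneg hCχ0 hR.le) hv hdiv (hB t ht) h1 h2
    (contDiff_cutoff R) (hasCompactSupport_cutoff hR) (cutoff_nonneg R) (cutoff_le_one R)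
    (hCχ R hR) _ hWc hforce

end Solution

section CutoffLimits

/-- **Removing the cutoff.** For a continuous integrable `g` and `k ≥ 0`,
`∫ χ_{n+1}ᵏ g → ∫ g` as `n → ∞` (dominated convergence; `χ_R(x) = 1` once `R ≥ |x|`). [folklore] -/
theorem tendsto_integral_cutoff_pow_mul {g : ℝ³ → ℝ} (hg : Continuous g) (hgi : Integrable g)
    (k : ℕ) :
    Tendsto (fun n : ℕ => ∫ x, cutoff ((n : ℝ) + 1) x ^ k * g x) atTop (𝓝 (∫ x, g x)) := by
  refine tendsto_integral_of_dominated_convergence (fun x => ‖g x‖) (fun n => ?_) hgi.norm ?_ ?_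
  · exact (((contDiff_cutoff (E := ℝ³) (n := 0) ((n : ℝ) + 1)).continuous.pow k).mul hg).aestronglyMeasurable
  · intro n
    refine Eventually.of_forall fun x => ?_
    rw [norm_mul, norm_pow, Real.norm_of_nonneg (cutoff_nonneg _ _)]
    calc cutoff ((n : ℝ) + 1) x ^ k * ‖g x‖ ≤ 1 ^ k * ‖g x‖ := by
          gcongr
          · exact cutoff_nonneg _ _
          · exact cutoff_le_one _ _
      _ = ‖g x‖ := by rw [one_pow, one_mul]
  · refine Eventually.of_forall fun x => ?_
    apply tendsto_const_nhds.congr'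
    have hev : ∀ᶠ n : ℕ in atTop, ‖x‖ ≤ (n : ℝ) := tendsto_natCast_atTop_atTop.eventually_ge_atTop ‖x‖
    filter_upwards [hev] with n hn
    have hpos : (0 : ℝ) < (n : ℝ) + 1 := by positivity
    rw [cutoff_eq_one hpos (by linarith), one_pow, one_mul]

variable {v : ℝ³ → ℝ³}

/-- **Global div–curl bound**: for a smooth divergence-free field with `|∇ᵐv|², |∇^{m+1}v|² ∈ L¹`,
`∫ |∇^{m+1}v|² ≤ ∫ |∇ᵐΩ|²` (the weighted div–curl inequality with the cutoff `χ_R`, `R → ∞`;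
on the whole space the cross term integrates to zero: Doering–Gibbon 1995, (6.1.5)–(6.1.6)).
[folklore] -/
theorem integral_levelSq_succ_le_integral_vortSq (hv : ContDiff ℝ ∞ v)
    (hdiv : ∀ x, ∑ i, pderiv i (fun y => v y i) x = 0) (m : ℕ)
    (hm : Integrable (levelSq m v)) (hm1 : Integrable (levelSq (m + 1) v)) :
    ∫ x, levelSq (m + 1) v x ≤ ∫ x, vortSq m v x := by
  obtain ⟨C, hC0, hC⟩ := exists_norm_fderiv_cutoff_le (E := ℝ³)
  have hB : Integrable (vortSq m v) :=
    (hm1.const_mul 4).mono' (continuous_vortSq hv m).aestronglyMeasurable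
      (Eventually.of_forall fun x => by
        rw [Real.norm_of_nonneg (vortSq_nonneg m v x)]
        exact vortSq_le_four_mul_levelSq_succ hv m x)
  -- for each `n`: `∫ χ⁴ A_{m+1} ≤ ∫ B_m + 48 C²/(n+1)² ∫ A_m`
  have hstep : ∀ n : ℕ, ∫ x, cutoff ((n : ℝ) + 1) x ^ 4 * levelSq (m + 1) v x ≤
      (∫ x, vortSq m v x) + 16 * (C / ((n : ℝ) + 1)) ^ 2 * 3 * ∫ x, levelSq m v x := by
    intro n
    have hR : (0 : ℝ) < (n : ℝ) + 1 := by positivity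
    have hc : ∀ l x, |pderiv l (cutoff ((n : ℝ) + 1)) x| ≤ C / ((n : ℝ) + 1) := fun l x =>
      (abs_pderiv_le_norm_fderiv l _ x).trans (hC _ hR x)
    have h := integral_pow_four_mul_levelSq_succ_le hv hdiv (contDiff_cutoff (E := ℝ³) ((n : ℝ) + 1))
      (hasCompactSupport_cutoff (E := ℝ³) hR) (cutoff_nonneg ((n : ℝ) + 1)) hc m
    have hcard : ((Fintype.card (Fin 3) : ℕ) : ℝ) = 3 := by simp
    rw [hcard] at h
    have i1 : ∫ x, cutoff ((n : ℝ) + 1) x ^ 4 * vortSq m v x ≤ ∫ x, vortSq m v x := by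
      refine integral_mono (integrable_cutoff_pow_mul (continuous_vortSq hv m) hR (j := 4) (by norm_num))
        hB fun x => ?_
      calc cutoff ((n : ℝ) + 1) x ^ 4 * vortSq m v x ≤ 1 * vortSq m v x :=
            mul_le_mul_of_nonneg_right (pow_le_one₀ (cutoff_nonneg _ _) (cutoff_le_one _ _))
              (vortSq_nonneg m v x)
        _ = vortSq m v x := one_mul _
    have i2 : ∫ x, cutoff ((n : ℝ) + 1) x ^ 2 * levelSq m v x ≤ ∫ x, levelSq m v x := by
      refine integral_mono (integrable_cutoff_pow_mul (continuous_levelSq hv m) hR (j := 2) (by norm_num))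
        hm fun x => ?_
      calc cutoff ((n : ℝ) + 1) x ^ 2 * levelSq m v x ≤ 1 * levelSq m v x :=
            mul_le_mul_of_nonneg_right (pow_le_one₀ (cutoff_nonneg _ _) (cutoff_le_one _ _))
              (levelSq_nonneg m v x)
        _ = levelSq m v x := one_mul _
    have i2' : 16 * (C / ((n : ℝ) + 1)) ^ 2 * 3 * ∫ x, cutoff ((n : ℝ) + 1) x ^ 2 * levelSq m v x ≤
        16 * (C / ((n : ℝ) + 1)) ^ 2 * 3 * ∫ x, levelSq m v x :=
      mul_le_mul_of_nonneg_left i2 (by positivity)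
    linarith [h, i1, i2']
  -- limits
  have hL : Tendsto (fun n : ℕ => ∫ x, cutoff ((n : ℝ) + 1) x ^ 4 * levelSq (m + 1) v x) atTop
      (𝓝 (∫ x, levelSq (m + 1) v x)) :=
    tendsto_integral_cutoff_pow_mul (continuous_levelSq hv (m + 1)) hm1 4
  have h0 : Tendsto (fun n : ℕ => C / ((n : ℝ) + 1)) atTop (𝓝 0) :=
    tendsto_const_nhds.div_atTop (tendsto_atTop_add_const_right _ 1 tendsto_natCast_atTop_atTop)
  have hRlim : Tendsto (fun n : ℕ => (∫ x, vortSq m v x) +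
      16 * (C / ((n : ℝ) + 1)) ^ 2 * 3 * ∫ x, levelSq m v x) atTop (𝓝 (∫ x, vortSq m v x)) := by
    have := (tendsto_const_nhds (x := ∫ x, vortSq m v x)).add
      ((((h0.pow 2).const_mul 16).mul_const 3).mul_const (∫ x, levelSq m v x))
    simpa using this
  exact le_of_tendsto_of_tendsto' hL hRlim hstep

end CutoffLimits

end Literature.Analysis.FluidPDE

namespace Literature.Analysis.FluidPDE

/-- Local notation for physical space `ℝ³ = EuclideanSpace ℝ (Fin 3)`. -/
local notation "ℝ³" => EuclideanSpace ℝ (Fin 3)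

/-! ## Global enstrophy quantities along a strong solution -/

section Quantities

variable (u : ℝ → ℝ³ → ℝ³)

/-- The enstrophy `y(t) = ∫ |Ω(t)|²` (`= 2∫|ω|²`). [folklore] -/
noncomputable def enstrophyAt (t : ℝ) : ℝ := ∫ x, vortSq 0 (u t) x

/-- The palinstrophy `z(t) = ∫ |∇Ω(t)|²`. [folklore] -/
noncomputable def palinstrophyAt (t : ℝ) : ℝ := ∫ x, vortSq 1 (u t) x

/-- `aₘ(t) = ∫ |∇ᵐ u(t)|²`. [folklore] -/
noncomputable def levelInt (m : ℕ) (t : ℝ) : ℝ := ∫ x, levelSq m (u t) x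

/-- The localised enstrophy `y_n(t) = ∫ χ_{n+1}⁴ |Ω(t)|²`. [folklore] -/
noncomputable def enstrophyCut (n : ℕ) (t : ℝ) : ℝ := ∫ x, cutoff ((n : ℝ) + 1) x ^ 4 * vortSq 0 (u t) x

/-- The localised palinstrophy `D_n(t) = ∫ χ_{n+1}⁴ |∇Ω(t)|²`. [folklore] -/
noncomputable def palinstrophyCut (n : ℕ) (t : ℝ) : ℝ :=
  ∫ x, cutoff ((n : ℝ) + 1) x ^ 4 * vortSq 1 (u t) x

/-- The localised enstrophy pairing `h_n(t) = ∑_c 2∫ χ_{n+1}⁴ ∂ₜΩ_c(t) Ω_c(t)`. [folklore] -/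
noncomputable def pairingCut (T : ℝ) (n : ℕ) (t : ℝ) : ℝ :=
  ∑ c', 2 * ∫ x, cutoff ((n : ℝ) + 1) x ^ 4 *
    (timeDerivWithin (Icc 0 T) (fun s y => vortFam 0 (u s) c' y) t x * vortFam 0 (u t) c' x)

/-- The stretching bound `N(t) = 1944 K^{3/2} y^{1/2} a₁^{1/4} (2a₂)^{3/4}`. [folklore] -/
noncomputable def stretchAt (t : ℝ) : ℝ :=
  stretchConst * (Real.sqrt (enstrophyAt u t) *
    (levelInt u 1 t ^ (1 / 4 : ℝ) * (2 * levelInt u 2 t) ^ (3 / 4 : ℝ)))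

/-- `0 ≤ y(t) ≤ 4 S₁`, `0 ≤ z(t) ≤ 4 S₂`. [folklore] -/
theorem enstrophyAt_nonneg (t : ℝ) : 0 ≤ enstrophyAt u t := integral_nonneg fun x => vortSq_nonneg 0 _ x
/-- `0 ≤ z(t)`. [folklore] -/
theorem palinstrophyAt_nonneg (t : ℝ) : 0 ≤ palinstrophyAt u t := integral_nonneg fun x => vortSq_nonneg 1 _ x
/-- `0 ≤ aₘ(t)`. [folklore] -/
theorem levelInt_nonneg (m : ℕ) (t : ℝ) : 0 ≤ levelInt u m t := integral_nonneg fun x => levelSq_nonneg m _ x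
/-- `0 ≤ y_n(t)`. [folklore] -/
theorem enstrophyCut_nonneg (n : ℕ) (t : ℝ) : 0 ≤ enstrophyCut u n t :=
  integral_nonneg fun x => mul_nonneg (pow_nonneg (cutoff_nonneg _ _) 4) (vortSq_nonneg 0 _ x)
/-- `0 ≤ D_n(t)`. [folklore] -/
theorem palinstrophyCut_nonneg (n : ℕ) (t : ℝ) : 0 ≤ palinstrophyCut u n t :=
  integral_nonneg fun x => mul_nonneg (pow_nonneg (cutoff_nonneg _ _) 4) (vortSq_nonneg 1 _ x)

/-- `0 ≤ N(t)`. [folklore] -/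
theorem stretchAt_nonneg (t : ℝ) : 0 ≤ stretchAt u t := by
  unfold stretchAt
  have h1 := levelInt_nonneg u 1 t
  have h2 := levelInt_nonneg u 2 t
  exact mul_nonneg stretchConst_nonneg (mul_nonneg (Real.sqrt_nonneg _)
    (mul_nonneg (Real.rpow_nonneg h1 _) (Real.rpow_nonneg (by linarith) _)))

end Quantities

section Facts

variable {T ν : ℝ} {u : ℝ → ℝ³ → ℝ³} {p : ℝ → ℝ³ → ℝ}

/-- **Uniform `Hᵐ` data.** From `u ∈ L^∞_t H^k_x` (all `k`): nonnegative constants `S m` with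
`|∇ᵐu(t)|² ∈ L¹` and `∫|∇ᵐu(t)|² ≤ S m` for all `t ∈ [0, T]`. [folklore] -/
theorem IsClassicalNSSolutionOn.exists_levelSq_bounds
    (h : IsClassicalNSSolutionOn (Icc 0 T) ν 0 u p) (hHB : FluidPDE.HasBoundedSobolevNormsOn (Icc 0 T) u) :
    ∃ S : ℕ → ℝ, (∀ m, 0 ≤ S m) ∧
      ∀ m, ∀ t ∈ Icc 0 T, Integrable (levelSq m (u t)) ∧ ∫ x, levelSq m (u t) x ≤ S m := by
  choose C hC using hHB
  refine ⟨fun m => 3 ^ (m + 1) * (C m : ℝ), fun m => by positivity, fun m t ht => ?_⟩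
  have hv : ContDiff ℝ ∞ (u t) := h.contDiff_velocity ht
  have hlt : ∫⁻ x, ‖iteratedFDeriv ℝ m (u t) x‖ₑ ^ 2 < ⊤ := (hC m t ht).trans_lt ENNReal.coe_lt_top
  obtain ⟨hi, hle⟩ := integrable_levelSq_of_lintegral_lt_top hv m hlt
  refine ⟨hi, hle.trans ?_⟩
  refine mul_le_mul_of_nonneg_left ?_ (by positivity)
  have := ENNReal.toReal_mono ENNReal.coe_ne_top (hC m t ht)
  rwa [ENNReal.coe_toReal] at this

/-- The localised enstrophy identity: `y_n(t) - y_n(0) = ∫₀ᵗ h_n`. [folklore] -/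
theorem IsClassicalNSSolutionOn.enstrophyCut_sub_eq (h : IsClassicalNSSolutionOn (Icc 0 T) ν 0 u p)
    (hT : 0 < T) (n : ℕ) {t : ℝ} (ht : t ∈ Icc 0 T) :
    enstrophyCut u n t - enstrophyCut u n 0 = ∫ τ in Ioo 0 t, pairingCut u T n τ := by
  have hR : (0 : ℝ) < (n : ℝ) + 1 := by positivity
  exact h.integral_cutoff_vortSq_sub_eq hT hR 0 ht

/-- `t ↦ h_n(t)` is continuous on `[0, T]`. [folklore] -/
theorem IsClassicalNSSolutionOn.continuousOn_pairingCut (h : IsClassicalNSSolutionOn (Icc 0 T) ν 0 u p)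
    (hT : 0 < T) (n : ℕ) : ContinuousOn (pairingCut u T n) (Icc 0 T) := by
  have hR : (0 : ℝ) < (n : ℝ) + 1 := by positivity
  unfold pairingCut
  refine continuousOn_finsetSum _ fun c' _ => ?_
  exact (h.continuousOn_integral_cutoff_pow_mul_timeDerivWithin_mul hT hR 0 c').const_smul (2 : ℝ) |>.congr
    fun t _ => by simp [smul_eq_mul]

/-- `t ↦ y_n(t)` and `t ↦ D_n(t)` are continuous on `[0, T]`. [folklore] -/
theorem IsClassicalNSSolutionOn.continuousOn_enstrophyCut (h : IsClassicalNSSolutionOn (Icc 0 T) ν 0 u p)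
    (hT : 0 < T) (n : ℕ) : ContinuousOn (enstrophyCut u n) (Icc 0 T) :=
  h.continuousOn_integral_cutoff_pow_mul_vortSq hT (by positivity) 4 0 (by norm_num)

/-- `t ↦ D_n(t)` is continuous on `[0, T]`. [folklore] -/
theorem IsClassicalNSSolutionOn.continuousOn_palinstrophyCut (h : IsClassicalNSSolutionOn (Icc 0 T) ν 0 u p)
    (hT : 0 < T) (n : ℕ) : ContinuousOn (palinstrophyCut u n) (Icc 0 T) :=
  h.continuousOn_integral_cutoff_pow_mul_vortSq hT (by positivity) 4 1 (by norm_num)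

/-- **`y_n` is differentiable on `(0, T)` with derivative `h_n`** (fundamental theorem of calculus
for the continuous integrand `h_n`). [folklore] -/
theorem IsClassicalNSSolutionOn.hasDerivAt_enstrophyCut (h : IsClassicalNSSolutionOn (Icc 0 T) ν 0 u p)
    (hT : 0 < T) (n : ℕ) {t : ℝ} (ht : t ∈ Ioo 0 T) :
    HasDerivAt (enstrophyCut u n) (pairingCut u T n t) t := by
  have hcont := h.continuousOn_pairingCut hT n
  -- the primitive `G(s) = y_n(0) + ∫₀ˢ h_n`
  have hG : ∀ s ∈ Icc 0 T, enstrophyCut u n s =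
      enstrophyCut u n 0 + ∫ τ in (0 : ℝ)..s, pairingCut u T n τ := by
    intro s hs
    rw [intervalIntegral.integral_of_le hs.1, integral_Ioc_eq_integral_Ioo,
      ← h.enstrophyCut_sub_eq hT n hs]
    ring
  have hII : IntervalIntegrable (pairingCut u T n) volume 0 t :=
    (hcont.mono (by
      rw [uIcc_of_le ht.1.le]
      exact Icc_subset_Icc le_rfl ht.2.le)).intervalIntegrable
  have hmeas : StronglyMeasurableAtFilter (pairingCut u T n) (𝓝 t) volume :=
    (hcont.mono Ioo_subset_Icc_self).stronglyMeasurableAtFilter isOpen_Ioo t ht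
  have hca : ContinuousAt (pairingCut u T n) t :=
    hcont.continuousAt (Icc_mem_nhds ht.1 ht.2)
  have hD := intervalIntegral.integral_hasDerivAt_right hII hmeas hca
  have hD' : HasDerivAt (fun s => enstrophyCut u n 0 + ∫ τ in (0 : ℝ)..s, pairingCut u T n τ)
      (pairingCut u T n t) t := hD.const_add _
  refine hD'.congr_of_eventuallyEq ?_
  filter_upwards [Icc_mem_nhds ht.1 ht.2] with s hs
  exact hG s hs


/-- Pointwise-in-time structure constants: the velocity bound `B`, the cutoff gradient constant
`C_χ` and the Sobolev data `S`. [folklore] -/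
structure StrongData (T ν : ℝ) (u : ℝ → ℝ³ → ℝ³) where
  B : ℝ
  Cχ : ℝ
  S : ℕ → ℝ
  B_nonneg : 0 ≤ B
  Cχ_nonneg : 0 ≤ Cχ
  S_nonneg : ∀ m, 0 ≤ S m
  norm_le : ∀ t ∈ Icc 0 T, ∀ x, ‖u t x‖ ≤ B
  cutoff_grad : ∀ R : ℝ, 0 < R → ∀ x : ℝ³, ‖fderiv ℝ (cutoff R) x‖ ≤ Cχ / R
  integrable_levelSq : ∀ m, ∀ t ∈ Icc 0 T, Integrable (levelSq m (u t))
  levelInt_le : ∀ m, ∀ t ∈ Icc 0 T, ∫ x, levelSq m (u t) x ≤ S m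

/-- A strong solution (`u ∈ L^∞_t H^k_x` for all `k`) carries `StrongData`. [folklore] -/
theorem IsClassicalNSSolutionOn.nonempty_strongData (h : IsClassicalNSSolutionOn (Icc 0 T) ν 0 u p)
    (hT : 0 < T) (hHB : FluidPDE.HasBoundedSobolevNormsOn (Icc 0 T) u) : Nonempty (StrongData T ν u) := by
  obtain ⟨S, hS0, hS⟩ := h.exists_levelSq_bounds hHB
  obtain ⟨Cχ, hCχ0, hCχ⟩ := exists_norm_fderiv_cutoff_le (E := ℝ³)
  obtain ⟨B, hB⟩ := FluidPDE.linfty_bound_of_hasBoundedSobolevNormsOn_holds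
    (fun t ht => (h.contDiff_velocity ht).of_le (by norm_cast)) hHB
  have hB0 : 0 ≤ B := (norm_nonneg _).trans (hB 0 ⟨le_rfl, hT.le⟩ 0)
  exact ⟨⟨B, Cχ, S, hB0, hCχ0, hS0, hB, hCχ, fun m t ht => (hS m t ht).1, fun m t ht => (hS m t ht).2⟩⟩

/-- `|Ω(t)|², |∇Ω(t)|² ∈ L¹`. [folklore] -/
theorem StrongData.integrable_vortSq (d : StrongData T ν u) (h : IsClassicalNSSolutionOn (Icc 0 T) ν 0 u p) (m : ℕ) {t : ℝ}
    (ht : t ∈ Icc 0 T) : Integrable (vortSq m (u t)) :=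
  integrable_vortSq_of_levelSq_succ (h.contDiff_velocity ht) m (d.integrable_levelSq (m + 1) t ht)


/-- `∫|∇ᵐΩ(t)|² ≤ 4 S_{m+1}`. [folklore] -/
theorem StrongData.vortInt_le (d : StrongData T ν u) (h : IsClassicalNSSolutionOn (Icc 0 T) ν 0 u p) (m : ℕ) {t : ℝ}
    (ht : t ∈ Icc 0 T) : ∫ x, vortSq m (u t) x ≤ 4 * d.S (m + 1) := by
  have hv := h.contDiff_velocity ht
  calc ∫ x, vortSq m (u t) x ≤ ∫ x, 4 * levelSq (m + 1) (u t) x :=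
        integral_mono (d.integrable_vortSq h m ht) ((d.integrable_levelSq (m + 1) t ht).const_mul 4)
          fun x => vortSq_le_four_mul_levelSq_succ hv m x
    _ = 4 * ∫ x, levelSq (m + 1) (u t) x := integral_const_mul _ _
    _ ≤ 4 * d.S (m + 1) := by gcongr; exact d.levelInt_le (m + 1) t ht

/-- `y(t) ≤ 4 S₁`. [folklore] -/
theorem StrongData.enstrophyAt_le (d : StrongData T ν u) (h : IsClassicalNSSolutionOn (Icc 0 T) ν 0 u p) {t : ℝ}
    (ht : t ∈ Icc 0 T) : enstrophyAt u t ≤ 4 * d.S 1 := d.vortInt_le h 0 ht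

/-- `z(t) ≤ 4 S₂`. [folklore] -/
theorem StrongData.palinstrophyAt_le (d : StrongData T ν u) (h : IsClassicalNSSolutionOn (Icc 0 T) ν 0 u p) {t : ℝ}
    (ht : t ∈ Icc 0 T) : palinstrophyAt u t ≤ 4 * d.S 2 := d.vortInt_le h 1 ht

/-- `D_n(t) ≤ z(t)` and `y_n(t) ≤ y(t)`. [folklore] -/
theorem StrongData.palinstrophyCut_le (d : StrongData T ν u) (h : IsClassicalNSSolutionOn (Icc 0 T) ν 0 u p) (n : ℕ) {t : ℝ}
    (ht : t ∈ Icc 0 T) : palinstrophyCut u n t ≤ palinstrophyAt u t := by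
  have hR : (0 : ℝ) < (n : ℝ) + 1 := by positivity
  refine integral_mono (integrable_cutoff_pow_mul (continuous_vortSq (h.contDiff_velocity ht) 1) hR
    (j := 4) (by norm_num)) (d.integrable_vortSq h 1 ht) fun x => ?_
  calc cutoff ((n : ℝ) + 1) x ^ 4 * vortSq 1 (u t) x ≤ 1 * vortSq 1 (u t) x :=
        mul_le_mul_of_nonneg_right (pow_le_one₀ (cutoff_nonneg _ _) (cutoff_le_one _ _)) (vortSq_nonneg 1 _ x)
    _ = _ := one_mul _

/-- `y_n(t) ≤ y(t)`. [folklore] -/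
theorem StrongData.enstrophyCut_le (d : StrongData T ν u) (h : IsClassicalNSSolutionOn (Icc 0 T) ν 0 u p) (n : ℕ) {t : ℝ}
    (ht : t ∈ Icc 0 T) : enstrophyCut u n t ≤ enstrophyAt u t := by
  have hR : (0 : ℝ) < (n : ℝ) + 1 := by positivity
  refine integral_mono (integrable_cutoff_pow_mul (continuous_vortSq (h.contDiff_velocity ht) 0) hR
    (j := 4) (by norm_num)) (d.integrable_vortSq h 0 ht) fun x => ?_
  calc cutoff ((n : ℝ) + 1) x ^ 4 * vortSq 0 (u t) x ≤ 1 * vortSq 0 (u t) x :=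
        mul_le_mul_of_nonneg_right (pow_le_one₀ (cutoff_nonneg _ _) (cutoff_le_one _ _)) (vortSq_nonneg 0 _ x)
    _ = _ := one_mul _

/-- **Global div–curl along the solution**: `a₁(t) ≤ y(t)` and `a₂(t) ≤ z(t)`. [folklore] -/
theorem StrongData.levelInt_one_le (d : StrongData T ν u) (h : IsClassicalNSSolutionOn (Icc 0 T) ν 0 u p) {t : ℝ}
    (ht : t ∈ Icc 0 T) : levelInt u 1 t ≤ enstrophyAt u t :=
  integral_levelSq_succ_le_integral_vortSq (h.contDiff_velocity ht) (h.sum_pderiv_comp_eq_zero ht) 0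
    (d.integrable_levelSq 0 t ht) (d.integrable_levelSq 1 t ht)

/-- `a₂(t) ≤ z(t)` (global div–curl at level one). [folklore] -/
theorem StrongData.levelInt_two_le (d : StrongData T ν u) (h : IsClassicalNSSolutionOn (Icc 0 T) ν 0 u p) {t : ℝ}
    (ht : t ∈ Icc 0 T) : levelInt u 2 t ≤ palinstrophyAt u t :=
  integral_levelSq_succ_le_integral_vortSq (h.contDiff_velocity ht) (h.sum_pderiv_comp_eq_zero ht) 1
    (d.integrable_levelSq 1 t ht) (d.integrable_levelSq 2 t ht)

/-- **Removing the cutoff**: `y_n(t) → y(t)`, `D_n(t) → z(t)`, and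
`∫ χ_{n+1}² |∇ᵐu(t)|² → aₘ(t)`. [folklore] -/
theorem StrongData.tendsto_enstrophyCut (d : StrongData T ν u) (h : IsClassicalNSSolutionOn (Icc 0 T) ν 0 u p) {t : ℝ}
    (ht : t ∈ Icc 0 T) : Tendsto (fun n => enstrophyCut u n t) atTop (𝓝 (enstrophyAt u t)) :=
  tendsto_integral_cutoff_pow_mul (continuous_vortSq (h.contDiff_velocity ht) 0) (d.integrable_vortSq h 0 ht) 4

/-- `D_n(t) → z(t)` as `n → ∞`. [folklore] -/
theorem StrongData.tendsto_palinstrophyCut (d : StrongData T ν u) (h : IsClassicalNSSolutionOn (Icc 0 T) ν 0 u p) {t : ℝ}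
    (ht : t ∈ Icc 0 T) : Tendsto (fun n => palinstrophyCut u n t) atTop (𝓝 (palinstrophyAt u t)) :=
  tendsto_integral_cutoff_pow_mul (continuous_vortSq (h.contDiff_velocity ht) 1) (d.integrable_vortSq h 1 ht) 4

/-- `∫ χ_{n+1}² |∇ᵐu(t)|² → aₘ(t)` as `n → ∞`. [folklore] -/
theorem StrongData.tendsto_levelCut (d : StrongData T ν u) (h : IsClassicalNSSolutionOn (Icc 0 T) ν 0 u p) (m : ℕ) {t : ℝ}
    (ht : t ∈ Icc 0 T) :
    Tendsto (fun n : ℕ => ∫ x, cutoff ((n : ℝ) + 1) x ^ 2 * levelSq m (u t) x) atTop (𝓝 (levelInt u m t)) :=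
  tendsto_integral_cutoff_pow_mul (continuous_levelSq (h.contDiff_velocity ht) m) (d.integrable_levelSq m t ht) 2

/-- **Measurability in time** of `y`, `z`, `aₘ` on `(0, T)`: each is a pointwise limit of functions
continuous on `[0, T]`. [folklore] -/
theorem aestronglyMeasurable_of_tendsto_continuousOn {f : ℕ → ℝ → ℝ} {g : ℝ → ℝ}
    (hf : ∀ n, ContinuousOn (f n) (Icc 0 T))
    (hlim : ∀ t ∈ Icc 0 T, Tendsto (fun n => f n t) atTop (𝓝 (g t))) :
    AEStronglyMeasurable g (volume.restrict (Ioo 0 T)) := by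
  refine aestronglyMeasurable_of_tendsto_ae (f := f) (atTop : Filter ℕ) (fun n => ?_) ?_
  · exact ((hf n).mono Ioo_subset_Icc_self).aestronglyMeasurable measurableSet_Ioo
  · rw [ae_restrict_iff' measurableSet_Ioo]
    exact Eventually.of_forall fun t ht => hlim t (Ioo_subset_Icc_self ht)

/-- `y` is a.e.-strongly measurable on `(0, T)`. [folklore] -/
theorem StrongData.aestronglyMeasurable_enstrophyAt (d : StrongData T ν u) (h : IsClassicalNSSolutionOn (Icc 0 T) ν 0 u p)
    (hT : 0 < T) : AEStronglyMeasurable (enstrophyAt u) (volume.restrict (Ioo 0 T)) :=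
  aestronglyMeasurable_of_tendsto_continuousOn (fun n => h.continuousOn_enstrophyCut hT n)
    fun _ ht => d.tendsto_enstrophyCut h ht

/-- `z` is a.e.-strongly measurable on `(0, T)`. [folklore] -/
theorem StrongData.aestronglyMeasurable_palinstrophyAt (d : StrongData T ν u) (h : IsClassicalNSSolutionOn (Icc 0 T) ν 0 u p)
    (hT : 0 < T) : AEStronglyMeasurable (palinstrophyAt u) (volume.restrict (Ioo 0 T)) :=
  aestronglyMeasurable_of_tendsto_continuousOn (fun n => h.continuousOn_palinstrophyCut hT n)
    fun _ ht => d.tendsto_palinstrophyCut h ht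

/-- `aₘ` is a.e.-strongly measurable on `(0, T)`. [folklore] -/
theorem StrongData.aestronglyMeasurable_levelInt (d : StrongData T ν u) (h : IsClassicalNSSolutionOn (Icc 0 T) ν 0 u p)
    (hT : 0 < T) (m : ℕ) : AEStronglyMeasurable (levelInt u m) (volume.restrict (Ioo 0 T)) :=
  aestronglyMeasurable_of_tendsto_continuousOn
    (fun n => h.continuousOn_integral_cutoff_pow_mul_levelSq hT (by positivity) 2 m (by norm_num))
    fun _ ht => d.tendsto_levelCut h m ht

/-- `N(t)` is measurable in time and bounded: `0 ≤ N(t) ≤ N_max`. [folklore] -/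
theorem StrongData.aestronglyMeasurable_stretchAt (d : StrongData T ν u) (h : IsClassicalNSSolutionOn (Icc 0 T) ν 0 u p)
    (hT : 0 < T) : AEStronglyMeasurable (stretchAt u) (volume.restrict (Ioo 0 T)) := by
  have hy := (d.aestronglyMeasurable_enstrophyAt h hT).aemeasurable
  have h1 := (d.aestronglyMeasurable_levelInt h hT 1).aemeasurable
  have h2 := (d.aestronglyMeasurable_levelInt h hT 2).aemeasurable
  unfold stretchAt
  refine (AEMeasurable.const_mul ?_ _).aestronglyMeasurable
  refine (Real.continuous_sqrt.measurable.comp_aemeasurable hy).mul ?_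
  refine ((Real.continuous_rpow_const (by norm_num)).measurable.comp_aemeasurable h1).mul ?_
  exact (Real.continuous_rpow_const (by norm_num)).measurable.comp_aemeasurable (h2.const_mul 2)


/-- The uniform bound `N(t) ≤ N_max := 1944K^{3/2} (4S₁)^{1/2} S₁^{1/4} (2S₂)^{3/4}`. [folklore] -/
noncomputable def StrongData.stretchMax (d : StrongData T ν u) : ℝ :=
  stretchConst * (Real.sqrt (4 * d.S 1) * (d.S 1 ^ (1 / 4 : ℝ) * (2 * d.S 2) ^ (3 / 4 : ℝ)))

/-- `N(t) ≤ stretchMax` on `[0, T]`. [folklore] -/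
theorem StrongData.stretchAt_le (d : StrongData T ν u) (h : IsClassicalNSSolutionOn (Icc 0 T) ν 0 u p) {t : ℝ} (ht : t ∈ Icc 0 T) :
    stretchAt u t ≤ d.stretchMax := by
  unfold stretchAt StrongData.stretchMax
  have hS1 := d.S_nonneg 1
  have hS2 := d.S_nonneg 2
  refine mul_le_mul_of_nonneg_left ?_ stretchConst_nonneg
  have hl1 := levelInt_nonneg u 1 t
  have hl2 := levelInt_nonneg u 2 t
  have hl2' : 0 ≤ 2 * levelInt u 2 t := by linarith
  refine mul_le_mul (Real.sqrt_le_sqrt (d.enstrophyAt_le h ht)) ?_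
    (mul_nonneg (Real.rpow_nonneg hl1 _) (Real.rpow_nonneg hl2' _)) (Real.sqrt_nonneg _)
  have hle2 : 2 * levelInt u 2 t ≤ 2 * d.S 2 := by
    have := d.levelInt_le 2 t ht; unfold levelInt; linarith
  exact mul_le_mul (Real.rpow_le_rpow hl1 (d.levelInt_le 1 t ht) (by norm_num))
    (Real.rpow_le_rpow hl2' hle2 (by norm_num)) (Real.rpow_nonneg hl2' _) (Real.rpow_nonneg hS1 _)

/-- **The simplified pairing bound**: `h_n(t) ≤ −(3/2)ν D_n(t) + Γ/(n+1) + N(t)` on `[0, T]`,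
with `Γ` depending only on the data. [folklore] -/
theorem StrongData.exists_pairingCut_le (d : StrongData T ν u) (h : IsClassicalNSSolutionOn (Icc 0 T) ν 0 u p) (hν : 0 < ν)
    (hT : 0 < T) :
    ∃ Γ : ℝ, 0 ≤ Γ ∧ ∀ n : ℕ, ∀ t ∈ Icc 0 T,
      pairingCut u T n t ≤ -(3 / 2 * ν) * palinstrophyCut u n t + Γ / ((n : ℝ) + 1) + stretchAt u t := by
  set S₁ := d.S 1 with hS₁
  have hS₁0 : 0 ≤ S₁ := d.S_nonneg 1
  set Γ : ℝ := (96 * ν * d.Cχ ^ 2 + 12 * d.Cχ * d.B) * (4 * S₁) +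
    stretchConst * (Real.sqrt (4 * S₁) * (S₁ ^ (1 / 4 : ℝ) * (2 * d.Cχ ^ 2 * S₁) ^ (3 / 4 : ℝ))) with hΓ
  have hB0 := d.B_nonneg
  have hC0 := d.Cχ_nonneg
  have hΓ0 : 0 ≤ Γ := by
    have := stretchConst_nonneg
    positivity
  refine ⟨Γ, hΓ0, fun n t ht => ?_⟩
  have hR : (0 : ℝ) < (n : ℝ) + 1 := by positivity
  have hR1 : (1 : ℝ) ≤ (n : ℝ) + 1 := by simp
  have key := h.enstrophy_pairing_cutoff_le hν hT d.norm_le hC0 d.cutoff_grad hR ht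
    (d.integrable_levelSq 1 t ht) (d.integrable_levelSq 2 t ht)
  -- names
  set R : ℝ := (n : ℝ) + 1 with hRdef
  set y := ∫ x, vortSq 0 (u t) x with hy
  set a₁ := ∫ x, levelSq 1 (u t) x with ha₁
  set a₂ := ∫ x, levelSq 2 (u t) x with ha₂
  have hy0 : 0 ≤ y := integral_nonneg fun x => vortSq_nonneg 0 _ x
  have ha₁0 : 0 ≤ a₁ := integral_nonneg fun x => levelSq_nonneg 1 _ x
  have ha₂0 : 0 ≤ a₂ := integral_nonneg fun x => levelSq_nonneg 2 _ x
  have hyS : y ≤ 4 * S₁ := d.enstrophyAt_le h ht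
  have ha₁S : a₁ ≤ S₁ := d.levelInt_le 1 t ht
  -- (i) the coefficient of `y`
  have hc2 : (d.Cχ / R) ^ 2 ≤ d.Cχ ^ 2 / R := by
    rw [div_pow, div_le_div_iff₀ (by positivity) hR, sq R]
    calc d.Cχ ^ 2 * R ≤ d.Cχ ^ 2 * (R * R) := by
          refine mul_le_mul_of_nonneg_left ?_ (sq_nonneg _)
          nlinarith
      _ = d.Cχ ^ 2 * (R * R) := rfl
  have h1 : (96 * ν * (d.Cχ / R) ^ 2 + 12 * (d.Cχ / R) * d.B) * y ≤
      (96 * ν * d.Cχ ^ 2 + 12 * d.Cχ * d.B) * (4 * S₁) / R := by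
    have e : (96 * ν * d.Cχ ^ 2 + 12 * d.Cχ * d.B) * (4 * S₁) / R =
        (96 * ν * (d.Cχ ^ 2 / R) + 12 * (d.Cχ / R) * d.B) * (4 * S₁) := by
      field_simp
    rw [e]
    refine mul_le_mul ?_ hyS hy0 (by positivity)
    nlinarith [hc2, hν.le]
  -- (ii) the stretching term
  have hsplit : (2 * a₂ + 2 * (d.Cχ / R) ^ 2 * a₁) ^ (3 / 4 : ℝ) ≤
      (2 * a₂) ^ (3 / 4 : ℝ) + (2 * (d.Cχ / R) ^ 2 * a₁) ^ (3 / 4 : ℝ) :=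
    rpow_three_quarters_add_le (by positivity) (by positivity)
  have hpow : (2 * (d.Cχ / R) ^ 2 * a₁) ^ (3 / 4 : ℝ) ≤ (2 * d.Cχ ^ 2 * S₁) ^ (3 / 4 : ℝ) / R := by
    -- `(2C²a₁/R²)^{3/4} = (2C²a₁)^{3/4} R^{-3/2} ≤ (2C²S₁)^{3/4} / R`
    have e : 2 * (d.Cχ / R) ^ 2 * a₁ = (2 * d.Cχ ^ 2 * a₁) * (R ^ 2)⁻¹ := by
      rw [div_pow]; ring
    rw [e, Real.mul_rpow (by positivity) (by positivity)]
    have hRi : ((R ^ 2)⁻¹) ^ (3 / 4 : ℝ) ≤ R⁻¹ := by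
      rw [Real.inv_rpow (by positivity), ← Real.rpow_natCast, ← Real.rpow_mul hR.le]
      rw [show ((2 : ℕ) : ℝ) * (3 / 4 : ℝ) = 3 / 2 by norm_num]
      rw [inv_le_inv₀ (Real.rpow_pos_of_pos hR _) hR]
      calc R = R ^ (1 : ℝ) := (Real.rpow_one R).symm
        _ ≤ R ^ (3 / 2 : ℝ) := Real.rpow_le_rpow_of_exponent_le hR1 (by norm_num)
    rw [div_eq_mul_inv]
    exact mul_le_mul (Real.rpow_le_rpow (by positivity) (by nlinarith [sq_nonneg d.Cχ]) (by norm_num))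
      hRi (Real.rpow_nonneg (by positivity) _) (Real.rpow_nonneg (by positivity) _)
  have h2 : stretchConst * (Real.sqrt y * (a₁ ^ (1 / 4 : ℝ) *
      (2 * a₂ + 2 * (d.Cχ / R) ^ 2 * a₁) ^ (3 / 4 : ℝ))) ≤
      stretchAt u t + stretchConst * (Real.sqrt (4 * S₁) * (S₁ ^ (1 / 4 : ℝ) *
        (2 * d.Cχ ^ 2 * S₁) ^ (3 / 4 : ℝ))) / R := by
    have hsc := stretchConst_nonneg
    have hsy : Real.sqrt y ≤ Real.sqrt (4 * S₁) := Real.sqrt_le_sqrt hyS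
    have ha14 : a₁ ^ (1 / 4 : ℝ) ≤ S₁ ^ (1 / 4 : ℝ) := Real.rpow_le_rpow ha₁0 ha₁S (by norm_num)
    calc stretchConst * (Real.sqrt y * (a₁ ^ (1 / 4 : ℝ) * (2 * a₂ + 2 * (d.Cχ / R) ^ 2 * a₁) ^ (3 / 4 : ℝ)))
        ≤ stretchConst * (Real.sqrt y * (a₁ ^ (1 / 4 : ℝ) *
            ((2 * a₂) ^ (3 / 4 : ℝ) + (2 * d.Cχ ^ 2 * S₁) ^ (3 / 4 : ℝ) / R))) := by
          gcongr
          exact hsplit.trans (add_le_add le_rfl hpow)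
      _ = stretchAt u t + stretchConst * (Real.sqrt y * (a₁ ^ (1 / 4 : ℝ) *
            (2 * d.Cχ ^ 2 * S₁) ^ (3 / 4 : ℝ))) / R := by
          simp only [stretchAt, enstrophyAt, levelInt, ← hy, ← ha₁, ← ha₂]
          ring
      _ ≤ stretchAt u t + stretchConst * (Real.sqrt (4 * S₁) * (S₁ ^ (1 / 4 : ℝ) *
            (2 * d.Cχ ^ 2 * S₁) ^ (3 / 4 : ℝ))) / R := by
          gcongr
  -- assemble
  have hsum : (96 * ν * d.Cχ ^ 2 + 12 * d.Cχ * d.B) * (4 * S₁) / R +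
      stretchConst * (Real.sqrt (4 * S₁) * (S₁ ^ (1 / 4 : ℝ) * (2 * d.Cχ ^ 2 * S₁) ^ (3 / 4 : ℝ))) / R =
      Γ / R := by rw [hΓ]; ring
  unfold pairingCut palinstrophyCut
  linarith [key, h1, h2, hsum.le, hsum.ge]


/-! ### The Foias–Guillopé–Temam device -/

/-- **Weighted AM–GM for the stretching term**: for `y, z ≥ 0`, `ν > 0`, `C ≥ 0`,
`C y^{3/4} z^{3/4} ≤ (ν/2) z + (27/32)(C+1)⁴ ν⁻³ y³`. [folklore] -/
theorem stretch_young {y z ν C : ℝ} (hy : 0 ≤ y) (hz : 0 ≤ z) (hν : 0 < ν) (hC : 0 ≤ C) :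
    C * (y ^ (3 / 4 : ℝ) * z ^ (3 / 4 : ℝ)) ≤ ν / 2 * z + 27 / 32 * (C + 1) ^ 4 * ν⁻¹ ^ 3 * y ^ 3 := by
  have hC1 : 0 < C + 1 := by linarith
  set s : ℝ := 2 * ν / (3 * (C + 1)) with hs
  have hs0 : 0 < s := by positivity
  -- AM–GM with weights `3/4`, `1/4` and `p₁ = s z`, `p₂ = y³/s³`
  have hp1 : 0 ≤ s * z := by positivity
  have hp2 : 0 ≤ y ^ 3 / s ^ 3 := by positivity
  have hag := Real.geom_mean_le_arith_mean2_weighted (by norm_num : (0:ℝ) ≤ 3 / 4)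
    (by norm_num : (0:ℝ) ≤ 1 / 4) hp1 hp2 (by norm_num)
  have e1 : (s * z) ^ (3 / 4 : ℝ) * (y ^ 3 / s ^ 3) ^ (1 / 4 : ℝ) = y ^ (3 / 4 : ℝ) * z ^ (3 / 4 : ℝ) := by
    rw [Real.mul_rpow hs0.le hz, Real.div_rpow (pow_nonneg hy 3) (pow_nonneg hs0.le 3)]
    rw [show (y ^ 3 : ℝ) = y ^ (3 : ℝ) by norm_cast, show (s ^ 3 : ℝ) = s ^ (3 : ℝ) by norm_cast,
      ← Real.rpow_mul hy, ← Real.rpow_mul hs0.le]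
    rw [show (3 : ℝ) * (1 / 4) = 3 / 4 by norm_num]
    field_simp
  rw [e1] at hag
  -- multiply by `C` and compare the two resulting terms
  have hCs : C * (3 / 4 * (s * z)) ≤ ν / 2 * z := by
    rw [hs]
    have : C * (3 / 4 * (2 * ν / (3 * (C + 1)) * z)) = (C / (C + 1)) * (ν / 2 * z) := by
      field_simp
      ring
    rw [this]
    refine mul_le_of_le_one_left (by positivity) ?_
    rw [div_le_one hC1]; linarith
  have hCy : C * (1 / 4 * (y ^ 3 / s ^ 3)) ≤ 27 / 32 * (C + 1) ^ 4 * ν⁻¹ ^ 3 * y ^ 3 := by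
    rw [hs]
    have : C * (1 / 4 * (y ^ 3 / (2 * ν / (3 * (C + 1))) ^ 3)) =
        C * (C + 1) ^ 3 * (27 / 32 * ν⁻¹ ^ 3 * y ^ 3) := by
      field_simp
      ring
    rw [this]
    have : 27 / 32 * (C + 1) ^ 4 * ν⁻¹ ^ 3 * y ^ 3 = (C + 1) * (C + 1) ^ 3 * (27 / 32 * ν⁻¹ ^ 3 * y ^ 3) := by
      ring
    rw [this]
    refine mul_le_mul_of_nonneg_right ?_ (by positivity)
    exact mul_le_mul_of_nonneg_right (by linarith) (by positivity)
  calc C * (y ^ (3 / 4 : ℝ) * z ^ (3 / 4 : ℝ)) ≤ C * (3 / 4 * (s * z) + 1 / 4 * (y ^ 3 / s ^ 3)) :=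
        mul_le_mul_of_nonneg_left hag hC
    _ = C * (3 / 4 * (s * z)) + C * (1 / 4 * (y ^ 3 / s ^ 3)) := by ring
    _ ≤ _ := add_le_add hCs hCy

/-- The Young constant `C_Y = (27/32)(2^{3/4}·1944K^{3/2} + 1)⁴`. [folklore] -/
noncomputable def youngConst : ℝ := 27 / 32 * (stretchConst * (2 : ℝ) ^ (3 / 4 : ℝ) + 1) ^ 4

/-- The Young constant is nonnegative. [folklore] -/
theorem youngConst_nonneg : 0 ≤ youngConst := by unfold youngConst; positivity

/-- **The stretching bound is absorbable**: `N(t) ≤ (ν/2) z(t) + C_Y ν⁻³ y(t)³` on `[0, T]`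
(`a₁ ≤ y`, `a₂ ≤ z` by the global div–curl bound, then weighted AM–GM). [folklore] -/
theorem StrongData.stretchAt_le_young (d : StrongData T ν u) (h : IsClassicalNSSolutionOn (Icc 0 T) ν 0 u p)
    (hν : 0 < ν) {t : ℝ} (ht : t ∈ Icc 0 T) :
    stretchAt u t ≤ ν / 2 * palinstrophyAt u t + youngConst * ν⁻¹ ^ 3 * enstrophyAt u t ^ 3 := by
  have hy0 := enstrophyAt_nonneg u t
  have hz0 := palinstrophyAt_nonneg u t
  have ha1 := levelInt_nonneg u 1 t
  have ha2 := levelInt_nonneg u 2 t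
  have h1 := d.levelInt_one_le h ht
  have h2 := d.levelInt_two_le h ht
  -- `N ≤ C' y^{3/4} z^{3/4}` with `C' = stretchConst 2^{3/4}`
  have hN : stretchAt u t ≤ (stretchConst * (2 : ℝ) ^ (3 / 4 : ℝ)) *
      (enstrophyAt u t ^ (3 / 4 : ℝ) * palinstrophyAt u t ^ (3 / 4 : ℝ)) := by
    unfold stretchAt
    have e : (stretchConst * (2 : ℝ) ^ (3 / 4 : ℝ)) *
        (enstrophyAt u t ^ (3 / 4 : ℝ) * palinstrophyAt u t ^ (3 / 4 : ℝ)) =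
        stretchConst * (Real.sqrt (enstrophyAt u t) *
          (enstrophyAt u t ^ (1 / 4 : ℝ) * (2 * palinstrophyAt u t) ^ (3 / 4 : ℝ))) := by
      rw [Real.sqrt_eq_rpow, Real.mul_rpow (by norm_num) hz0]
      have : enstrophyAt u t ^ (3 / 4 : ℝ) = enstrophyAt u t ^ (1 / 2 : ℝ) * enstrophyAt u t ^ (1 / 4 : ℝ) := by
        rw [← Real.rpow_add' hy0 (by norm_num)]; norm_num
      rw [this]; ring
    rw [e]
    refine mul_le_mul_of_nonneg_left ?_ stretchConst_nonneg
    refine mul_le_mul_of_nonneg_left ?_ (Real.sqrt_nonneg _)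
    have h22 : (0 : ℝ) ≤ 2 * levelInt u 2 t := by linarith
    exact mul_le_mul (Real.rpow_le_rpow ha1 h1 (by norm_num))
      (Real.rpow_le_rpow h22 (by linarith) (by norm_num)) (Real.rpow_nonneg h22 _)
      (Real.rpow_nonneg hy0 _)
  refine hN.trans ?_
  have hC' : 0 ≤ stretchConst * (2 : ℝ) ^ (3 / 4 : ℝ) :=
    mul_nonneg stretchConst_nonneg (Real.rpow_nonneg (by norm_num) _)
  have := stretch_young hy0 hz0 hν hC'
  unfold youngConst
  linarith

/-- **FGT at the cutoff level and in the limit.** For a strong solution and `α > 0`: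
`−(α + y(T))⁻¹ + (α + y(0))⁻¹ ≤ ∫₀ᵀ (−(3/2)ν z + N)/(α + y)²`. Proof: for each cutoff `χ_{n+1}`,
`t ↦ −(α + y_n(t))⁻¹` is `C¹` with derivative `h_n/(α + y_n)² ≤ (−(3/2)ν D_n + Γ/(n+1) + N)/(α+y_n)²`
(`h_n ≤ …` and `α + y_n > 0`); integrate over `[0, T]` and let `n → ∞` (dominated convergence,
`y_n → y`, `D_n → z` pointwise, all integrands bounded). [folklore] -/
theorem StrongData.fgt_limit (d : StrongData T ν u) (h : IsClassicalNSSolutionOn (Icc 0 T) ν 0 u p)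
    (hν : 0 < ν) (hT : 0 < T) {α : ℝ} (hα : 0 < α) :
    -(α + enstrophyAt u T)⁻¹ + (α + enstrophyAt u 0)⁻¹ ≤
      ∫ τ in Ioo 0 T, (-(3 / 2 * ν) * palinstrophyAt u τ + stretchAt u τ) / (α + enstrophyAt u τ) ^ 2 := by
  obtain ⟨Γ, hΓ0, hΓ⟩ := d.exists_pairingCut_le h hν hT
  have h0T : (0 : ℝ) ∈ Icc 0 T := ⟨le_rfl, hT.le⟩
  have hTT : T ∈ Icc 0 T := ⟨hT.le, le_rfl⟩
  -- uniform constants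
  set M : ℝ := (3 / 2 * ν * (4 * d.S 2) + d.stretchMax) / α ^ 2 with hM
  -- Step 1: the inequality at level `n`
  have step : ∀ n : ℕ, -(α + enstrophyCut u n T)⁻¹ + (α + enstrophyCut u n 0)⁻¹ ≤
      (∫ τ in Ioo 0 T, (-(3 / 2 * ν) * palinstrophyCut u n τ + stretchAt u τ) /
        (α + enstrophyCut u n τ) ^ 2) + T * (Γ / (((n : ℝ) + 1) * α ^ 2)) := by
    intro n
    set Y := enstrophyCut u n with hY
    set H := pairingCut u T n with hH
    set D := palinstrophyCut u n with hD
    have hYc : ContinuousOn Y (Icc 0 T) := h.continuousOn_enstrophyCut hT n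
    have hDc : ContinuousOn D (Icc 0 T) := h.continuousOn_palinstrophyCut hT n
    have hHc : ContinuousOn H (Icc 0 T) := h.continuousOn_pairingCut hT n
    have hY0 : ∀ s, 0 ≤ Y s := fun s => enstrophyCut_nonneg u n s
    have hpos : ∀ s, 0 < α + Y s := fun s => by linarith [hY0 s]
    -- the primitive `g = -(α + Y)⁻¹`
    have hg_deriv : ∀ t ∈ Ioo 0 T, HasDerivAt (fun s => -(α + Y s)⁻¹) (H t / (α + Y t) ^ 2) t := by
      intro t ht
      have h1 : HasDerivAt (fun s => α + Y s) (H t) t := (h.hasDerivAt_enstrophyCut hT n ht).const_add α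
      have h2 : HasDerivAt (fun s => (α + Y s)⁻¹) (-(H t) / (α + Y t) ^ 2) t := h1.inv (hpos t).ne'
      have h3 := h2.neg
      have e : -(-(H t) / (α + Y t) ^ 2) = H t / (α + Y t) ^ 2 := by ring
      rw [e] at h3
      exact h3
    have hg_cont : ContinuousOn (fun s => -(α + Y s)⁻¹) (Icc 0 T) :=
      ((continuousOn_const.add hYc).inv₀ fun s _ => (hpos s).ne').neg
    have hq_cont : ContinuousOn (fun τ => H τ / (α + Y τ) ^ 2) (Icc 0 T) :=
      hHc.div ((continuousOn_const.add hYc).pow 2) fun s _ => (pow_pos (hpos s) 2).ne'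
    have hFTC := intervalIntegral.integral_eq_sub_of_hasDerivAt_of_le hT.le hg_cont hg_deriv
      (hq_cont.intervalIntegrable_of_Icc hT.le)
    -- bound of the integrand on `[0, T]`
    have hbound : ∀ τ ∈ Icc 0 T, H τ / (α + Y τ) ^ 2 ≤
        (-(3 / 2 * ν) * D τ + stretchAt u τ) / (α + Y τ) ^ 2 + Γ / (((n : ℝ) + 1) * α ^ 2) := by
      intro τ hτ
      have hq : 0 < (α + Y τ) ^ 2 := pow_pos (hpos τ) 2
      have h1 : H τ / (α + Y τ) ^ 2 ≤ (-(3 / 2 * ν) * D τ + Γ / ((n : ℝ) + 1) + stretchAt u τ) / (α + Y τ) ^ 2 :=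
        div_le_div_of_nonneg_right (hΓ n τ hτ) hq.le
      have h2 : Γ / ((n : ℝ) + 1) / (α + Y τ) ^ 2 ≤ Γ / (((n : ℝ) + 1) * α ^ 2) := by
        rw [div_div]
        refine div_le_div_of_nonneg_left hΓ0 (by positivity) ?_
        refine mul_le_mul_of_nonneg_left ?_ (by positivity)
        exact pow_le_pow_left₀ hα.le (by linarith [hY0 τ]) 2
      calc H τ / (α + Y τ) ^ 2 ≤ _ := h1
        _ = (-(3 / 2 * ν) * D τ + stretchAt u τ) / (α + Y τ) ^ 2 + Γ / ((n : ℝ) + 1) / (α + Y τ) ^ 2 := by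
            ring
        _ ≤ _ := by linarith [h2]
    -- integrability of the right-hand side
    have hNm : AEStronglyMeasurable (stretchAt u) (volume.restrict (Ioc 0 T)) := by
      rw [← restrict_Ioo_eq_restrict_Ioc]
      exact d.aestronglyMeasurable_stretchAt h hT
    have hRm : AEStronglyMeasurable (fun τ => (-(3 / 2 * ν) * D τ + stretchAt u τ) / (α + Y τ) ^ 2)
        (volume.restrict (Ioc 0 T)) := by
      have hDm : AEStronglyMeasurable D (volume.restrict (Ioc 0 T)) :=
        (hDc.mono Ioc_subset_Icc_self).aestronglyMeasurable measurableSet_Ioc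
      have hYm : AEStronglyMeasurable Y (volume.restrict (Ioc 0 T)) :=
        (hYc.mono Ioc_subset_Icc_self).aestronglyMeasurable measurableSet_Ioc
      exact (((hDm.aemeasurable.const_mul _).add hNm.aemeasurable).div
        ((aemeasurable_const.add hYm.aemeasurable).pow_const 2)).aestronglyMeasurable
    have hRbound : ∀ τ ∈ Icc 0 T, |(-(3 / 2 * ν) * D τ + stretchAt u τ) / (α + Y τ) ^ 2| ≤ M := by
      intro τ hτ
      have hDτ : 0 ≤ D τ := palinstrophyCut_nonneg u n τ
      have hDle : D τ ≤ 4 * d.S 2 := (d.palinstrophyCut_le h n hτ).trans (d.palinstrophyAt_le h hτ)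
      have hNτ : 0 ≤ stretchAt u τ := stretchAt_nonneg u τ
      have hNle : stretchAt u τ ≤ d.stretchMax := d.stretchAt_le h hτ
      have hq1 : α ^ 2 ≤ (α + Y τ) ^ 2 := pow_le_pow_left₀ hα.le (by linarith [hY0 τ]) 2
      rw [abs_div, abs_of_pos (pow_pos (hpos τ) 2), hM]
      calc |(-(3 / 2 * ν) * D τ + stretchAt u τ)| / (α + Y τ) ^ 2
          ≤ (3 / 2 * ν * (4 * d.S 2) + d.stretchMax) / (α + Y τ) ^ 2 := by
            refine div_le_div_of_nonneg_right ?_ (pow_pos (hpos τ) 2).le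
            refine (abs_add_le _ _).trans (add_le_add ?_ ?_)
            · rw [abs_mul, abs_neg, abs_of_pos (by positivity), abs_of_nonneg hDτ]
              exact mul_le_mul_of_nonneg_left hDle (by positivity)
            · rw [abs_of_nonneg hNτ]; exact hNle
        _ ≤ (3 / 2 * ν * (4 * d.S 2) + d.stretchMax) / α ^ 2 := by
            refine div_le_div_of_nonneg_left ?_ (by positivity) hq1
            have := d.S_nonneg 2
            have : 0 ≤ d.stretchMax := (stretchAt_nonneg u τ).trans hNle
            positivity
    have hRint : IntegrableOn (fun τ => (-(3 / 2 * ν) * D τ + stretchAt u τ) / (α + Y τ) ^ 2) (Ioc 0 T) := by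
      refine Integrable.mono' (integrable_const M) hRm ?_
      rw [ae_restrict_iff' measurableSet_Ioc]
      exact Eventually.of_forall fun τ hτ => by
        rw [Real.norm_eq_abs]; exact hRbound τ (Ioc_subset_Icc_self hτ)
    -- integrate the pointwise bound
    have hmono : ∫ τ in (0:ℝ)..T, H τ / (α + Y τ) ^ 2 ≤
        ∫ τ in (0:ℝ)..T, ((-(3 / 2 * ν) * D τ + stretchAt u τ) / (α + Y τ) ^ 2 + Γ / (((n : ℝ) + 1) * α ^ 2)) := by
      refine intervalIntegral.integral_mono_on hT.le (hq_cont.intervalIntegrable_of_Icc hT.le) ?_ hbound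
      exact ((intervalIntegrable_iff_integrableOn_Ioc_of_le hT.le).2 hRint).add intervalIntegrable_const
    rw [intervalIntegral.integral_add ((intervalIntegrable_iff_integrableOn_Ioc_of_le hT.le).2 hRint)
      intervalIntegrable_const, intervalIntegral.integral_const, smul_eq_mul, sub_zero] at hmono
    have eR : (∫ τ in (0:ℝ)..T, (-(3 / 2 * ν) * D τ + stretchAt u τ) / (α + Y τ) ^ 2) =
        ∫ τ in Ioo 0 T, (-(3 / 2 * ν) * D τ + stretchAt u τ) / (α + Y τ) ^ 2 := by
      rw [intervalIntegral.integral_of_le hT.le, integral_Ioc_eq_integral_Ioo]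
    rw [eR] at hmono
    have e : -(α + Y T)⁻¹ + (α + Y 0)⁻¹ = ∫ τ in (0:ℝ)..T, H τ / (α + Y τ) ^ 2 := by
      rw [hFTC]; ring
    rw [e]
    linarith
  -- Step 2: pass to the limit `n → ∞`
  have hlimL : Tendsto (fun n : ℕ => -(α + enstrophyCut u n T)⁻¹ + (α + enstrophyCut u n 0)⁻¹) atTop
      (𝓝 (-(α + enstrophyAt u T)⁻¹ + (α + enstrophyAt u 0)⁻¹)) := by
    have hT' := d.tendsto_enstrophyCut h hTT
    have h0' := d.tendsto_enstrophyCut h h0T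
    refine ((tendsto_const_nhds.add hT').inv₀ ?_).neg.add ((tendsto_const_nhds.add h0').inv₀ ?_)
    · have := enstrophyAt_nonneg u T; positivity
    · have := enstrophyAt_nonneg u 0; positivity
  have hlimR : Tendsto (fun n : ℕ => (∫ τ in Ioo 0 T, (-(3 / 2 * ν) * palinstrophyCut u n τ + stretchAt u τ) /
        (α + enstrophyCut u n τ) ^ 2) + T * (Γ / (((n : ℝ) + 1) * α ^ 2))) atTop
      (𝓝 ((∫ τ in Ioo 0 T, (-(3 / 2 * ν) * palinstrophyAt u τ + stretchAt u τ) /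
        (α + enstrophyAt u τ) ^ 2) + T * 0)) := by
    refine Tendsto.add ?_ (tendsto_const_nhds.mul ?_)
    · -- dominated convergence on `(0, T)`
      refine tendsto_integral_of_dominated_convergence (fun _ => M) (fun n => ?_) (integrable_const M) ?_ ?_
      · have hDm : AEStronglyMeasurable (palinstrophyCut u n) (volume.restrict (Ioo 0 T)) :=
          ((h.continuousOn_palinstrophyCut hT n).mono Ioo_subset_Icc_self).aestronglyMeasurable measurableSet_Ioo
        have hYm : AEStronglyMeasurable (enstrophyCut u n) (volume.restrict (Ioo 0 T)) :=
          ((h.continuousOn_enstrophyCut hT n).mono Ioo_subset_Icc_self).aestronglyMeasurable measurableSet_Ioo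
        exact (((hDm.aemeasurable.const_mul _).add (d.aestronglyMeasurable_stretchAt h hT).aemeasurable).div
          ((aemeasurable_const.add hYm.aemeasurable).pow_const 2)).aestronglyMeasurable
      · intro n
        rw [ae_restrict_iff' measurableSet_Ioo]
        refine Eventually.of_forall fun τ hτ => ?_
        have hτ' : τ ∈ Icc 0 T := Ioo_subset_Icc_self hτ
        -- same bound as in Step 1
        have hY0 : 0 ≤ enstrophyCut u n τ := enstrophyCut_nonneg u n τ
        have hposτ : 0 < α + enstrophyCut u n τ := by linarith
        have hDτ : 0 ≤ palinstrophyCut u n τ := palinstrophyCut_nonneg u n τ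
        have hDle : palinstrophyCut u n τ ≤ 4 * d.S 2 :=
          (d.palinstrophyCut_le h n hτ').trans (d.palinstrophyAt_le h hτ')
        have hNτ : 0 ≤ stretchAt u τ := stretchAt_nonneg u τ
        have hNle : stretchAt u τ ≤ d.stretchMax := d.stretchAt_le h hτ'
        have hq1 : α ^ 2 ≤ (α + enstrophyCut u n τ) ^ 2 := pow_le_pow_left₀ hα.le (by linarith) 2
        rw [Real.norm_eq_abs, abs_div, abs_of_pos (pow_pos hposτ 2), hM]
        calc |(-(3 / 2 * ν) * palinstrophyCut u n τ + stretchAt u τ)| / (α + enstrophyCut u n τ) ^ 2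
            ≤ (3 / 2 * ν * (4 * d.S 2) + d.stretchMax) / (α + enstrophyCut u n τ) ^ 2 := by
              refine div_le_div_of_nonneg_right ?_ (pow_pos hposτ 2).le
              refine (abs_add_le _ _).trans (add_le_add ?_ ?_)
              · rw [abs_mul, abs_neg, abs_of_pos (by positivity), abs_of_nonneg hDτ]
                exact mul_le_mul_of_nonneg_left hDle (by positivity)
              · rw [abs_of_nonneg hNτ]; exact hNle
          _ ≤ (3 / 2 * ν * (4 * d.S 2) + d.stretchMax) / α ^ 2 := by
              refine div_le_div_of_nonneg_left ?_ (by positivity) hq1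
              have := d.S_nonneg 2
              have : 0 ≤ d.stretchMax := (stretchAt_nonneg u τ).trans hNle
              positivity
      · rw [ae_restrict_iff' measurableSet_Ioo]
        refine Eventually.of_forall fun τ hτ => ?_
        have hτ' : τ ∈ Icc 0 T := Ioo_subset_Icc_self hτ
        have hpos : 0 < α + enstrophyAt u τ := by linarith [enstrophyAt_nonneg u τ]
        exact ((tendsto_const_nhds.mul (d.tendsto_palinstrophyCut h hτ')).add tendsto_const_nhds).div
          ((tendsto_const_nhds.add (d.tendsto_enstrophyCut h hτ')).pow 2) (pow_pos hpos 2).ne'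
    · have : Tendsto (fun n : ℕ => ((n : ℝ) + 1) * α ^ 2) atTop atTop :=
        (tendsto_atTop_add_const_right _ 1 tendsto_natCast_atTop_atTop).atTop_mul_const (by positivity)
      exact tendsto_const_nhds.div_atTop this
  rw [mul_zero, add_zero] at hlimR
  exact le_of_tendsto_of_tendsto' hlimL hlimR step


/-- Integrability on `(0, T)` of a bounded, a.e.-strongly measurable function. [folklore] -/
theorem integrableOn_Ioo_of_bound {f : ℝ → ℝ} (hf : AEStronglyMeasurable f (volume.restrict (Ioo 0 T)))
    {M : ℝ} (hM : ∀ t ∈ Icc 0 T, |f t| ≤ M) : IntegrableOn f (Ioo 0 T) := by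
  refine Integrable.mono' (integrable_const M) hf ?_
  rw [ae_restrict_iff' measurableSet_Ioo]
  exact Eventually.of_forall fun t ht => by rw [Real.norm_eq_abs]; exact hM t (Ioo_subset_Icc_self ht)

/-- **The FGT dissipation bound** (Foias–Guillopé–Temam 1981; Robinson–Rodrigo–Sadowski 2016,
Lemma 8.15, proof: "dividing both sides by `‖∇u‖⁴` … integrating in time"): for a strong solution
and `α > 0`, `ν ∫₀ᵀ z/(α + y)² ≤ α⁻¹ + C_Y ν⁻³ ∫₀ᵀ y`, where `y = ∫|Ω|²`, `z = ∫|∇Ω|²`.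
[cite: RobinsonRodrigoSadowski2016, Lemma 8.15] -/
theorem StrongData.fgt_dissipation (d : StrongData T ν u) (h : IsClassicalNSSolutionOn (Icc 0 T) ν 0 u p)
    (hν : 0 < ν) (hT : 0 < T) {α : ℝ} (hα : 0 < α) :
    ν * ∫ τ in Ioo 0 T, palinstrophyAt u τ / (α + enstrophyAt u τ) ^ 2 ≤
      α⁻¹ + youngConst * ν⁻¹ ^ 3 * ∫ τ in Ioo 0 T, enstrophyAt u τ := by
  have hlim := d.fgt_limit h hν hT hα
  have hym := d.aestronglyMeasurable_enstrophyAt h hT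
  have hzm := d.aestronglyMeasurable_palinstrophyAt h hT
  have hNm := d.aestronglyMeasurable_stretchAt h hT
  have hy0 : ∀ t, 0 ≤ enstrophyAt u t := enstrophyAt_nonneg u
  have hpos : ∀ t, 0 < α + enstrophyAt u t := fun t => by linarith [hy0 t]
  -- integrability of `z/(α+y)²` and of `y`
  have hQm : AEStronglyMeasurable (fun τ => palinstrophyAt u τ / (α + enstrophyAt u τ) ^ 2)
      (volume.restrict (Ioo 0 T)) :=
    (hzm.aemeasurable.div ((aemeasurable_const.add hym.aemeasurable).pow_const 2)).aestronglyMeasurable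
  have hQint : IntegrableOn (fun τ => palinstrophyAt u τ / (α + enstrophyAt u τ) ^ 2) (Ioo 0 T) := by
    refine integrableOn_Ioo_of_bound hQm (M := 4 * d.S 2 / α ^ 2) fun t ht => ?_
    rw [abs_div, abs_of_nonneg (palinstrophyAt_nonneg u t), abs_of_pos (pow_pos (hpos t) 2)]
    exact div_le_div₀ (by have := d.S_nonneg 2; positivity) (d.palinstrophyAt_le h ht) (by positivity)
      (pow_le_pow_left₀ hα.le (by linarith [hy0 t]) 2)
  have hyint : IntegrableOn (enstrophyAt u) (Ioo 0 T) := by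
    refine integrableOn_Ioo_of_bound hym (M := 4 * d.S 1) fun t ht => ?_
    rw [abs_of_nonneg (hy0 t)]; exact d.enstrophyAt_le h ht
  have hRint : IntegrableOn (fun τ => (-(3 / 2 * ν) * palinstrophyAt u τ + stretchAt u τ) /
      (α + enstrophyAt u τ) ^ 2) (Ioo 0 T) := by
    have hm : AEStronglyMeasurable (fun τ => (-(3 / 2 * ν) * palinstrophyAt u τ + stretchAt u τ) /
        (α + enstrophyAt u τ) ^ 2) (volume.restrict (Ioo 0 T)) :=
      (((hzm.aemeasurable.const_mul _).add hNm.aemeasurable).div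
        ((aemeasurable_const.add hym.aemeasurable).pow_const 2)).aestronglyMeasurable
    refine integrableOn_Ioo_of_bound hm (M := (3 / 2 * ν * (4 * d.S 2) + d.stretchMax) / α ^ 2) fun t ht => ?_
    have hzle := d.palinstrophyAt_le h ht
    have hz0 := palinstrophyAt_nonneg u t
    have hN0 := stretchAt_nonneg u t
    have hNle := d.stretchAt_le h ht
    rw [abs_div, abs_of_pos (pow_pos (hpos t) 2)]
    refine div_le_div₀ ?_ ?_ (by positivity) (pow_le_pow_left₀ hα.le (by linarith [hy0 t]) 2)
    · have := d.S_nonneg 2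
      have : 0 ≤ d.stretchMax := hN0.trans hNle
      positivity
    · refine (abs_add_le _ _).trans (add_le_add ?_ ?_)
      · rw [abs_mul, abs_neg, abs_of_pos (by positivity), abs_of_nonneg hz0]
        exact mul_le_mul_of_nonneg_left hzle (by positivity)
      · rw [abs_of_nonneg hN0]; exact hNle
  -- the pointwise absorption
  have hpt : ∀ τ ∈ Icc 0 T, (-(3 / 2 * ν) * palinstrophyAt u τ + stretchAt u τ) / (α + enstrophyAt u τ) ^ 2 ≤
      -ν * (palinstrophyAt u τ / (α + enstrophyAt u τ) ^ 2) + youngConst * ν⁻¹ ^ 3 * enstrophyAt u τ := by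
    intro τ hτ
    have hY := d.stretchAt_le_young h hν hτ
    have hq : 0 < (α + enstrophyAt u τ) ^ 2 := pow_pos (hpos τ) 2
    have hyτ := hy0 τ
    have h3 : enstrophyAt u τ ^ 3 / (α + enstrophyAt u τ) ^ 2 ≤ enstrophyAt u τ := by
      rw [div_le_iff₀ hq]
      have : enstrophyAt u τ ^ 2 ≤ (α + enstrophyAt u τ) ^ 2 := pow_le_pow_left₀ hyτ (by linarith) 2
      nlinarith
    calc (-(3 / 2 * ν) * palinstrophyAt u τ + stretchAt u τ) / (α + enstrophyAt u τ) ^ 2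
        ≤ (-(3 / 2 * ν) * palinstrophyAt u τ + (ν / 2 * palinstrophyAt u τ +
            youngConst * ν⁻¹ ^ 3 * enstrophyAt u τ ^ 3)) / (α + enstrophyAt u τ) ^ 2 := by
          gcongr
      _ = -ν * (palinstrophyAt u τ / (α + enstrophyAt u τ) ^ 2) +
            youngConst * ν⁻¹ ^ 3 * (enstrophyAt u τ ^ 3 / (α + enstrophyAt u τ) ^ 2) := by ring
      _ ≤ _ := by
          have hc : 0 ≤ youngConst * ν⁻¹ ^ 3 := mul_nonneg youngConst_nonneg (by positivity)
          nlinarith [mul_le_mul_of_nonneg_left h3 hc]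
  have hint_le : ∫ τ in Ioo 0 T, (-(3 / 2 * ν) * palinstrophyAt u τ + stretchAt u τ) / (α + enstrophyAt u τ) ^ 2 ≤
      ∫ τ in Ioo 0 T, (-ν * (palinstrophyAt u τ / (α + enstrophyAt u τ) ^ 2) +
        youngConst * ν⁻¹ ^ 3 * enstrophyAt u τ) := by
    refine setIntegral_mono_on hRint ((hQint.const_mul _).add (hyint.const_mul _)) measurableSet_Ioo
      fun τ hτ => hpt τ (Ioo_subset_Icc_self hτ)
  rw [integral_add (hQint.const_mul _) (hyint.const_mul _), integral_const_mul, integral_const_mul] at hint_le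
  -- the left end: `-(α⁻¹) ≤ -(α+y T)⁻¹ + (α + y 0)⁻¹`
  have hleft : -α⁻¹ ≤ -(α + enstrophyAt u T)⁻¹ + (α + enstrophyAt u 0)⁻¹ := by
    have h1 : (α + enstrophyAt u T)⁻¹ ≤ α⁻¹ := inv_anti₀ hα (by linarith [hy0 T])
    have h2 : 0 ≤ (α + enstrophyAt u 0)⁻¹ := inv_nonneg.2 (hpos 0).le
    linarith
  linarith

/-- **The energy-dissipation hypothesis in coordinates**: from
`ν ∫₀ᵀ∫ |∇u|² ≤ E` (lower integrals, Frobenius density) one gets `∫₀ᵀ a₁ ≤ E/ν` and hence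
`∫₀ᵀ y ≤ 4E/ν`. [folklore] -/
theorem StrongData.integral_enstrophyAt_le (d : StrongData T ν u) (h : IsClassicalNSSolutionOn (Icc 0 T) ν 0 u p)
    (hν : 0 < ν) (hT : 0 < T) {E : ℝ} (hE : 0 ≤ E)
    (hD : ENNReal.ofReal ν * ∫⁻ t in Ioo 0 T, ∫⁻ x, ENNReal.ofReal (frobeniusNormSq (fderiv ℝ (u t) x)) ≤
      ENNReal.ofReal E) :
    ∫ τ in Ioo 0 T, enstrophyAt u τ ≤ 4 * E / ν := by
  have hy0 : ∀ t, 0 ≤ enstrophyAt u t := enstrophyAt_nonneg u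
  have hym := d.aestronglyMeasurable_enstrophyAt h hT
  have ham := d.aestronglyMeasurable_levelInt h hT 1
  -- slice identity `∫⁻ ofReal |∇u(t)|² = ofReal (a₁ t)`
  have hslice : ∀ t ∈ Icc 0 T, ∫⁻ x, ENNReal.ofReal (frobeniusNormSq (fderiv ℝ (u t) x)) =
      ENNReal.ofReal (levelInt u 1 t) := by
    intro t ht
    have hv := h.contDiff_velocity ht
    have hdiff : ∀ x, DifferentiableAt ℝ (u t) x := fun x => (hv.differentiable (by simp)) x
    rw [levelInt, ofReal_integral_eq_lintegral_ofReal (d.integrable_levelSq 1 t ht)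
      (ae_of_all _ fun x => levelSq_nonneg 1 _ x)]
    refine lintegral_congr fun x => ?_
    rw [levelSq_one_eq_frobeniusNormSq (hdiff x)]
  have hlin : ∫⁻ t in Ioo 0 T, ∫⁻ x, ENNReal.ofReal (frobeniusNormSq (fderiv ℝ (u t) x)) =
      ∫⁻ t in Ioo 0 T, ENNReal.ofReal (levelInt u 1 t) := by
    refine setLIntegral_congr_fun measurableSet_Ioo ?_
    exact fun t ht => hslice t (Ioo_subset_Icc_self ht)
  have haint : IntegrableOn (levelInt u 1) (Ioo 0 T) := by
    refine integrableOn_Ioo_of_bound ham (M := d.S 1) fun t ht => ?_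
    rw [abs_of_nonneg (levelInt_nonneg u 1 t)]; exact d.levelInt_le 1 t ht
  have hlin2 : ∫⁻ t in Ioo 0 T, ENNReal.ofReal (levelInt u 1 t) = ENNReal.ofReal (∫ t in Ioo 0 T, levelInt u 1 t) :=
    (ofReal_integral_eq_lintegral_ofReal haint (ae_of_all _ fun t => levelInt_nonneg u 1 t)).symm
  rw [hlin, hlin2, ← ENNReal.ofReal_mul hν.le] at hD
  have hI0 : 0 ≤ ∫ t in Ioo 0 T, levelInt u 1 t := integral_nonneg fun t => levelInt_nonneg u 1 t
  have hreal : ν * ∫ t in Ioo 0 T, levelInt u 1 t ≤ E := (ENNReal.ofReal_le_ofReal_iff hE).1 hD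
  -- `y ≤ 4 a₁`
  have hyint : IntegrableOn (enstrophyAt u) (Ioo 0 T) := by
    refine integrableOn_Ioo_of_bound hym (M := 4 * d.S 1) fun t ht => ?_
    rw [abs_of_nonneg (hy0 t)]; exact d.enstrophyAt_le h ht
  have hpt : ∀ t ∈ Icc 0 T, enstrophyAt u t ≤ 4 * levelInt u 1 t := by
    intro t ht
    have hv := h.contDiff_velocity ht
    unfold enstrophyAt levelInt
    rw [← integral_const_mul]
    exact integral_mono (d.integrable_vortSq h 0 ht) ((d.integrable_levelSq 1 t ht).const_mul 4)
      fun x => vortSq_le_four_mul_levelSq_succ hv 0 x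
  calc ∫ τ in Ioo 0 T, enstrophyAt u τ ≤ ∫ τ in Ioo 0 T, 4 * levelInt u 1 τ :=
        setIntegral_mono_on hyint (haint.const_mul 4) measurableSet_Ioo fun t ht => hpt t (Ioo_subset_Icc_self ht)
    _ = 4 * ∫ τ in Ioo 0 T, levelInt u 1 τ := integral_const_mul _ _
    _ ≤ 4 * (E / ν) := by
        gcongr
        rw [le_div_iff₀ hν]; linarith
    _ = 4 * E / ν := by ring

/-- **Hölder in time** (exponents `4`, `4/3`): with `q = z/(α+y)²`,
`∫₀ᵀ (y z)^{1/4} ≤ (∫₀ᵀ q)^{1/4} (αT + ∫₀ᵀ y)^{3/4}`, using `(yz)^{1/4} ≤ q^{1/4}(α + y)^{3/4}`.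
[folklore] -/
theorem StrongData.integral_rpow_quarter_le (d : StrongData T ν u) (h : IsClassicalNSSolutionOn (Icc 0 T) ν 0 u p)
    (hT : 0 < T) {α : ℝ} (hα : 0 < α) :
    ∫ τ in Ioo 0 T, (enstrophyAt u τ * palinstrophyAt u τ) ^ (1 / 4 : ℝ) ≤
      (∫ τ in Ioo 0 T, palinstrophyAt u τ / (α + enstrophyAt u τ) ^ 2) ^ (1 / 4 : ℝ) *
        (α * T + ∫ τ in Ioo 0 T, enstrophyAt u τ) ^ (3 / 4 : ℝ) := by
  have hy0 : ∀ t, 0 ≤ enstrophyAt u t := enstrophyAt_nonneg u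
  have hz0 : ∀ t, 0 ≤ palinstrophyAt u t := palinstrophyAt_nonneg u
  have hpos : ∀ t, 0 < α + enstrophyAt u t := fun t => by linarith [hy0 t]
  have hym := d.aestronglyMeasurable_enstrophyAt h hT
  have hzm := d.aestronglyMeasurable_palinstrophyAt h hT
  set f : ℝ → ℝ := fun τ => (palinstrophyAt u τ / (α + enstrophyAt u τ) ^ 2) ^ (1 / 4 : ℝ) with hf
  set g : ℝ → ℝ := fun τ => (α + enstrophyAt u τ) ^ (3 / 4 : ℝ) with hg
  have hq0 : ∀ τ, 0 ≤ palinstrophyAt u τ / (α + enstrophyAt u τ) ^ 2 := fun τ =>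
    div_nonneg (hz0 τ) (pow_pos (hpos τ) 2).le
  have hf0 : ∀ τ, 0 ≤ f τ := fun τ => Real.rpow_nonneg (hq0 τ) _
  have hg0 : ∀ τ, 0 ≤ g τ := fun τ => Real.rpow_nonneg (hpos τ).le _
  -- pointwise: `(yz)^{1/4} ≤ f g`
  have hpt : ∀ τ, (enstrophyAt u τ * palinstrophyAt u τ) ^ (1 / 4 : ℝ) ≤ f τ * g τ := by
    intro τ
    have hy := hy0 τ; have hz := hz0 τ; have hp := hpos τ
    have e : f τ * g τ = palinstrophyAt u τ ^ (1 / 4 : ℝ) * (α + enstrophyAt u τ) ^ (1 / 4 : ℝ) := by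
      simp only [hf, hg]
      rw [Real.div_rpow hz (pow_pos hp 2).le, show ((α + enstrophyAt u τ) ^ 2 : ℝ) =
        (α + enstrophyAt u τ) ^ (2 : ℝ) by norm_cast, ← Real.rpow_mul hp.le]
      rw [show (2 : ℝ) * (1 / 4) = 1 / 2 by norm_num]
      rw [div_mul_eq_mul_div, div_eq_iff (Real.rpow_pos_of_pos hp _).ne']
      rw [mul_assoc, ← Real.rpow_add hp]
      norm_num
    rw [e, Real.mul_rpow hy hz, mul_comm]
    exact mul_le_mul_of_nonneg_left (Real.rpow_le_rpow hy (by linarith) (by norm_num)) (Real.rpow_nonneg hz _)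
  -- Hölder
  have hpq : (4 : ℝ).HolderConjugate (4 / 3) := by rw [Real.holderConjugate_iff]; norm_num
  have hfm : AEStronglyMeasurable f (volume.restrict (Ioo 0 T)) :=
    ((Real.continuous_rpow_const (by norm_num)).measurable.comp_aemeasurable
      (hzm.aemeasurable.div ((aemeasurable_const.add hym.aemeasurable).pow_const 2))).aestronglyMeasurable
  have hgm : AEStronglyMeasurable g (volume.restrict (Ioo 0 T)) :=
    ((Real.continuous_rpow_const (by norm_num)).measurable.comp_aemeasurable
      (aemeasurable_const.add hym.aemeasurable)).aestronglyMeasurable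
  have hfb : ∀ τ ∈ Icc 0 T, |f τ| ≤ (4 * d.S 2 / α ^ 2) ^ (1 / 4 : ℝ) := by
    intro τ hτ
    rw [abs_of_nonneg (hf0 τ)]
    refine Real.rpow_le_rpow (hq0 τ) ?_ (by norm_num)
    exact div_le_div₀ (by have := d.S_nonneg 2; positivity) (d.palinstrophyAt_le h hτ) (by positivity)
      (pow_le_pow_left₀ hα.le (by linarith [hy0 τ]) 2)
  have hgb : ∀ τ ∈ Icc 0 T, |g τ| ≤ (α + 4 * d.S 1) ^ (3 / 4 : ℝ) := by
    intro τ hτ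
    rw [abs_of_nonneg (hg0 τ)]
    exact Real.rpow_le_rpow (hpos τ).le (by linarith [d.enstrophyAt_le h hτ]) (by norm_num)
  have hfL : MemLp f (ENNReal.ofReal 4) (volume.restrict (Ioo 0 T)) :=
    MemLp.of_bound hfm _ (by
      rw [ae_restrict_iff' measurableSet_Ioo]
      exact Eventually.of_forall fun τ hτ => by rw [Real.norm_eq_abs]; exact hfb τ (Ioo_subset_Icc_self hτ))
  have hgL : MemLp g (ENNReal.ofReal (4 / 3)) (volume.restrict (Ioo 0 T)) :=
    MemLp.of_bound hgm _ (by
      rw [ae_restrict_iff' measurableSet_Ioo]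
      exact Eventually.of_forall fun τ hτ => by rw [Real.norm_eq_abs]; exact hgb τ (Ioo_subset_Icc_self hτ))
  have hH := integral_mul_le_Lp_mul_Lq_of_nonneg hpq (ae_of_all _ hf0) (ae_of_all _ hg0) hfL hgL
  -- identify the two integrals
  have ef : ∫ τ in Ioo 0 T, f τ ^ (4 : ℝ) = ∫ τ in Ioo 0 T, palinstrophyAt u τ / (α + enstrophyAt u τ) ^ 2 := by
    refine integral_congr_ae (Eventually.of_forall fun τ => ?_)
    simp only [hf]
    rw [← Real.rpow_mul (hq0 τ)]; norm_num
  have eg : ∫ τ in Ioo 0 T, g τ ^ (4 / 3 : ℝ) = α * T + ∫ τ in Ioo 0 T, enstrophyAt u τ := by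
    have hyint : IntegrableOn (enstrophyAt u) (Ioo 0 T) := by
      refine integrableOn_Ioo_of_bound hym (M := 4 * d.S 1) fun t ht => ?_
      rw [abs_of_nonneg (hy0 t)]; exact d.enstrophyAt_le h ht
    calc ∫ τ in Ioo 0 T, g τ ^ (4 / 3 : ℝ) = ∫ τ in Ioo 0 T, (α + enstrophyAt u τ) := by
          refine integral_congr_ae (Eventually.of_forall fun τ => ?_)
          simp only [hg]
          rw [← Real.rpow_mul (hpos τ).le]; norm_num
      _ = α * T + ∫ τ in Ioo 0 T, enstrophyAt u τ := by
          have hc : IntegrableOn (fun _ : ℝ => α) (Ioo 0 T) := integrableOn_const (hs := measure_Ioo_lt_top.ne)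
          rw [integral_add hc.integrable hyint.integrable]
          simp [hT.le, mul_comm]
  -- integrability of `(yz)^{1/4}` for `setIntegral_mono`
  have hprod_m : AEStronglyMeasurable (fun τ => (enstrophyAt u τ * palinstrophyAt u τ) ^ (1 / 4 : ℝ))
      (volume.restrict (Ioo 0 T)) :=
    ((Real.continuous_rpow_const (by norm_num)).measurable.comp_aemeasurable
      (hym.aemeasurable.mul hzm.aemeasurable)).aestronglyMeasurable
  have hprod_int : IntegrableOn (fun τ => (enstrophyAt u τ * palinstrophyAt u τ) ^ (1 / 4 : ℝ)) (Ioo 0 T) := by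
    refine integrableOn_Ioo_of_bound hprod_m (M := (4 * d.S 1 * (4 * d.S 2)) ^ (1 / 4 : ℝ)) fun t ht => ?_
    rw [abs_of_nonneg (Real.rpow_nonneg (mul_nonneg (hy0 t) (hz0 t)) _)]
    exact Real.rpow_le_rpow (mul_nonneg (hy0 t) (hz0 t)) (mul_le_mul (d.enstrophyAt_le h ht)
      (d.palinstrophyAt_le h ht) (hz0 t) (by have := d.S_nonneg 1; positivity)) (by norm_num)
  have hfg_int : IntegrableOn (fun τ => f τ * g τ) (Ioo 0 T) := by
    refine integrableOn_Ioo_of_bound (hfm.mul hgm)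
      (M := (4 * d.S 2 / α ^ 2) ^ (1 / 4 : ℝ) * (α + 4 * d.S 1) ^ (3 / 4 : ℝ)) fun t ht => ?_
    rw [abs_mul]
    exact mul_le_mul (hfb t ht) (hgb t ht) (abs_nonneg _) (Real.rpow_nonneg (by have := d.S_nonneg 2; positivity) _)
  calc ∫ τ in Ioo 0 T, (enstrophyAt u τ * palinstrophyAt u τ) ^ (1 / 4 : ℝ) ≤ ∫ τ in Ioo 0 T, f τ * g τ :=
        setIntegral_mono_on hprod_int hfg_int measurableSet_Ioo fun τ _ => hpt τ
    _ ≤ (∫ τ in Ioo 0 T, f τ ^ (4 : ℝ)) ^ (1 / (4 : ℝ)) * (∫ τ in Ioo 0 T, g τ ^ (4 / 3 : ℝ)) ^ (1 / (4 / 3 : ℝ)) := hH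
    _ = _ := by rw [ef, eg]; norm_num


/-! ## Agmon along the solution, and the total speed bound -/

/-- **Agmon along a strong solution**: `|u(t,x)| ≤ A (y(t) z(t))^{1/4}`, from Agmon's inequality
`‖v‖_∞ ≤ A (a₁ a₂)^{1/4}` and the global div–curl bounds `a₁ ≤ y`, `a₂ ≤ z`. [folklore] -/
theorem StrongData.norm_apply_le (d : StrongData T ν u) (h : IsClassicalNSSolutionOn (Icc 0 T) ν 0 u p)
    {t : ℝ} (ht : t ∈ Icc 0 T) (x : ℝ³) :
    ‖u t x‖ ≤ FluidPDE.agmonConst * (enstrophyAt u t * palinstrophyAt u t) ^ (1 / 4 : ℝ) := by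
  have hv := h.contDiff_velocity ht
  have hA := FluidPDE.norm_apply_le_agmon hv (d.integrable_levelSq 0 t ht) (d.integrable_levelSq 1 t ht)
    (d.integrable_levelSq 2 t ht) x
  refine hA.trans (mul_le_mul_of_nonneg_left ?_ FluidPDE.agmonConst_nonneg)
  refine Real.rpow_le_rpow (mul_nonneg (levelInt_nonneg u 1 t) (levelInt_nonneg u 2 t)) ?_ (by norm_num)
  exact mul_le_mul (d.levelInt_one_le h ht) (d.levelInt_two_le h ht) (levelInt_nonneg u 2 t)
    (enstrophyAt_nonneg u t)

/-- The slice bound in `L^∞`: `‖u(t)‖_{L^∞} ≤ A (y(t) z(t))^{1/4}`. [folklore] -/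
theorem StrongData.eLpNorm_top_le (d : StrongData T ν u) (h : IsClassicalNSSolutionOn (Icc 0 T) ν 0 u p)
    {t : ℝ} (ht : t ∈ Icc 0 T) :
    eLpNorm (u t) ∞ volume ≤
      ENNReal.ofReal (FluidPDE.agmonConst * (enstrophyAt u t * palinstrophyAt u t) ^ (1 / 4 : ℝ)) := by
  rw [eLpNorm_exponent_top]
  exact eLpNormEssSup_le_of_ae_bound (Eventually.of_forall fun x => d.norm_apply_le h ht x)

/-- `(y z)^{1/4}` is integrable on `(0, T)` (bounded and measurable). [folklore] -/
theorem StrongData.integrableOn_rpow_quarter (d : StrongData T ν u) (h : IsClassicalNSSolutionOn (Icc 0 T) ν 0 u p)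
    (hT : 0 < T) :
    IntegrableOn (fun τ => (enstrophyAt u τ * palinstrophyAt u τ) ^ (1 / 4 : ℝ)) (Ioo 0 T) := by
  have hy0 : ∀ t, 0 ≤ enstrophyAt u t := enstrophyAt_nonneg u
  have hz0 : ∀ t, 0 ≤ palinstrophyAt u t := palinstrophyAt_nonneg u
  have hym := d.aestronglyMeasurable_enstrophyAt h hT
  have hzm := d.aestronglyMeasurable_palinstrophyAt h hT
  have hprod_m : AEStronglyMeasurable (fun τ => (enstrophyAt u τ * palinstrophyAt u τ) ^ (1 / 4 : ℝ))
      (volume.restrict (Ioo 0 T)) :=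
    ((Real.continuous_rpow_const (by norm_num)).measurable.comp_aemeasurable
      (hym.aemeasurable.mul hzm.aemeasurable)).aestronglyMeasurable
  refine integrableOn_Ioo_of_bound hprod_m (M := (4 * d.S 1 * (4 * d.S 2)) ^ (1 / 4 : ℝ)) fun t ht => ?_
  rw [abs_of_nonneg (Real.rpow_nonneg (mul_nonneg (hy0 t) (hz0 t)) _)]
  exact Real.rpow_le_rpow (mul_nonneg (hy0 t) (hz0 t)) (mul_le_mul (d.enstrophyAt_le h ht)
    (d.palinstrophyAt_le h ht) (hz0 t) (by have := d.S_nonneg 1; positivity)) (by norm_num)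

/-- `(x^{1/4})⁴ = x`. [folklore] -/
theorem rpow_quarter_pow_four {x : ℝ} (hx : 0 ≤ x) : (x ^ (1 / 4 : ℝ)) ^ 4 = x := by
  rw [← Real.rpow_natCast, ← Real.rpow_mul hx]; norm_num

/-- `(x^{3/4})⁴ = x³`. [folklore] -/
theorem rpow_three_quarters_pow_four {x : ℝ} (hx : 0 ≤ x) : (x ^ (3 / 4 : ℝ)) ^ 4 = x ^ 3 := by
  rw [← Real.rpow_natCast, ← Real.rpow_mul hx,
    show (3 / 4 : ℝ) * ((4 : ℕ) : ℝ) = ((3 : ℕ) : ℝ) by norm_num, Real.rpow_natCast]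

/-- `(x^{-3/4})⁴ = x⁻³` for `x > 0`. [folklore] -/
theorem rpow_neg_three_quarters_pow_four {x : ℝ} (hx : 0 < x) : (x ^ (-(3 / 4 : ℝ))) ^ 4 = x⁻¹ ^ 3 := by
  rw [← Real.rpow_natCast, ← Real.rpow_mul hx.le,
    show (-(3 / 4 : ℝ)) * ((4 : ℕ) : ℝ) = -((3 : ℕ) : ℝ) by norm_num, Real.rpow_neg hx.le,
    Real.rpow_natCast, inv_pow]

/-- `(√x)⁴ = x²`. [folklore] -/
theorem sqrt_pow_four {x : ℝ} (hx : 0 ≤ x) : Real.sqrt x ^ 4 = x ^ 2 := by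
  rw [show (4 : ℕ) = 2 * 2 from rfl, pow_mul, Real.sq_sqrt hx]

/-- The first scaling identity: `(T/E)^{1/4} (5E/ν)^{3/4} = 5^{3/4} ν^{-3/4} E^{1/2} T^{1/4}`. [folklore] -/
theorem scaling_identity_free {E ν T : ℝ} (hE : 0 < E) (hν : 0 < ν) (hT : 0 ≤ T) :
    (T / E) ^ (1 / 4 : ℝ) * (5 * E / ν) ^ (3 / 4 : ℝ) =
      (5 : ℝ) ^ (3 / 4 : ℝ) * (ν ^ (-(3 / 4 : ℝ)) * Real.sqrt E * T ^ (1 / 4 : ℝ)) := by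
  have h5 : (0 : ℝ) ≤ 5 * E / ν := by positivity
  rw [← pow_left_inj₀ (by positivity) (by positivity) (by norm_num : (4 : ℕ) ≠ 0)]
  rw [mul_pow, mul_pow, mul_pow, mul_pow, rpow_quarter_pow_four (by positivity),
    rpow_three_quarters_pow_four h5, rpow_three_quarters_pow_four (by norm_num),
    rpow_neg_three_quarters_pow_four hν, sqrt_pow_four hE.le, rpow_quarter_pow_four hT]
  field_simp

/-- The second scaling identity: `(4C E ν⁻⁵)^{1/4} (5E/ν)^{3/4} = (4C)^{1/4} 5^{3/4} ν⁻² E`. [folklore] -/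
theorem scaling_identity_nonlinear {C E ν : ℝ} (hC : 0 ≤ C) (hE : 0 < E) (hν : 0 < ν) :
    (4 * C * E * ν⁻¹ ^ 5) ^ (1 / 4 : ℝ) * (5 * E / ν) ^ (3 / 4 : ℝ) =
      (4 * C) ^ (1 / 4 : ℝ) * (5 : ℝ) ^ (3 / 4 : ℝ) * (ν⁻¹ ^ 2 * E) := by
  have h5 : (0 : ℝ) ≤ 5 * E / ν := by positivity
  have h4 : (0 : ℝ) ≤ 4 * C * E * ν⁻¹ ^ 5 := by positivity
  rw [← pow_left_inj₀ (by positivity) (by positivity) (by norm_num : (4 : ℕ) ≠ 0)]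
  rw [mul_pow, mul_pow, mul_pow, mul_pow, rpow_quarter_pow_four h4,
    rpow_three_quarters_pow_four h5, rpow_three_quarters_pow_four (by norm_num),
    rpow_quarter_pow_four (by positivity)]
  field_simp

/-- The constant of the strong total speed bound. [folklore] -/
noncomputable def speedConst : ℝ :=
  FluidPDE.agmonConst * ((5 : ℝ) ^ (3 / 4 : ℝ) * (1 + (4 * youngConst) ^ (1 / 4 : ℝ)))

/-- The speed constant is nonnegative. [folklore] -/
theorem speedConst_nonneg : 0 ≤ speedConst := by
  unfold speedConst
  have := FluidPDE.agmonConst_nonneg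
  have := youngConst_nonneg
  positivity

/-- **The real-variable core of the strong total speed bound**: with `α = E/(νT)`, Hölder in time,
the FGT dissipation bound and `∫₀ᵀ y ≤ 4E/ν` give
`∫₀ᵀ (y z)^{1/4} ≤ 5^{3/4}(1 + (4C_Y)^{1/4}) (ν^{-3/4} E^{1/2} T^{1/4} + ν⁻² E)`. [folklore] -/
theorem StrongData.integral_rpow_quarter_le_energy (d : StrongData T ν u) (h : IsClassicalNSSolutionOn (Icc 0 T) ν 0 u p)
    (hν : 0 < ν) (hT : 0 < T) {E : ℝ} (hE : 0 < E)
    (hD : ENNReal.ofReal ν * ∫⁻ t in Ioo 0 T, ∫⁻ x, ENNReal.ofReal (frobeniusNormSq (fderiv ℝ (u t) x)) ≤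
      ENNReal.ofReal E) :
    ∫ τ in Ioo 0 T, (enstrophyAt u τ * palinstrophyAt u τ) ^ (1 / 4 : ℝ) ≤
      (5 : ℝ) ^ (3 / 4 : ℝ) * (1 + (4 * youngConst) ^ (1 / 4 : ℝ)) *
        (ν ^ (-(3 / 4 : ℝ)) * Real.sqrt E * T ^ (1 / 4 : ℝ) + ν⁻¹ ^ 2 * E) := by
  obtain ⟨α, hα_def⟩ : ∃ α : ℝ, α = E / (ν * T) := ⟨_, rfl⟩
  have hα : 0 < α := by rw [hα_def]; positivity
  have hH := d.integral_rpow_quarter_le h hT hα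
  have hF := d.fgt_dissipation h hν hT hα
  have hEn := d.integral_enstrophyAt_le h hν hT hE.le hD
  obtain ⟨Q, hQ_def⟩ : ∃ Q : ℝ, Q = ∫ τ in Ioo 0 T, palinstrophyAt u τ / (α + enstrophyAt u τ) ^ 2 :=
    ⟨_, rfl⟩
  obtain ⟨Y, hY_def⟩ : ∃ Y : ℝ, Y = ∫ τ in Ioo 0 T, enstrophyAt u τ := ⟨_, rfl⟩
  rw [← hQ_def, ← hY_def] at hH hF
  rw [← hY_def] at hEn
  have hQ0 : 0 ≤ Q := by
    rw [hQ_def]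
    exact integral_nonneg fun τ => div_nonneg (palinstrophyAt_nonneg u τ) (sq_nonneg _)
  have hY0 : 0 ≤ Y := by rw [hY_def]; exact integral_nonneg fun τ => enstrophyAt_nonneg u τ
  have hC0 := youngConst_nonneg
  -- `Q ≤ T/E + 4 C_Y E ν⁻⁵`
  have hQle : Q ≤ T / E + 4 * youngConst * E * ν⁻¹ ^ 5 := by
    have hαinv : α⁻¹ = ν * T / E := by rw [hα_def, inv_div]
    have h2 : youngConst * ν⁻¹ ^ 3 * Y ≤ youngConst * ν⁻¹ ^ 3 * (4 * E / ν) :=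
      mul_le_mul_of_nonneg_left hEn (by positivity)
    have h3 : ν * Q ≤ ν * T / E + youngConst * ν⁻¹ ^ 3 * (4 * E / ν) := by
      rw [← hαinv]; exact hF.trans (by linarith)
    have h4 : ν * T / E + youngConst * ν⁻¹ ^ 3 * (4 * E / ν) =
        ν * (T / E + 4 * youngConst * E * ν⁻¹ ^ 5) := by
      field_simp
    rw [h4] at h3
    exact le_of_mul_le_mul_left h3 hν
  -- `αT + Y ≤ 5E/ν`
  have hPle : α * T + Y ≤ 5 * E / ν := by
    have : α * T = E / ν := by rw [hα_def]; field_simp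
    rw [this]
    have : E / ν + 4 * E / ν = 5 * E / ν := by ring
    linarith
  have hP0 : 0 ≤ α * T + Y := by positivity
  -- combine
  have hq1 : 0 ≤ T / E := by positivity
  have hq2 : 0 ≤ 4 * youngConst * E * ν⁻¹ ^ 5 := by positivity
  set X₁ := ν ^ (-(3 / 4 : ℝ)) * Real.sqrt E * T ^ (1 / 4 : ℝ) with hX₁
  set X₂ := ν⁻¹ ^ 2 * E with hX₂
  have hX₁0 : 0 ≤ X₁ := by
    have := Real.rpow_nonneg hν.le (-(3 / 4 : ℝ))
    positivity
  have hX₂0 : 0 ≤ X₂ := by positivity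
  have hc4 : 0 ≤ (4 * youngConst) ^ (1 / 4 : ℝ) := Real.rpow_nonneg (by positivity) _
  have h5 : 0 ≤ (5 : ℝ) ^ (3 / 4 : ℝ) := Real.rpow_nonneg (by norm_num) _
  calc ∫ τ in Ioo 0 T, (enstrophyAt u τ * palinstrophyAt u τ) ^ (1 / 4 : ℝ)
      ≤ Q ^ (1 / 4 : ℝ) * (α * T + Y) ^ (3 / 4 : ℝ) := hH
    _ ≤ (T / E + 4 * youngConst * E * ν⁻¹ ^ 5) ^ (1 / 4 : ℝ) * (5 * E / ν) ^ (3 / 4 : ℝ) :=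
        mul_le_mul (Real.rpow_le_rpow hQ0 hQle (by norm_num)) (Real.rpow_le_rpow hP0 hPle (by norm_num))
          (Real.rpow_nonneg hP0 _) (Real.rpow_nonneg (hq1.trans (le_add_of_nonneg_right hq2)) _)
    _ ≤ ((T / E) ^ (1 / 4 : ℝ) + (4 * youngConst * E * ν⁻¹ ^ 5) ^ (1 / 4 : ℝ)) *
          (5 * E / ν) ^ (3 / 4 : ℝ) :=
        mul_le_mul_of_nonneg_right (Real.rpow_add_le_add_rpow hq1 hq2 (by norm_num) (by norm_num))
          (Real.rpow_nonneg (by positivity) _)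
    _ = (5 : ℝ) ^ (3 / 4 : ℝ) * X₁ + (4 * youngConst) ^ (1 / 4 : ℝ) * (5 : ℝ) ^ (3 / 4 : ℝ) * X₂ := by
        rw [add_mul, scaling_identity_free hE hν hT.le, scaling_identity_nonlinear hC0 hE hν]
    _ ≤ (5 : ℝ) ^ (3 / 4 : ℝ) * (1 + (4 * youngConst) ^ (1 / 4 : ℝ)) * (X₁ + X₂) := by
        have e : (5 : ℝ) ^ (3 / 4 : ℝ) * (1 + (4 * youngConst) ^ (1 / 4 : ℝ)) * (X₁ + X₂) =
            (5 : ℝ) ^ (3 / 4 : ℝ) * X₁ + (4 * youngConst) ^ (1 / 4 : ℝ) * (5 : ℝ) ^ (3 / 4 : ℝ) * X₂ +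
              ((5 : ℝ) ^ (3 / 4 : ℝ) * (4 * youngConst) ^ (1 / 4 : ℝ) * X₁ + (5 : ℝ) ^ (3 / 4 : ℝ) * X₂) := by
          ring
        rw [e]
        have : 0 ≤ (5 : ℝ) ^ (3 / 4 : ℝ) * (4 * youngConst) ^ (1 / 4 : ℝ) * X₁ + (5 : ℝ) ^ (3 / 4 : ℝ) * X₂ := by
          positivity
        linarith

/-- **Bounded total speed for strong solutions** (the conclusion of Tao 2011, Prop. 9.1, in the
class of strong solutions, by the Foias–Guillopé–Temam argument): for a classical solution on
`[0, T] × ℝ³` carrying `StrongData` and with energy dissipation `ν ∫₀ᵀ∫|∇u|² ≤ E` (`E > 0`),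
`∫₀ᵀ ‖u(t)‖_{L^∞} dt ≤ K (ν^{-3/4} E^{1/2} T^{1/4} + ν⁻² E)` with the absolute constant
`K = speedConst`. [cite: RobinsonRodrigoSadowski2016, Lemma 8.15 + Thm. 8.17 (proof)] -/
theorem StrongData.lintegral_eLpNorm_top_le (d : StrongData T ν u) (h : IsClassicalNSSolutionOn (Icc 0 T) ν 0 u p)
    (hν : 0 < ν) (hT : 0 < T) {E : ℝ} (hE : 0 < E)
    (hD : ENNReal.ofReal ν * ∫⁻ t in Ioo 0 T, ∫⁻ x, ENNReal.ofReal (frobeniusNormSq (fderiv ℝ (u t) x)) ≤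
      ENNReal.ofReal E) :
    ∫⁻ t in Ioo 0 T, eLpNorm (u t) ∞ volume ≤
      ENNReal.ofReal (speedConst * (ν ^ (-(3 / 4 : ℝ)) * Real.sqrt E * T ^ (1 / 4 : ℝ) + ν⁻¹ ^ 2 * E)) := by
  have hint := d.integrableOn_rpow_quarter h hT
  have hpt : ∀ᵐ t ∂(volume.restrict (Ioo 0 T)), eLpNorm (u t) ∞ volume ≤
      ENNReal.ofReal (FluidPDE.agmonConst * (enstrophyAt u t * palinstrophyAt u t) ^ (1 / 4 : ℝ)) := by
    rw [ae_restrict_iff' measurableSet_Ioo]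
    exact Eventually.of_forall fun t ht => d.eLpNorm_top_le h (Ioo_subset_Icc_self ht)
  have hnn : 0 ≤ᵐ[volume.restrict (Ioo 0 T)]
      fun t => FluidPDE.agmonConst * (enstrophyAt u t * palinstrophyAt u t) ^ (1 / 4 : ℝ) :=
    Eventually.of_forall fun t => mul_nonneg FluidPDE.agmonConst_nonneg
      (Real.rpow_nonneg (mul_nonneg (enstrophyAt_nonneg u t) (palinstrophyAt_nonneg u t)) _)
  calc ∫⁻ t in Ioo 0 T, eLpNorm (u t) ∞ volume
      ≤ ∫⁻ t in Ioo 0 T, ENNReal.ofReal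
          (FluidPDE.agmonConst * (enstrophyAt u t * palinstrophyAt u t) ^ (1 / 4 : ℝ)) := lintegral_mono_ae hpt
    _ = ENNReal.ofReal (∫ t in Ioo 0 T,
          FluidPDE.agmonConst * (enstrophyAt u t * palinstrophyAt u t) ^ (1 / 4 : ℝ)) :=
        (ofReal_integral_eq_lintegral_ofReal (hint.const_mul _) hnn).symm
    _ ≤ _ := by
        refine ENNReal.ofReal_le_ofReal ?_
        rw [integral_const_mul, speedConst, mul_assoc]
        exact mul_le_mul_of_nonneg_left (d.integral_rpow_quarter_le_energy h hν hT hE hD)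
          FluidPDE.agmonConst_nonneg

end Facts
end Literature.Analysis.FluidPDE

/-! ## The packaged statement -/

namespace Literature.Analysis.FluidPDE


local notation "ℝ³" => EuclideanSpace ℝ (Fin 3)

/-- **Tao 2011, Prop. 9.1 (bounded total speed) in the class of strong solutions — PROVED.**
There is an absolute constant `K > 0` such that for every `ν > 0`, `T > 0` and every classical
solution `u` of the (`f = 0`) Navier–Stokes system on the closed slab `[0, T] × ℝ³` with
`u ∈ L^∞_t H^k_x` for all `k` (`HasBoundedSobolevNormsOn`) and energy dissipation
`ν ∫₀ᵀ ∫ |∇u|² ≤ E` (`E > 0`), the total speed obeys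
`∫₀ᵀ ‖u(t)‖_{L^∞_x} dt ≤ K (ν^{-3/4} E^{1/2} T^{1/4} + ν⁻² E)` — the bound printed in Prop. 9.1
(arXiv Prop. 52, p. 27, `ν = 1`: `≲ E^{1/2}T^{1/4} + E`, rescaled by footnote 3), here obtained
not by Tao's Littlewood–Paley argument but by the Foias–Guillopé–Temam normalised-enstrophy
estimate `ν∫₀ᵀ ‖∇ω‖²/(α + ‖ω‖²)² ≤ α⁻¹ + Cν⁻³∫₀ᵀ‖ω‖²` (Robinson–Rodrigo–Sadowski 2016,
Lemma 8.15), Agmon's inequality `‖u‖_∞ ≲ ‖∇u‖₂^{1/2}‖∇²u‖₂^{1/2}` (ibid., Thm. 1.20), the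
div–curl bounds and Hölder's inequality in time with `α = E/(νT)` (ibid., proof of Thm. 8.17,
which derives `u ∈ L¹(0,T;L^∞)` for strong solutions this way). Only the dissipation bound is
used (no hypothesis on `‖u(t)‖_{L²}` is needed). [cite: RobinsonRodrigoSadowski2016, Lemma 8.15 + Thm. 8.17; Tao2011, Prop. 9.1 (statement)] -/
theorem tao2011_boundedTotalSpeed_of_hasBoundedSobolevNormsOn :
    ∃ K : ℝ, 0 < K ∧
      ∀ ⦃ν : ℝ⦄ (_hν : 0 < ν) ⦃T : ℝ⦄ (_hT : 0 < T) ⦃u : ℝ → ℝ³ → ℝ³⦄ ⦃p : ℝ → ℝ³ → ℝ⦄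
        (_hsol : IsClassicalNSSolutionOn (Icc 0 T) ν 0 u p)
        (_hHB : HasBoundedSobolevNormsOn (Icc 0 T) u)
        ⦃E : ℝ⦄ (_hE : 0 < E)
        (_hD : ENNReal.ofReal ν *
            ∫⁻ t in Ioo 0 T, ∫⁻ x, ENNReal.ofReal (frobeniusNormSq (fderiv ℝ (u t) x)) ≤
          ENNReal.ofReal E),
        ∫⁻ t in Ioo 0 T, eLpNorm (u t) ∞ volume ≤
          ENNReal.ofReal (K * (ν ^ (-(3 / 4 : ℝ)) * Real.sqrt E * T ^ (1 / 4 : ℝ) + ν⁻¹ ^ 2 * E)) := by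
  refine ⟨speedConst + 1, by have := speedConst_nonneg; linarith, ?_⟩
  intro ν hν T hT u p hsol hHB E hE hD
  obtain ⟨d⟩ := hsol.nonempty_strongData hT hHB
  refine (d.lintegral_eLpNorm_top_le hsol hν hT hE hD).trans (ENNReal.ofReal_le_ofReal ?_)
  have hX : 0 ≤ ν ^ (-(3 / 4 : ℝ)) * Real.sqrt E * T ^ (1 / 4 : ℝ) + ν⁻¹ ^ 2 * E := by
    have := Real.rpow_nonneg hν.le (-(3 / 4 : ℝ))
    positivity
  nlinarith

end Literature.Analysis.FluidPDE
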